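import Mathlib
import Summits.ValiantsHypothesis.ValiantsHypothesis.Cruxes.NNLinearDegreeCofactorHard.Lines.xc_division
import Literature.Barriers.PneNP.TSPExtensionComplexityHyperplaneBound
import Literature.Barriers.PneNP.ExtendedFormulationLinearImage
import Literature.Barriers.PneNP.TSPExtensionComplexityKaibelWeltge
import Summits.ValiantsHypothesis.ValiantsHypothesis.Theorems.FifoMatchingGridCorShadowOfCliqueFace

/-! # Exact pencils (val-idea-38 g2, W6-P1; crux `FifoMatching.NNDivisionHard`, stmt-ValiantsHypothesis-21181)

W6-P1 (R303 (3)): «located families over normal-cone rows of coordinate faces WITH EXACT RHS».  Narrative, dead ends, enemy spec: memo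
`ExactPencil38.md`; this docstring is the INDEX.  Chain `cliqueRows.Law` ✗ `⟹ diagTilted.Law` ✗ `⟹ LocatedPencilLaw` ✗ (N22) `⟹ ExactPencilLaw` (= C′,
OPEN) `⟹ allRows.Law ⟹ CorVirtualHardN`.  Nothing here proves or refutes the crux; VP ≠ VNP is NOT proved.

* §0 VERBATIM `CliqueRowBlind.lean` rev 6 §4 (39 g3: `RowFamily`, `.Law`, `corVirtualHardN_of_law`, `.Emb`, `.Law.mono`, `entryTilted`, `allRows`,
  `LocatedPencilLaw`, `CorVirtualHardN`) · §1 `hCOR` (exact support value on `COR(n)`) · §2 `exactTilted`, ★ `ExactPencilLaw := exactTilted.Law` ·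
  §3 ★ `RowFamily.Law.of_tightening`, ★ `exactPencilLaw_of_locatedPencilLaw`, `exact_law_chain` · §4 pair cube `gPair`/`qPair`, pairing direction `dPair` ·
  §5 ★★★ `exactTilted_law_holds_on_qPair` (law currency; `three_pow_le_of_block`, `T_lt_of_block_half`) · §6 ★★ `pinnedRowsLaw_iff_exactPencilLaw` ·
  §7 ★★ `hCOR_eq_box_iff`, `hCOR_dPair_lt_box` · §8 ★★★ `cor_add_qPair_decided` · §9/§9b ★★★ `cor_add_zgenCube_decided` / `cor_add_scaledZgenCube_decided`
  (TRANSVERSAL face `W^z`) · §10 ★★ transversal-face TEMPLATE CEILING `no_exact_column_of_interDiff` (names `Q_II`, decided in §12) ·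
  §11 ★★ TOGETHER FACES (`bUn`, `Wtog`, `hCOR_Wtog`, `ud_block_tog`, `Pins`, `cor_add_cube_bound_of_pinning`) ·
  §12 ★★★ W7-K1 `exists_witness_of_sparse`, `exists_reads_ne_of_closed`, `exists_pins_of_sparse`, ★★★ `cor_add_sparseCube_bound : 3^k ≤ (r+1)·2^k`;
  §12b rates: `βstd`/`σstd`, `T_lt_of_block_div`, ★★★ `cor_add_sparseCube_decided (s c)`; (rev 18) UNIFORM `T_succ_mul_two_pow_lt` / `T_lt_of_block_uniform`
  (`k ≥ 2(log₂ n + c)^c + 6`, every `n`) and ★★★ THE WINDOW CLOSED FROM ABOVE `cor_add_sparseCube_decided_window` (`s·(2(log₂ n + c)^c + 6) ≤ n`,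
  supports `< s` ⇒ `T c n < r`; R334 (2) prover half), `cor_add_sparseDiff_decided_window` (§12e).
* §12c (rev 14–17) ★★★ FORCED-OUT SETS (memo §2g faces `F_{Z,β}`): dead blocks `D` (`Z = β⁻¹(D)`), live face `{b_S : S ∩ D = ∅}` exposed by
  `W^β − I_Z` (`WD`, `WD_face_or_le_neg_one`), readers `E_{xy}` with a dead row or column (`Es_faceZeroD`); ENGINE over the live blocks in the
  LITERAL LAW-BODY CURRENCY of `exactTilted` (rev 17) `lawBody_bound_of_commonMaxD` and at the top law `cor_add_bound_of_commonMaxD :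
  3^{k−|D|} ≤ (r+1)·2^{k−|D|}`; GENERICITY in EDGE FORM = CLAIM α in kernel (rev 16) ★★★ `exists_commonMax_of_edgesReadD` (neighbour structure
  `N` + CONE CERTIFICATE `q_{j'} − q_j ∈ cone{q_e − q_j : e ∈ N j}` — any polytope's 1-skeleton, a cube's generator flips, `PM(K_n)`'s alternating
  cycles — every nonzero EDGE direction read ⇒ a face-tight `W` with a common maximiser; two-scale lexicographic maximiser), pair form
  `exists_commonMax_of_pairsReadD` (`N = univ`), ★★★ `cor_add_bound_of_edgesReadD`, ★★★ C′-currency `exactTilted_lawBody_of_edgesReadD` (rev 17),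
  witness `exists_witnessD`, ★★★ `cor_add_bound_of_pairsReadD`, ★★★ `cor_add_touchOrSparse_bound`.
* §12d–§12e the case `D = ∅`: `cor_add_bound_of_commonMax`, `cor_add_decided_of_commonMax`, `exists_commonMax_of_pairsRead`,
  ★★★ `cor_add_bound_of_pairsRead`, ★★★ `cor_add_sparseDiff_bound`, rate `cor_add_sparseDiff_decided (s c)` (pairwise differences of column support `< s`).
* §12f ★★★ `cor_add_touchOrSparse_decided (s c)` (`∀ Z, 2|Z| ≤ n/s →` every nonzero difference entry in a column of `Z` or in `< s` columns `→ … → T c n < r`).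
* §12g ★★★ COLUMN-HIT (singleton live blocks): `cor_add_bound_of_columnHit : 3^{n−|Z|} ≤ (r+1)·2^{n−|Z|}`, `cor_add_columnHit_decided (c)`,
  ★★★ `cor_add_fewVertex_decided (c)` (EVERY passenger with `2·|ι|² ≤ n` vertices, any shape), ★★★ `cor_add_cut_bound` (`COR(n) + CUT(n)`, `cutMat`).
* §12h ★★★ FUNCTION GRAPHS (`graphMat`; `PM(K_n)`, Birkhoff, any family of maps): `cor_add_funcGraph_bound : 3^k ≤ (r+1)·2^k` (blocks of size `≥ 2`,
  row-move readers `exists_faceZero_reads_graphMat`), `cor_add_funcGraph_decided (c)` (`k = ⌊n/2⌋`), C′-currency `exactTilted_lawBody_funcGraph (c)` (rev 17). -/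

set_option linter.dupNamespace false

namespace Summit.ValiantsHypothesis.ValiantsHypothesis.Cruxes.NNDivisionHard.ExactPencil

open Matrix Finset
open Literature.Barriers.PneNP (HasEFOfSize three_pow_le_card_mul_two_pow_of_cover_univ)
open Summit.ValiantsHypothesis.ValiantsHypothesis.Theorems.FifoMatching.GridCorShadow (four_T_lt_two_pow)
open Literature.Combinatorics.Optimization.FixedSizePsdRank
  (corPolytope flat vecOuter flat_dotProduct_le_of_mem_corPolytope flat_dotProduct_vecOuter)
open Summit.ValiantsHypothesis.ValiantsHypothesis.Cruxes.NNLinearDegreeCofactorHard.XcDivision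
  (udRow udPt udInd udMat ud_data udInd_apply udInd_sq T dot_le_of_mem_convexHull flat_dotProduct_flat)
open scoped Pointwise

/-! ## §0 Row-family laws — VERBATIM from `CliqueRowBlind.lean` rev 6 §4 (val-idea-39 g3), not importable on the farm -/
section RowFamilies

/-- COR-VIRTUAL in the flat `corPolytope n` currency — VERBATIM `RecourseGraph.CorVirtualHardN` (val-idea-39 g2 workfile
`Cruxes/NNDivisionHard/RecourseGraph.lean` §3 @7e0b5a907a4c, where `corVirtualHard_of_matrixLaw`-style bridges connect it to the
line's graph currency); restated only because that module is not importable on the farm snapshot. -/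
def CorVirtualHardN : Prop :=
  ∀ c : ℕ, ∃ n₀ : ℕ, ∀ n ≥ n₀, ∀ (K : ℕ) (q : Fin (K + 1) → (Fin (n * n) → ℝ)) (r : ℕ),
    HasEFOfSize (corPolytope n + convexHull ℝ (Set.range q)) r →
      HasEFOfSize (convexHull ℝ (Set.range q)) r → T c n < r

/-- A ROW FAMILY for the correlation polytopes: index types `A n`, directions `ρ n a`, right-hand sides `β n a`
valid on `COR(n)`. -/
structure RowFamily where
  A : ℕ → Type
  ρ : ∀ n, A n → (Fin (n * n) → ℝ)
  β : ∀ n, A n → ℝ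
  valid : ∀ n (a : A n), ∀ x ∈ corPolytope n, ρ n a ⬝ᵥ x ≤ β n a

/-- **THE `F`-ROW LAW.**  Eventually in `n`: for every passenger `Q = conv{q_j}` with an EF of size `r`, writing
`m a = max_j ⟨ρ a, q_j⟩`, if the augmented `F`-row slack `(β a + m a) − ⟨ρ a, x_b + q_j⟩` of `COR(n) + Q` has a nonnegative
factorization through `r + 1` slots then `T c n < r`. -/
def RowFamily.Law (F : RowFamily) : Prop :=
  ∀ c : ℕ, ∃ n₀ : ℕ, ∀ n ≥ n₀, ∀ (K : ℕ) (q : Fin (K + 1) → (Fin (n * n) → ℝ)) (r : ℕ),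
    HasEFOfSize (convexHull ℝ (Set.range q)) r →
    ∀ m : F.A n → ℝ, (∀ a j, F.ρ n a ⬝ᵥ q j ≤ m a) → (∀ a, ∃ j, F.ρ n a ⬝ᵥ q j = m a) →
    ∀ (U : F.A n → Option (Fin r) → ℝ) (V : Finset (Fin n) × Fin (K + 1) → Option (Fin r) → ℝ),
      (∀ a i, 0 ≤ U a i) → (∀ p i, 0 ≤ V p i) →
      (∀ a b j, (F.β n a + m a) - F.ρ n a ⬝ᵥ (udPt b + q j) = ∑ i, U a i * V (b, j) i) → T c n < r

/-- ★ **EVERY ROW-FAMILY LAW IMPLIES COR-VIRTUAL** (Yannakakis' factorization theorem, once). -/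
theorem corVirtualHardN_of_law (F : RowFamily) (hL : F.Law) : CorVirtualHardN := by
  classical
  intro c
  obtain ⟨n₀, hn₀⟩ := hL c
  refine ⟨n₀, fun n hn K q r hR hQ => ?_⟩
  obtain ⟨pt_mem, -, -, -⟩ := ud_data n
  let m : F.A n → ℝ := fun a =>
    Finset.univ.sup' Finset.univ_nonempty (fun j : Fin (K + 1) => F.ρ n a ⬝ᵥ q j)
  have hmax : ∀ a, ∃ j, F.ρ n a ⬝ᵥ q j = m a := fun a => by
    obtain ⟨j, -, hj⟩ := Finset.exists_mem_eq_sup' Finset.univ_nonempty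
      (fun j : Fin (K + 1) => F.ρ n a ⬝ᵥ q j)
    exact ⟨j, hj.symm⟩
  have hmq : ∀ a j, F.ρ n a ⬝ᵥ q j ≤ m a := fun a j =>
    Finset.le_sup' (fun j : Fin (K + 1) => F.ρ n a ⬝ᵥ q j) (Finset.mem_univ j)
  have hm : ∀ a, ∀ y ∈ convexHull ℝ (Set.range q), F.ρ n a ⬝ᵥ y ≤ m a := fun a =>
    dot_le_of_mem_convexHull _ _ _ (by rintro _ ⟨j, rfl⟩; exact hmq a j)
  have hq : ∀ j, q j ∈ convexHull ℝ (Set.range q) := fun j => subset_convexHull ℝ _ ⟨j, rfl⟩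
  have hv : ∀ p : Finset (Fin n) × Fin (K + 1),
      udPt p.1 + q p.2 ∈ corPolytope n + convexHull ℝ (Set.range q) :=
    fun p => Set.add_mem_add (pt_mem p.1) (hq p.2)
  have hvalid : ∀ a, ∀ x ∈ corPolytope n + convexHull ℝ (Set.range q), F.ρ n a ⬝ᵥ x ≤ F.β n a + m a := by
    rintro a x ⟨p, hp, y, hy, rfl⟩
    rw [dotProduct_add]
    exact add_le_add (F.valid n a p hp) (hm a y hy)
  obtain ⟨U, V, hU, hV, hfac⟩ := Literature.Barriers.PneNP.HasEFOfSize.exists_nonneg_factorization hR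
    (fun p : Finset (Fin n) × Fin (K + 1) => udPt p.1 + q p.2) hv (F.ρ n) (fun a => F.β n a + m a) hvalid
  exact hn₀ n hn K q r hQ m hmq hmax U V hU hV (fun a b j => hfac a (b, j))

/-- An EMBEDDING of row families: `G` contains (copies of) all rows of `F`. -/
structure RowFamily.Emb (F G : RowFamily) where
  φ : ∀ n, F.A n → G.A n
  ρ_eq : ∀ n a, G.ρ n (φ n a) = F.ρ n a
  β_eq : ∀ n a, G.β n (φ n a) = F.β n a

/-- ★ **LAWS ARE MONOTONE**: a law for a SMALLER row family is a STRONGER statement (its factorizations are restrictions). -/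
theorem RowFamily.Law.mono {F G : RowFamily} (e : RowFamily.Emb F G) (hF : F.Law) : G.Law := by
  intro c
  obtain ⟨n₀, hn₀⟩ := hF c
  refine ⟨n₀, fun n hn K q r hQ m hmq hmax U V hU hV hfac => ?_⟩
  refine hn₀ n hn K q r hQ (fun a => m (e.φ n a)) (fun a j => ?_) (fun a => ?_)
    (fun a => U (e.φ n a)) V (fun a i => hU _ i) hV (fun a b j => ?_)
  · rw [← e.ρ_eq n a]; exact hmq _ j
  · obtain ⟨j, hj⟩ := hmax (e.φ n a); exact ⟨j, by rw [← e.ρ_eq n a]; exact hj⟩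
  · rw [← e.ρ_eq n a, ← e.β_eq n a]; exact hfac _ b j

/-- box validity: `⟨flat W, x⟩ ≤ Σ_{i,m} max(W_im, 0)` on `COR(n)`. -/
theorem flat_le_box {n : ℕ} (W : Matrix (Fin n) (Fin n) ℝ) :
    ∀ x ∈ corPolytope n, flat W ⬝ᵥ x ≤ ∑ i, ∑ m, max (W i m) 0 := by
  intro y hy
  refine flat_dotProduct_le_of_mem_corPolytope hy ⟨(W, ∑ i, ∑ m, max (W i m) 0), fun x hx => ?_⟩
  refine Finset.sum_le_sum fun i _ => Finset.sum_le_sum fun m _ => ?_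
  rcases hx i with hi | hi <;> rcases hx m with hm | hm <;> simp [hi, hm]

/-- ★ **C⁺ = `LocatedPencilLaw` := `entryTilted.Law`** — clique rows tilted by an ARBITRARY matrix direction with the box
right-hand side: `udRow a + flat W ≤ 1 + Σ max(W_im, 0)`.  Contains `diagTilted` (diagonal `W`) and the switched-face
reads `W = ±E_im` of `SwitchFace.lean`; strictly inside `allRows` (box right-hand sides only). -/
@[reducible] def entryTilted : RowFamily where
  A := fun n => Finset (Fin n) × Matrix (Fin n) (Fin n) ℝ
  ρ := fun _ a => udRow a.1 + flat a.2
  β := fun _ a => 1 + ∑ i, ∑ m, max (a.2 i m) 0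
  valid := fun n a x hx => by
    rw [add_dotProduct]
    exact add_le_add ((ud_data n).2.1 a.1 x hx) (flat_le_box a.2 x hx)

/-- ALL valid rows (its law is COR-VIRTUAL in Yannakakis form; only `⟹` is recorded here, via `corVirtualHardN_of_law`). -/
@[reducible] def allRows : RowFamily where
  A := fun n => {cd : (Fin (n * n) → ℝ) × ℝ // ∀ x ∈ corPolytope n, cd.1 ⬝ᵥ x ≤ cd.2}
  ρ := fun _ a => a.1.1
  β := fun _ a => a.1.2
  valid := fun _ a => a.2

/-- `C⁺ := entryTilted.Law` under its card name. -/
def LocatedPencilLaw : Prop := entryTilted.Law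

/-- `entryTilted ↪ allRows`. -/
def entryTilted_emb_allRows : RowFamily.Emb entryTilted allRows where
  φ := fun n a => ⟨(entryTilted.ρ n a, entryTilted.β n a), entryTilted.valid n a⟩
  ρ_eq := fun _ _ => rfl
  β_eq := fun _ _ => rfl


end RowFamilies

/-! ## §1 The exact support value `h_COR(W)` -/

/-- the EXACT support value of the matrix direction `W` on `COR(n)`: `h_COR(W) = max_b ⟨flat W, 𝟙_b𝟙_bᵀ⟩`. -/
noncomputable def hCOR {n : ℕ} (W : Matrix (Fin n) (Fin n) ℝ) : ℝ :=
  Finset.univ.sup' Finset.univ_nonempty (fun b : Finset (Fin n) => flat W ⬝ᵥ udPt b)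

theorem le_hCOR {n : ℕ} (W : Matrix (Fin n) (Fin n) ℝ) (b : Finset (Fin n)) :
    flat W ⬝ᵥ udPt b ≤ hCOR W :=
  Finset.le_sup' (fun b : Finset (Fin n) => flat W ⬝ᵥ udPt b) (Finset.mem_univ b)

/-- the maximum is ATTAINED at a vertex (exactness of the right-hand side). -/
theorem exists_eq_hCOR {n : ℕ} (W : Matrix (Fin n) (Fin n) ℝ) :
    ∃ b : Finset (Fin n), flat W ⬝ᵥ udPt b = hCOR W := by
  obtain ⟨b, -, hb⟩ := Finset.exists_mem_eq_sup' Finset.univ_nonempty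
    (fun b : Finset (Fin n) => flat W ⬝ᵥ udPt b)
  exact ⟨b, hb.symm⟩

/-- validity of the exact row `flat W ≤ h_COR(W)` on `COR(n)`. -/
theorem flat_le_hCOR {n : ℕ} (W : Matrix (Fin n) (Fin n) ℝ) :
    ∀ x ∈ corPolytope n, flat W ⬝ᵥ x ≤ hCOR W := by
  classical
  intro y hy
  refine flat_dotProduct_le_of_mem_corPolytope hy ⟨(W, hCOR W), fun x hx => ?_⟩
  let b : Finset (Fin n) := Finset.univ.filter (fun i => x i = 1)
  have hxb : udInd b = x := by
    funext i
    rw [udInd_apply]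
    rcases hx i with h | h
    · have : i ∉ b := by simp [b, h]
      rw [if_neg this, h]
    · have : i ∈ b := by simp [b, h]
      rw [if_pos this, h]
  have key : flat W ⬝ᵥ udPt b = ∑ i, ∑ j, W i j * (x i * x j) := by
    show flat W ⬝ᵥ vecOuter n (udInd b) = _
    rw [flat_dotProduct_vecOuter, hxb]
  have := le_hCOR W b
  rw [key] at this
  exact this

/-- `h_COR(W) ≤ Σ max(W_im, 0)`: the exact rhs is TIGHTER than the box rhs. -/
theorem hCOR_le_box {n : ℕ} (W : Matrix (Fin n) (Fin n) ℝ) : hCOR W ≤ ∑ i, ∑ m, max (W i m) 0 := by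
  obtain ⟨b, hb⟩ := exists_eq_hCOR W
  rw [← hb]
  exact flat_le_box W _ ((ud_data n).1 b)

/-! ## §2 The exact pencil family and its law -/

/-- ★ the EXACTLY TILTED clique rows `udRow a + flat W ≤ 1 + h_COR(W)` (every matrix direction, exact support value). -/
@[reducible] noncomputable def exactTilted : RowFamily where
  A := fun n => Finset (Fin n) × Matrix (Fin n) (Fin n) ℝ
  ρ := fun _ a => udRow a.1 + flat a.2
  β := fun _ a => 1 + hCOR a.2
  valid := fun n a x hx => by
    rw [add_dotProduct]
    exact add_le_add ((ud_data n).2.1 a.1 x hx) (flat_le_hCOR a.2 x hx)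

/-- ★ `ExactPencilLaw := exactTilted.Law` — the exact-rhs successor of C⁺_entry = `LocatedPencilLaw`. -/
def ExactPencilLaw : Prop := exactTilted.Law

/-- `exactTilted ↪ allRows`. -/
noncomputable def exactTilted_emb_allRows : RowFamily.Emb exactTilted allRows where
  φ := fun n a => ⟨(exactTilted.ρ n a, exactTilted.β n a), exactTilted.valid n a⟩
  ρ_eq := fun _ _ => rfl
  β_eq := fun _ _ => rfl

/-- `ExactPencilLaw ⟹ allRows.Law`. -/
theorem allRowsLaw_of_exactPencilLaw (h : ExactPencilLaw) : allRows.Law :=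
  RowFamily.Law.mono exactTilted_emb_allRows h

/-- ★ **`ExactPencilLaw ⟹ COR-VIRTUAL`** (flat currency). -/
theorem corVirtualHardN_of_exactPencilLaw (h : ExactPencilLaw) : CorVirtualHardN :=
  corVirtualHardN_of_law exactTilted h

/-! ## §3 Laws are antitone in the right-hand side -/

/-- `F` is a TIGHTENING of `G`: every row of `G` is (a copy of) a row of `F` whose right-hand side in `F` is not larger. -/
structure Tightening (F G : RowFamily) where
  ψ : ∀ n, G.A n → F.A n
  ρ_eq : ∀ n a, F.ρ n (ψ n a) = G.ρ n a
  β_le : ∀ n a, F.β n (ψ n a) ≤ G.β n a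

/-- `2 · T c n ≤ T (c+1) n` once `n ≥ 2` (one extra slot is free at the next level of the quasi-polynomial scale). -/
theorem two_mul_T_le (c : ℕ) {n : ℕ} (hn : 2 ≤ n) : 2 * T c n ≤ T (c + 1) n := by
  have hL : 1 ≤ Nat.log 2 n := Nat.le_log_of_pow_le (by norm_num) (by simpa using hn)
  show 2 * 2 ^ ((Nat.log 2 n + c) ^ c) ≤ 2 ^ ((Nat.log 2 n + (c + 1)) ^ (c + 1))
  rw [← pow_succ']
  apply Nat.pow_le_pow_right (by norm_num)
  set x := Nat.log 2 n + c with hx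
  have hx1 : 1 ≤ x := by omega
  have h1 : Nat.log 2 n + (c + 1) = x + 1 := by omega
  rw [h1, pow_succ]
  have hA : 1 ≤ x ^ c := Nat.one_le_pow _ _ (by omega)
  have hB : x ^ c ≤ (x + 1) ^ c := Nat.pow_le_pow_left (by omega) c
  nlinarith [hA, hB, hx1]

/-- ★ **LAWS ARE ANTITONE IN THE RHS** (a law for the looser family implies the law for its tightening). -/
theorem RowFamily.Law.of_tightening {F G : RowFamily} (t : Tightening F G) (hG : G.Law) : F.Law := by
  classical
  intro c
  obtain ⟨n₀, hn₀⟩ := hG (c + 1)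
  refine ⟨max n₀ 2, fun n hn K q r hQ m hmq hmax U V hU hV hfac => ?_⟩
  have hn₀' : n₀ ≤ n := le_trans (le_max_left _ _) hn
  have hn2 : 2 ≤ n := le_trans (le_max_right _ _) hn
  -- the loosened factorization through `Option (Fin (r+1))`: slot `none` carries the rhs difference
  let e : Fin (r + 1) ≃ Option (Fin r) := finSuccEquiv r
  let U' : G.A n → Option (Fin (r + 1)) → ℝ := fun a o =>
    match o with
    | none => G.β n a - F.β n (t.ψ n a)
    | some i => U (t.ψ n a) (e i)
  let V' : Finset (Fin n) × Fin (K + 1) → Option (Fin (r + 1)) → ℝ := fun p o =>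
    match o with
    | none => 1
    | some i => V p (e i)
  have hU' : ∀ a o, 0 ≤ U' a o := by
    intro a o; cases o with
    | none => exact sub_nonneg.2 (t.β_le n a)
    | some i => exact hU _ _
  have hV' : ∀ p o, 0 ≤ V' p o := by
    intro p o; cases o with
    | none => exact zero_le_one
    | some i => exact hV _ _
  have hfac' : ∀ a b j, (G.β n a + m (t.ψ n a)) - G.ρ n a ⬝ᵥ (udPt b + q j) = ∑ o, U' a o * V' (b, j) o := by
    intro a b j
    rw [Fintype.sum_option]
    have hs : ∑ i : Fin (r + 1), U' a (some i) * V' (b, j) (some i) =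
        ∑ o : Option (Fin r), U (t.ψ n a) o * V (b, j) o := by
      show ∑ i : Fin (r + 1), U (t.ψ n a) (e i) * V (b, j) (e i) = _
      exact Equiv.sum_comp e (fun o => U (t.ψ n a) o * V (b, j) o)
    rw [hs, ← hfac (t.ψ n a) b j, t.ρ_eq n a]
    show (G.β n a + m (t.ψ n a)) - G.ρ n a ⬝ᵥ (udPt b + q j) =
      (G.β n a - F.β n (t.ψ n a)) * 1 + ((F.β n (t.ψ n a) + m (t.ψ n a)) - G.ρ n a ⬝ᵥ (udPt b + q j))
    ring
  have hlt : T (c + 1) n < r + 1 :=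
    hn₀ n hn₀' K q (r + 1) hQ.succ (fun a => m (t.ψ n a))
      (fun a j => by rw [← t.ρ_eq n a]; exact hmq _ j)
      (fun a => by obtain ⟨j, hj⟩ := hmax (t.ψ n a); exact ⟨j, by rw [← t.ρ_eq n a]; exact hj⟩)
      U' V' hU' hV' hfac'
  have h2 := two_mul_T_le c hn2
  have hT : 1 ≤ T c n := Nat.one_le_two_pow
  omega

/-- the box pencil `entryTilted` is a LOOSENING of the exact pencil (`h_COR(W) ≤ Σ max(W_im, 0)`). -/
noncomputable def exactTilted_tightening_entryTilted : Tightening exactTilted entryTilted where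
  ψ := fun _ a => a
  ρ_eq := fun _ _ => rfl
  β_le := fun n a => by
    show (1 : ℝ) + hCOR a.2 ≤ 1 + ∑ i, ∑ m, max (a.2 i m) 0
    have := hCOR_le_box a.2
    linarith

/-- ★ **C⁺_entry ⟹ the exact pencil law**: `LocatedPencilLaw → ExactPencilLaw` (`ExactPencilLaw` is the WEAKER live target). -/
theorem exactPencilLaw_of_locatedPencilLaw (h : LocatedPencilLaw) : ExactPencilLaw :=
  RowFamily.Law.of_tightening exactTilted_tightening_entryTilted h

/-- ★ the extended chain: `LocatedPencilLaw ⟹ ExactPencilLaw ⟹ allRows.Law ⟹ CorVirtualHardN` (all PROVED; the laws OPEN). -/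
theorem exact_law_chain :
    (LocatedPencilLaw → ExactPencilLaw) ∧ (ExactPencilLaw → allRows.Law) ∧ (allRows.Law → CorVirtualHardN) :=
  ⟨exactPencilLaw_of_locatedPencilLaw, allRowsLaw_of_exactPencilLaw, corVirtualHardN_of_law allRows⟩

/-! ## §4 The pair cube `Q_pair = J + Σ_{j<m} [0, g_{jm}]`, `g_{jm} = E_jj + E_mm − 2E_jm − 2E_mj`: clique weights `∈ {0, 1, −2}` and the
exact pairing pin `⟨D_π, g⟩ ∈ {0, −2}` (the separating example of memo §2). -/

/-- pick out one entry: `Σ_i Σ_i' f i i' · [i = j ∧ i' = m]·c = c · f j m`. -/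
theorem sum_sum_mul_ite_and {n : ℕ} (f : Fin n → Fin n → ℝ) (c : ℝ) (j m : Fin n) :
    ∑ i, ∑ i', f i i' * (if i = j ∧ i' = m then c else 0) = c * f j m := by
  have : ∀ i i' : Fin n, f i i' * (if i = j ∧ i' = m then c else 0) =
      if i' = m then (if i = j then c * f i i' else 0) else 0 := by
    intro i i'
    by_cases hi : i = j <;> by_cases hi' : i' = m <;> simp [hi, hi', mul_comm]
  simp_rw [this]
  simp only [Finset.sum_ite_eq', Finset.mem_univ, if_true]

/-- the generator `g_jm = E_jj + E_mm + 2(E_jm + E_mj)` of the PAIR CUBE `Q_pair = Σ_{j<m} [0, g_jm]`. -/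
def gPair {n : ℕ} (j m : Fin n) : Matrix (Fin n) (Fin n) ℝ := fun i i' =>
  (if i = j ∧ i' = j then (1 : ℝ) else 0) + (if i = m ∧ i' = m then (1 : ℝ) else 0) +
    (if i = j ∧ i' = m then (2 : ℝ) else 0) + (if i = m ∧ i' = j then (2 : ℝ) else 0)

/-- ★ clique weight of a pair generator: `[j∈a] + [m∈a] − 4[j∈a][m∈a] ∈ {0, 1, −2}`. -/
theorem udRow_dotProduct_gPair {n : ℕ} (a : Finset (Fin n)) {j m : Fin n} (hjm : j ≠ m) :
    udRow a ⬝ᵥ flat (gPair j m) = udInd a j + udInd a m - 4 * (udInd a j * udInd a m) := by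
  rw [show udRow a = flat (udMat a) from rfl, flat_dotProduct_flat]
  simp only [gPair, mul_add, Finset.sum_add_distrib, sum_sum_mul_ite_and]
  simp [udMat, hjm, Ne.symm hjm, udInd_sq]
  ring

/-- the pairing-face direction of ONE matched pair: `d_jj' = E_jj + E_j'j' − E_jj' − E_j'j` (`⟨d, x_b⟩ = [b_j ≠ b_j']`). -/
def dPair {n : ℕ} (j j' : Fin n) : Matrix (Fin n) (Fin n) ℝ := fun i i' =>
  (if i = j ∧ i' = j then (1 : ℝ) else 0) + (if i = j' ∧ i' = j' then (1 : ℝ) else 0) +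
    (if i = j ∧ i' = j' then (-1 : ℝ) else 0) + (if i = j' ∧ i' = j then (-1 : ℝ) else 0)

/-- ★ THE PIN: `⟨D_π, g⟩ = −2` on the matched pair's own generator, `0` otherwise. -/
theorem flat_dPair_dotProduct_gPair_self {n : ℕ} {j j' : Fin n} (h : j ≠ j') :
    flat (dPair j j') ⬝ᵥ flat (gPair j j') = -2 := by
  rw [flat_dotProduct_flat]
  simp only [gPair, mul_add, Finset.sum_add_distrib, sum_sum_mul_ite_and]
  simp [dPair, h, Ne.symm h]
  norm_num

theorem flat_dPair_dotProduct_gPair_touch {n : ℕ} {j j' m : Fin n} (h : j ≠ j') (hm : m ≠ j) (hm' : m ≠ j') :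
    flat (dPair j j') ⬝ᵥ flat (gPair j m) = 1 := by
  rw [flat_dotProduct_flat]
  simp only [gPair, mul_add, Finset.sum_add_distrib, sum_sum_mul_ite_and]
  simp [dPair, h, hm, hm']

theorem flat_dPair_dotProduct_gPair_disjoint {n : ℕ} {j j' l m : Fin n} (hl : l ≠ j) (hl' : l ≠ j')
    (hm : m ≠ j) (hm' : m ≠ j') :
    flat (dPair j j') ⬝ᵥ flat (gPair l m) = 0 := by
  rw [flat_dotProduct_flat]
  simp only [gPair, mul_add, Finset.sum_add_distrib, sum_sum_mul_ite_and]
  simp [dPair, hl, hl', hm, hm']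


/-! ## §5 The exact pairing read DECIDES the pair cube — `exactTilted.Law` on `Q_pair`, in the Law's own currency -/

section QPair
variable {n : ℕ}

theorem gPair_comm (j m : Fin n) : gPair j m = gPair m j := by
  funext i i'; simp only [gPair]; ring

theorem dPair_comm (j j' : Fin n) : dPair j j' = dPair j' j := by
  funext i i'; simp only [dPair]; ring

/-- pick out one entry (left factor version). -/
theorem sum_sum_ite_and_mul (f : Fin n → Fin n → ℝ) (c : ℝ) (j m : Fin n) :
    ∑ i, ∑ i', (if i = j ∧ i' = m then c else 0) * f i i' = c * f j m := by
  have : ∀ i i' : Fin n, (if i = j ∧ i' = m then c else 0) * f i i' =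
      if i' = m then (if i = j then c * f i i' else 0) else 0 := by
    intro i i'
    by_cases hi : i = j <;> by_cases hi' : i' = m <;> simp [hi, hi']
  simp_rw [this]
  simp only [Finset.sum_ite_eq', Finset.mem_univ, if_true]

/-- `⟨d_jj', x_b⟩ = (b_j − b_j')² = [b splits {j,j'}]`. -/
theorem flat_dPair_dotProduct_udPt {j j' : Fin n} (b : Finset (Fin n)) :
    flat (dPair j j') ⬝ᵥ udPt b = (udInd b j - udInd b j') ^ 2 := by
  show flat (dPair j j') ⬝ᵥ vecOuter n (udInd b) = _
  rw [flat_dotProduct_vecOuter]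
  simp only [dPair, add_mul, Finset.sum_add_distrib, sum_sum_ite_and_mul]
  ring

theorem flat_dPair_dotProduct_udPt_le_one {j j' : Fin n} (b : Finset (Fin n)) :
    flat (dPair j j') ⬝ᵥ udPt b ≤ 1 := by
  rw [flat_dPair_dotProduct_udPt]
  rw [udInd_apply, udInd_apply]
  split_ifs <;> norm_num

/-- touch variants of the pin value `+1` (shared vertex in any position). -/
theorem dg_touch₁ {p p' m : Fin n} (hpp : p ≠ p') (hm : m ≠ p) (hm' : m ≠ p') :
    flat (dPair p p') ⬝ᵥ flat (gPair p m) = 1 := flat_dPair_dotProduct_gPair_touch hpp hm hm'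

theorem dg_touch₂ {p p' j : Fin n} (hpp : p ≠ p') (hj : j ≠ p) (hj' : j ≠ p') :
    flat (dPair p p') ⬝ᵥ flat (gPair j p) = 1 := by
  rw [gPair_comm]; exact flat_dPair_dotProduct_gPair_touch hpp hj hj'

theorem dg_touch₃ {p p' m : Fin n} (hpp : p ≠ p') (hm : m ≠ p') (hm' : m ≠ p) :
    flat (dPair p p') ⬝ᵥ flat (gPair p' m) = 1 := by
  rw [dPair_comm]; exact flat_dPair_dotProduct_gPair_touch hpp.symm hm hm'

theorem dg_touch₄ {p p' j : Fin n} (hpp : p ≠ p') (hj : j ≠ p') (hj' : j ≠ p) :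
    flat (dPair p p') ⬝ᵥ flat (gPair j p') = 1 := by
  rw [dPair_comm, gPair_comm]; exact flat_dPair_dotProduct_gPair_touch hpp.symm hj hj'

/-- `flat` is linear. -/
def flatLin (n : ℕ) : Matrix (Fin n) (Fin n) ℝ →ₗ[ℝ] (Fin (n * n) → ℝ) where
  toFun := flat
  map_add' := fun _ _ => rfl
  map_smul' := fun _ _ => rfl

/-! ### the half-matching, the location `W_π`, the passenger `Q_pair` -/

/-- `k = ⌊n/2⌋`. -/
def kk (n : ℕ) : ℕ := n / 2

/-- left endpoints `t ↦ t`. -/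
def ι₁ (t : Fin (kk n)) : Fin n := ⟨t, by have := t.2; unfold kk at this; omega⟩

/-- right endpoints `t ↦ t + k`. -/
def ι₂ (t : Fin (kk n)) : Fin n := ⟨t + kk n, by have := t.2; simp only [kk] at this ⊢; omega⟩

@[simp] theorem ι₁_val (t : Fin (kk n)) : ((ι₁ t : Fin n) : ℕ) = t := rfl
@[simp] theorem ι₂_val (t : Fin (kk n)) : ((ι₂ t : Fin n) : ℕ) = t + kk n := rfl

theorem ι₁_ne_ι₂ (t s : Fin (kk n)) : ι₁ t ≠ ι₂ s := by
  intro h; have := congrArg Fin.val h; simp at this; omega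

theorem ι₁_injective : Function.Injective (ι₁ (n := n)) := by
  intro t s h; have := congrArg Fin.val h; simp at this; exact Fin.ext this

theorem ι₂_injective : Function.Injective (ι₂ (n := n)) := by
  intro t s h; have := congrArg Fin.val h; simp at this; exact Fin.ext (by omega)

/-- ordered pairs `j < m` (the edges of `K_n`). -/
abbrev PIdx (n : ℕ) := {p : Fin n × Fin n // p.1 < p.2}

/-- `e` is a matched pair `(t, t+k)`. -/
def Matched (e : PIdx n) : Prop := (e.1.1 : ℕ) < kk n ∧ (e.1.2 : ℕ) = e.1.1 + kk n

instance (e : PIdx n) : Decidable (Matched e) := by unfold Matched; infer_instance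

/-- the location: `W_π = 3·Σ_t d_{ι₁ t, ι₂ t}`. -/
noncomputable def Wm (n : ℕ) : Matrix (Fin n) (Fin n) ℝ := ∑ t : Fin (kk n), (3 : ℝ) • dPair (ι₁ t) (ι₂ t)

theorem flat_Wm : flat (Wm n) = ∑ t : Fin (kk n), (3 : ℝ) • flat (dPair (ι₁ t) (ι₂ t)) := by
  change flatLin n (Wm n) = ∑ t : Fin (kk n), (3 : ℝ) • flatLin n (dPair (ι₁ t) (ι₂ t))
  unfold Wm
  rw [map_sum]
  simp_rw [map_smul]

theorem flat_Wm_dotProduct (v : Fin (n * n) → ℝ) :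
    flat (Wm n) ⬝ᵥ v = ∑ t : Fin (kk n), 3 * (flat (dPair (ι₁ t) (ι₂ t)) ⬝ᵥ v) := by
  rw [flat_Wm, sum_dotProduct]
  simp_rw [smul_dotProduct, smul_eq_mul]

/-- the vertex `q_H = Σ_{e ∈ H} g_e` of the pair cube. -/
noncomputable def qPair (H : Finset (PIdx n)) : Fin (n * n) → ℝ := ∑ e ∈ H, flat (gPair e.1.1 e.1.2)

/-- the common maximising column `H⋆ = πᶜ`. -/
noncomputable def Hstar (n : ℕ) : Finset (PIdx n) := Finset.univ.filter (fun e => ¬ Matched e)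

/-! ### the pin values `D(e) = Σ_t ⟨d_t, g_e⟩`: `−2` on `π`, `∈ {0,1}` termwise and `≥ 1` off `π` -/

theorem dg_matched (e : PIdx n) (he : Matched e) :
    flat (Wm n) ⬝ᵥ flat (gPair e.1.1 e.1.2) = -6 := by
  obtain ⟨h1, h2⟩ := he
  rw [flat_Wm_dotProduct]
  set s : Fin (kk n) := ⟨e.1.1, h1⟩ with hs
  have he1 : ι₁ s = e.1.1 := Fin.ext (by simp [hs])
  have he2 : ι₂ s = e.1.2 := Fin.ext (by simp [hs]; omega)
  rw [Finset.sum_eq_single s]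
  · rw [← he1, ← he2, flat_dPair_dotProduct_gPair_self (ι₁_ne_ι₂ s s)]; norm_num
  · intro t _ hts
    have h11 : ι₁ t ≠ e.1.1 := by rw [← he1]; exact fun h => hts (ι₁_injective h)
    have h12 : ι₁ t ≠ e.1.2 := by rw [← he2]; exact ι₁_ne_ι₂ t s
    have h21 : ι₂ t ≠ e.1.1 := by rw [← he1]; exact (ι₁_ne_ι₂ s t).symm
    have h22 : ι₂ t ≠ e.1.2 := by rw [← he2]; exact fun h => hts (ι₂_injective h)
    rw [flat_dPair_dotProduct_gPair_disjoint h11.symm h21.symm h12.symm h22.symm]; ring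
  · intro h; exact absurd (Finset.mem_univ s) h

/-- termwise: for an unmatched edge every pair term is `0` or `1`. -/
theorem dg_term_unmatched (e : PIdx n) (he : ¬ Matched e) (t : Fin (kk n)) :
    flat (dPair (ι₁ t) (ι₂ t)) ⬝ᵥ flat (gPair e.1.1 e.1.2) = 0 ∨
      flat (dPair (ι₁ t) (ι₂ t)) ⬝ᵥ flat (gPair e.1.1 e.1.2) = 1 := by
  have hjm : e.1.1 ≠ e.1.2 := ne_of_lt e.2
  have hlt : (e.1.1 : ℕ) < e.1.2 := e.2
  have hpp : ι₁ t ≠ ι₂ t := ι₁_ne_ι₂ t t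
  by_cases a1 : ι₁ t = e.1.1
  · by_cases a4 : ι₂ t = e.1.2
    · exfalso; apply he
      have h1 := congrArg Fin.val a1; have h2 := congrArg Fin.val a4; simp at h1 h2
      have := t.2
      exact ⟨by omega, by omega⟩
    · right
      have hm : e.1.2 ≠ ι₁ t := by rw [a1]; exact hjm.symm
      have hm' : e.1.2 ≠ ι₂ t := fun h => a4 h.symm
      rw [← a1]; exact dg_touch₁ hpp hm hm'
  · by_cases a2 : ι₁ t = e.1.2
    · by_cases a3 : ι₂ t = e.1.1
      · exfalso
        have h1 := congrArg Fin.val a2; have h2 := congrArg Fin.val a3; simp at h1 h2; omega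
      · right
        have hj : e.1.1 ≠ ι₁ t := fun h => a1 h.symm
        have hj' : e.1.1 ≠ ι₂ t := fun h => a3 h.symm
        rw [← a2]; exact dg_touch₂ hpp hj hj'
    · by_cases a3 : ι₂ t = e.1.1
      · right
        have hm : e.1.2 ≠ ι₂ t := by rw [a3]; exact hjm.symm
        have hm' : e.1.2 ≠ ι₁ t := fun h => a2 h.symm
        rw [← a3]; exact dg_touch₃ hpp hm hm'
      · by_cases a4 : ι₂ t = e.1.2
        · right
          have hj : e.1.1 ≠ ι₂ t := fun h => a3 h.symm
          have hj' : e.1.1 ≠ ι₁ t := fun h => a1 h.symm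
          rw [← a4]; exact dg_touch₄ hpp hj hj'
        · left
          exact flat_dPair_dotProduct_gPair_disjoint (fun h => a1 h.symm) (fun h => a3 h.symm)
            (fun h => a2 h.symm) (fun h => a4 h.symm)

/-! ### scores and the common maximiser `H⋆` -/

theorem two_kk_succ (n : ℕ) : n ≤ kk n + kk n + 1 := by unfold kk; omega

/-- off `π`: `D(e) = ⟨W_π, g_e⟩ ≥ 3`. -/
theorem dg_unmatched (e : PIdx n) (he : ¬ Matched e) : 3 ≤ flat (Wm n) ⬝ᵥ flat (gPair e.1.1 e.1.2) := by
  have hjm : e.1.1 ≠ e.1.2 := ne_of_lt e.2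
  have hlt : (e.1.1 : ℕ) < e.1.2 := e.2
  have h2 : (e.1.2 : ℕ) < n := e.1.2.2
  have hk := two_kk_succ n
  rw [flat_Wm_dotProduct]
  have hnonneg : ∀ t ∈ (Finset.univ : Finset (Fin (kk n))),
      0 ≤ 3 * (flat (dPair (ι₁ t) (ι₂ t)) ⬝ᵥ flat (gPair e.1.1 e.1.2)) := by
    intro t _
    rcases dg_term_unmatched e he t with h | h <;> rw [h] <;> norm_num
  -- the pair `t₀` containing the (matched) vertex `e.1.1`
  by_cases hj : (e.1.1 : ℕ) < kk n
  · let t₀ : Fin (kk n) := ⟨e.1.1, hj⟩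
    have h1 : ι₁ t₀ = e.1.1 := Fin.ext (by simp [t₀])
    have hval : flat (dPair (ι₁ t₀) (ι₂ t₀)) ⬝ᵥ flat (gPair e.1.1 e.1.2) = 1 := by
      have hm : e.1.2 ≠ ι₁ t₀ := by rw [h1]; exact hjm.symm
      have hm' : e.1.2 ≠ ι₂ t₀ := by
        intro h; apply he
        have := congrArg Fin.val h; simp [t₀] at this
        exact ⟨hj, by omega⟩
      conv_lhs => rw [← h1]
      exact dg_touch₁ (ι₁_ne_ι₂ t₀ t₀) hm hm'
    have := Finset.single_le_sum hnonneg (Finset.mem_univ t₀)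
    rw [hval] at this
    linarith
  · have hj2 : (e.1.1 : ℕ) - kk n < kk n := by omega
    let t₀ : Fin (kk n) := ⟨e.1.1 - kk n, hj2⟩
    have h1 : ι₂ t₀ = e.1.1 := Fin.ext (by simp [t₀]; omega)
    have hval : flat (dPair (ι₁ t₀) (ι₂ t₀)) ⬝ᵥ flat (gPair e.1.1 e.1.2) = 1 := by
      have hm : e.1.2 ≠ ι₂ t₀ := by rw [h1]; exact hjm.symm
      have hm' : e.1.2 ≠ ι₁ t₀ := by
        intro h; have := congrArg Fin.val h; simp [t₀] at this; omega
      conv_lhs => rw [← h1]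
      exact dg_touch₃ (ι₁_ne_ι₂ t₀ t₀) hm hm'
    have := Finset.single_le_sum hnonneg (Finset.mem_univ t₀)
    rw [hval] at this
    linarith

/-- the clique weights are in `[−2, 1]`. -/
theorem w_bounds (a : Finset (Fin n)) (e : PIdx n) :
    -2 ≤ udRow a ⬝ᵥ flat (gPair e.1.1 e.1.2) ∧ udRow a ⬝ᵥ flat (gPair e.1.1 e.1.2) ≤ 1 := by
  rw [udRow_dotProduct_gPair a (ne_of_lt e.2), udInd_apply, udInd_apply]
  split_ifs <;> norm_num

/-- the located row `(a, W_π)` scores every generator: negative on `π`, positive off `π`. -/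
theorem score_neg (a : Finset (Fin n)) (e : PIdx n) (he : Matched e) :
    (udRow a + flat (Wm n)) ⬝ᵥ flat (gPair e.1.1 e.1.2) < 0 := by
  rw [add_dotProduct, dg_matched e he]; linarith [(w_bounds a e).2]

theorem score_pos (a : Finset (Fin n)) (e : PIdx n) (he : ¬ Matched e) :
    0 < (udRow a + flat (Wm n)) ⬝ᵥ flat (gPair e.1.1 e.1.2) := by
  rw [add_dotProduct]; linarith [(w_bounds a e).1, dg_unmatched e he]

theorem dotProduct_qPair (ρ : Fin (n * n) → ℝ) (H : Finset (PIdx n)) :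
    ρ ⬝ᵥ qPair H = ∑ e ∈ H, ρ ⬝ᵥ flat (gPair e.1.1 e.1.2) := by
  unfold qPair; rw [dotProduct_sum]

/-- ★ `H⋆ = πᶜ` maximises EVERY located row `(a, W_π)` over the pair cube. -/
theorem score_le_star (a : Finset (Fin n)) (H : Finset (PIdx n)) :
    (udRow a + flat (Wm n)) ⬝ᵥ qPair H ≤ (udRow a + flat (Wm n)) ⬝ᵥ qPair (Hstar n) := by
  classical
  set ρ := udRow a + flat (Wm n)
  rw [dotProduct_qPair, dotProduct_qPair]
  have hsplit := Finset.sum_filter_add_sum_filter_not H (fun e => Matched e)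
    (fun e => ρ ⬝ᵥ flat (gPair e.1.1 e.1.2))
  have hneg : ∑ e ∈ H.filter (fun e => Matched e), ρ ⬝ᵥ flat (gPair e.1.1 e.1.2) ≤ 0 :=
    Finset.sum_nonpos fun e he => (score_neg a e (Finset.mem_filter.mp he).2).le
  have hsub : H.filter (fun e => ¬ Matched e) ⊆ Hstar n := by
    intro e he
    exact Finset.mem_filter.mpr ⟨Finset.mem_univ _, (Finset.mem_filter.mp he).2⟩
  have hmono : ∑ e ∈ H.filter (fun e => ¬ Matched e), ρ ⬝ᵥ flat (gPair e.1.1 e.1.2) ≤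
      ∑ e ∈ Hstar n, ρ ⬝ᵥ flat (gPair e.1.1 e.1.2) :=
    Finset.sum_le_sum_of_subset_of_nonneg hsub fun e he _ =>
      (score_pos a e (Finset.mem_filter.mp he).2).le
  linarith

/-! ### the block columns `B_S = ι₁(S) ∪ ι₂(Sᶜ)` -/

/-- the embeddings. -/
def ι₁e (n : ℕ) : Fin (kk n) ↪ Fin n := ⟨ι₁, ι₁_injective⟩
def ι₂e (n : ℕ) : Fin (kk n) ↪ Fin n := ⟨ι₂, ι₂_injective⟩

/-- `B_S := ι₁(S) ∪ ι₂(Sᶜ)` — splits every matched pair. -/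
def Bcol (S : Finset (Fin (kk n))) : Finset (Fin n) := S.map (ι₁e n) ∪ Sᶜ.map (ι₂e n)

theorem ι₁_mem_Bcol (S : Finset (Fin (kk n))) (t : Fin (kk n)) : ι₁ t ∈ Bcol S ↔ t ∈ S := by
  unfold Bcol
  rw [Finset.mem_union]
  constructor
  · rintro (h | h)
    · obtain ⟨s, hs, hst⟩ := Finset.mem_map.mp h
      rw [← ι₁_injective hst]; exact hs
    · exfalso
      obtain ⟨s, -, hs⟩ := Finset.mem_map.mp h
      exact ι₁_ne_ι₂ t s hs.symm
  · intro h; left; exact Finset.mem_map.mpr ⟨t, h, rfl⟩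

theorem ι₂_mem_Bcol (S : Finset (Fin (kk n))) (t : Fin (kk n)) : ι₂ t ∈ Bcol S ↔ t ∉ S := by
  unfold Bcol
  rw [Finset.mem_union]
  constructor
  · rintro (h | h)
    · exfalso
      obtain ⟨s, -, hs⟩ := Finset.mem_map.mp h
      exact ι₁_ne_ι₂ s t hs
    · obtain ⟨s, hs, hst⟩ := Finset.mem_map.mp h
      rw [← ι₂_injective hst]; exact Finset.mem_compl.mp hs
  · intro h; right; exact Finset.mem_map.mpr ⟨t, Finset.mem_compl.mpr h, rfl⟩

theorem dPair_dotProduct_Bcol (S : Finset (Fin (kk n))) (t : Fin (kk n)) :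
    flat (dPair (ι₁ t) (ι₂ t)) ⬝ᵥ udPt (Bcol S) = 1 := by
  rw [flat_dPair_dotProduct_udPt, udInd_apply, udInd_apply]
  by_cases ht : t ∈ S
  · rw [if_pos ((ι₁_mem_Bcol S t).mpr ht), if_neg (fun h => ((ι₂_mem_Bcol S t).mp h) ht)]; norm_num
  · rw [if_neg (fun h => ht ((ι₁_mem_Bcol S t).mp h)), if_pos ((ι₂_mem_Bcol S t).mpr ht)]; norm_num

theorem Wm_dotProduct_Bcol (S : Finset (Fin (kk n))) : flat (Wm n) ⬝ᵥ udPt (Bcol S) = 3 * kk n := by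
  rw [flat_Wm_dotProduct]
  simp_rw [dPair_dotProduct_Bcol]
  rw [Finset.sum_const, Finset.card_univ, Fintype.card_fin, nsmul_eq_mul]
  ring

theorem Wm_dotProduct_udPt_le (b : Finset (Fin n)) : flat (Wm n) ⬝ᵥ udPt b ≤ 3 * kk n := by
  rw [flat_Wm_dotProduct]
  calc ∑ t : Fin (kk n), 3 * (flat (dPair (ι₁ t) (ι₂ t)) ⬝ᵥ udPt b)
      ≤ ∑ _t : Fin (kk n), (3 : ℝ) :=
        Finset.sum_le_sum fun t _ => by linarith [flat_dPair_dotProduct_udPt_le_one (j := ι₁ t) (j' := ι₂ t) b]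
    _ = 3 * kk n := by rw [Finset.sum_const, Finset.card_univ, Fintype.card_fin, nsmul_eq_mul]; ring

/-- the exact rhs of the location: `h_COR(W_π) = 3k`. -/
theorem hCOR_Wm : hCOR (Wm n) = 3 * kk n := by
  apply le_antisymm
  · exact Finset.sup'_le _ _ fun b _ => Wm_dotProduct_udPt_le b
  · rw [← Wm_dotProduct_Bcol (∅ : Finset (Fin (kk n)))]; exact le_hCOR _ _

theorem map_inter_Bcol (a' S : Finset (Fin (kk n))) : a'.map (ι₁e n) ∩ Bcol S = (a' ∩ S).map (ι₁e n) := by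
  ext x
  rw [Finset.mem_inter, Finset.mem_map, Finset.mem_map]
  constructor
  · rintro ⟨⟨t, ht, rfl⟩, hx⟩
    exact ⟨t, Finset.mem_inter.mpr ⟨ht, (ι₁_mem_Bcol S t).mp hx⟩, rfl⟩
  · rintro ⟨t, ht, rfl⟩
    exact ⟨⟨t, (Finset.mem_inter.mp ht).1, rfl⟩, (ι₁_mem_Bcol S t).mpr (Finset.mem_inter.mp ht).2⟩

/-- the clique part of the block: `1 − ⟨udRow ι₁(a'), x_{B_S}⟩ = (1 − |a' ∩ S|)²`. -/
theorem ud_block (a' S : Finset (Fin (kk n))) :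
    1 - udRow (a'.map (ι₁e n)) ⬝ᵥ udPt (Bcol S) = (1 - ((a' ∩ S).card : ℝ)) ^ 2 := by
  rw [(ud_data n).2.2.1, map_inter_Bcol, Finset.card_map]

/-! ### the law-currency block count (40 g5 `LocatedRows.three_pow_le_of_block`, restated) and the rate -/

/-- **LAW-CURRENCY LOCATED BLOCK COUNT** (40 g5 `LocatedRows.lean` §2, restated): a `(1 − |α'∩S|)²` block inside a nonnegative
factorization through `ι` forces `3^k ≤ |ι|·2^k`. -/
theorem three_pow_le_of_block {R C ι α : Type*} [Fintype ι] [Fintype α] [DecidableEq α]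
    (U : R → ι → ℝ) (V : C → ι → ℝ) (hU : ∀ ρ i, 0 ≤ U ρ i) (hV : ∀ κ i, 0 ≤ V κ i)
    (row : Finset α → R) (col : Finset α → C)
    (hblock : ∀ a b : Finset α, ∑ i, U (row a) i * V (col b) i = (1 - ((a ∩ b).card : ℝ)) ^ 2) :
    3 ^ Fintype.card α ≤ Fintype.card ι * 2 ^ Fintype.card α := by
  classical
  have key := three_pow_le_card_mul_two_pow_of_cover_univ (α := α) (Finset.univ : Finset ι)
    (fun i => {a : Finset α | 0 < U (row a) i}) (fun i => {b : Finset α | 0 < V (col b) i}) ?_ ?_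
  · rwa [Finset.card_univ] at key
  · intro i _ a ha b hb h1
    have ha' : 0 < U (row a) i := ha
    have hb' : 0 < V (col b) i := hb
    have hsum := hblock a b
    rw [h1, Nat.cast_one, sub_self] at hsum
    have hle : U (row a) i * V (col b) i ≤ ∑ j, U (row a) j * V (col b) j :=
      Finset.single_le_sum (fun j _ => mul_nonneg (hU _ j) (hV _ j)) (Finset.mem_univ i)
    rw [hsum] at hle
    norm_num at hle
    exact absurd hle (not_le.mpr (mul_pos ha' hb'))
  · intro a b hab
    have hsum := hblock a b
    rw [Finset.disjoint_iff_inter_eq_empty.mp hab, Finset.card_empty, Nat.cast_zero, sub_zero, one_pow] at hsum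
    have hpos : 0 < ∑ j, U (row a) j * V (col b) j := by rw [hsum]; exact one_pos
    obtain ⟨j, -, hj⟩ : ∃ j ∈ (Finset.univ : Finset ι), 0 < U (row a) j * V (col b) j := by
      by_contra h
      push Not at h
      exact absurd (Finset.sum_nonpos h) (not_le.mpr hpos)
    have hUj : 0 < U (row a) j := lt_of_le_of_ne (hU _ j) (fun h => by
      rw [← h, zero_mul] at hj; exact lt_irrefl _ hj)
    have hVj : 0 < V (col b) j := lt_of_le_of_ne (hV _ j) (fun h => by
      rw [← h, mul_zero] at hj; exact lt_irrefl _ hj)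
    exact ⟨j, Finset.mem_univ _, hUj, hVj⟩

theorem two_pow_half_mul_le (h : ℕ) : 2 ^ (h / 2) * 2 ^ h ≤ 3 ^ h := by
  have hh : h = 2 * (h / 2) + h % 2 := (Nat.div_add_mod h 2).symm
  have hv : h % 2 < 2 := Nat.mod_lt _ (by norm_num)
  generalize h / 2 = u at hh ⊢
  generalize h % 2 = v at hh hv ⊢
  subst hh
  calc 2 ^ u * 2 ^ (2 * u + v) = 2 ^ (3 * u) * 2 ^ v := by ring
    _ = (2 ^ 3) ^ u * 2 ^ v := by rw [pow_mul]
    _ ≤ (3 ^ 2) ^ u * 3 ^ v :=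
        Nat.mul_le_mul (Nat.pow_le_pow_left (by norm_num) u) (Nat.pow_le_pow_left (by norm_num) v)
    _ = 3 ^ (2 * u) * 3 ^ v := by rw [← pow_mul]
    _ = 3 ^ (2 * u + v) := by ring

/-- RATE at the pairing face: `3^k ≤ (r+1)·2^k`, `k = ⌊n/2⌋` ⟹ `T c n < r`, eventually in `n`. -/
theorem T_lt_of_block_half (c : ℕ) : ∃ n₀ : ℕ, ∀ n ≥ n₀, ∀ r : ℕ, 3 ^ kk n ≤ (r + 1) * 2 ^ kk n → T c n < r := by
  obtain ⟨t₁, ht₁⟩ := four_T_lt_two_pow c (c₀ := 1 / 5) (by norm_num)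
  refine ⟨max t₁ 16, fun n hn r hr => ?_⟩
  have hn16 : 16 ≤ n := le_of_max_le_right hn
  have hdiv : n ≤ 5 * (kk n / 2) := by unfold kk; omega
  have hreal : (1 / 5 : ℝ) * n ≤ ((kk n / 2 : ℕ) : ℝ) := by
    have : (n : ℝ) ≤ 5 * ((kk n / 2 : ℕ) : ℝ) := by exact_mod_cast hdiv
    linarith
  have h4 := ht₁ n (le_of_max_le_left hn) (kk n / 2) hreal
  have hpow : 2 ^ (kk n / 2) * 2 ^ kk n ≤ (r + 1) * 2 ^ kk n := (two_pow_half_mul_le (kk n)).trans hr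
  have hle : 2 ^ (kk n / 2) ≤ r + 1 := Nat.le_of_mul_le_mul_right hpow (Nat.pos_of_ne_zero (by positivity))
  have hT : 1 ≤ T c n := Nat.one_le_two_pow
  show 2 ^ ((Nat.log 2 n + c) ^ c) < r
  have hT' : (1 : ℕ) ≤ 2 ^ ((Nat.log 2 n + c) ^ c) := Nat.one_le_two_pow
  omega

/-! ### ★★★ the theorem -/

/-- ★★★ **`exactTilted.Law` HOLDS ON THE PAIR CUBE** (the Law's literal currency; budget hypothesis unused). -/
theorem exactTilted_law_holds_on_qPair : ∀ c : ℕ, ∃ n₀ : ℕ, ∀ n ≥ n₀,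
    ∀ (K : ℕ) (e : Fin (K + 1) ≃ Finset (PIdx n)) (r : ℕ),
    HasEFOfSize (convexHull ℝ (Set.range (qPair ∘ e))) r →
    ∀ mm : exactTilted.A n → ℝ, (∀ a j, exactTilted.ρ n a ⬝ᵥ (qPair ∘ e) j ≤ mm a) →
      (∀ a, ∃ j, exactTilted.ρ n a ⬝ᵥ (qPair ∘ e) j = mm a) →
    ∀ (U : exactTilted.A n → Option (Fin r) → ℝ) (V : Finset (Fin n) × Fin (K + 1) → Option (Fin r) → ℝ),
      (∀ a i, 0 ≤ U a i) → (∀ p i, 0 ≤ V p i) →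
      (∀ a b j, (exactTilted.β n a + mm a) - exactTilted.ρ n a ⬝ᵥ (udPt b + (qPair ∘ e) j) = ∑ i, U a i * V (b, j) i) →
      T c n < r := by
  classical
  intro c
  obtain ⟨n₀, hn₀⟩ := T_lt_of_block_half c
  refine ⟨n₀, fun n hn K e r _ mm hle hat U V hU hV hfac => hn₀ n hn r ?_⟩
  -- the block data
  let jstar : Fin (K + 1) := e.symm (Hstar n)
  let row : Finset (Fin (kk n)) → exactTilted.A n := fun a' => (a'.map (ι₁e n), Wm n)
  let col : Finset (Fin (kk n)) → Finset (Fin n) × Fin (K + 1) := fun S => (Bcol S, jstar)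
  have hq : (qPair ∘ e) jstar = qPair (Hstar n) := by simp [jstar]
  -- the common maximiser: `mm (row a') = ρ ⬝ q_{H⋆}`
  have hmm : ∀ a', mm (row a') = (udRow (a'.map (ι₁e n)) + flat (Wm n)) ⬝ᵥ qPair (Hstar n) := by
    intro a'
    obtain ⟨j₀, hj₀⟩ := hat (row a')
    have h1 := hle (row a') jstar
    rw [hq] at h1
    have h2 : exactTilted.ρ n (row a') ⬝ᵥ (qPair ∘ e) j₀ ≤ (udRow (a'.map (ι₁e n)) + flat (Wm n)) ⬝ᵥ qPair (Hstar n) :=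
      score_le_star _ (e j₀)
    rw [hj₀] at h2
    exact le_antisymm h2 h1
  have key := three_pow_le_of_block (ι := Option (Fin r)) U V hU hV row col ?_
  · simpa [Fintype.card_option, Fintype.card_fin] using key
  · intro a' S
    rw [← hfac (row a') (Bcol S) jstar, hq, hmm a']
    show ((1 + hCOR (Wm n)) + (udRow (a'.map (ι₁e n)) + flat (Wm n)) ⬝ᵥ qPair (Hstar n)) -
        (udRow (a'.map (ι₁e n)) + flat (Wm n)) ⬝ᵥ (udPt (Bcol S) + qPair (Hstar n)) = (1 - ((a' ∩ S).card : ℝ)) ^ 2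
    rw [dotProduct_add, add_dotProduct _ _ (udPt (Bcol S)), hCOR_Wm, Wm_dotProduct_Bcol, ← ud_block a' S]
    ring

end QPair

/-! ## §6 (rev 3) One law, two presentations: `pinnedRows.Law ↔ ExactPencilLaw` -/

section OneLaw

/-- ★ val-idea-40 g5's located family with exact right-hand sides (VERBATIM restatement of `LocatedRows.pinnedRows`). -/
@[reducible] def pinnedRows : RowFamily where
  A := fun n => Finset (Fin n) ×
    {wS : (Fin (n * n) → ℝ) × Finset (Fin n) // ∀ x ∈ corPolytope n, wS.1 ⬝ᵥ x ≤ wS.1 ⬝ᵥ udPt wS.2}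
  ρ := fun _ a => udRow a.1 + a.2.1.1
  β := fun _ a => 1 + a.2.1.1 ⬝ᵥ udPt a.2.1.2
  valid := fun n a x hx => by
    rw [add_dotProduct]
    exact add_le_add ((ud_data n).2.1 a.1 x hx) (a.2.2 x hx)

/-- un-flattening a vector of `ℝ^{n²}` into a matrix. -/
def unflat {n : ℕ} (v : Fin (n * n) → ℝ) : Matrix (Fin n) (Fin n) ℝ := fun i j => v (finProdFinEquiv (i, j))

theorem flat_unflat {n : ℕ} (v : Fin (n * n) → ℝ) : flat (unflat v) = v := by
  funext p
  simp only [flat, unflat]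
  first
    | rfl
    | exact congrArg v (finProdFinEquiv.apply_symm_apply p)

/-- a direction maximised over `COR(n)` at the vertex `x_S` has `h_COR = ⟨·, x_S⟩`. -/
theorem hCOR_unflat_eq {n : ℕ} (w : Fin (n * n) → ℝ) (S : Finset (Fin n))
    (h : ∀ x ∈ corPolytope n, w ⬝ᵥ x ≤ w ⬝ᵥ udPt S) : hCOR (unflat w) = w ⬝ᵥ udPt S := by
  apply le_antisymm
  · refine Finset.sup'_le _ _ fun b _ => ?_
    rw [flat_unflat]; exact h _ ((ud_data n).1 b)
  · have := le_hCOR (unflat w) S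
    rwa [flat_unflat] at this

/-- `pinnedRows ↪ exactTilted`. -/
noncomputable def pinnedRows_emb_exactTilted : RowFamily.Emb pinnedRows exactTilted where
  φ := fun _ a => (a.1, unflat a.2.1.1)
  ρ_eq := fun n a => by
    show udRow a.1 + flat (unflat a.2.1.1) = udRow a.1 + a.2.1.1
    rw [flat_unflat]
  β_eq := fun n a => by
    show 1 + hCOR (unflat a.2.1.1) = 1 + a.2.1.1 ⬝ᵥ udPt a.2.1.2
    rw [hCOR_unflat_eq _ _ a.2.2]

/-- `exactTilted ↪ pinnedRows` (pin at a maximising vertex of `h_COR`). -/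
noncomputable def exactTilted_emb_pinnedRows : RowFamily.Emb exactTilted pinnedRows where
  φ := fun _ a => (a.1, ⟨(flat a.2, Classical.choose (exists_eq_hCOR a.2)), fun x hx => by
      rw [Classical.choose_spec (exists_eq_hCOR a.2)]; exact flat_le_hCOR a.2 x hx⟩)
  ρ_eq := fun _ _ => rfl
  β_eq := fun n a => by
    show (1 : ℝ) + flat a.2 ⬝ᵥ udPt (Classical.choose (exists_eq_hCOR a.2)) = 1 + hCOR a.2
    rw [Classical.choose_spec (exists_eq_hCOR a.2)]

/-- ★★ **ONE LAW**: `pinnedRows.Law ↔ ExactPencilLaw` — N22's repaired statement C′ has a single meaning. -/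
theorem pinnedRowsLaw_iff_exactPencilLaw : pinnedRows.Law ↔ ExactPencilLaw :=
  ⟨fun h => RowFamily.Law.mono pinnedRows_emb_exactTilted h, fun h => RowFamily.Law.mono exactTilted_emb_pinnedRows h⟩

/-- hence 40 g5's glue in this file's names: `pinnedRows.Law → CorVirtualHardN`. -/
theorem corVirtualHardN_of_pinnedRowsLaw (h : pinnedRows.Law) : CorVirtualHardN :=
  corVirtualHardN_of_exactPencilLaw (pinnedRowsLaw_iff_exactPencilLaw.mp h)

end OneLaw

/-! ## §7 (rev 4) Exactly when does the exact right-hand side differ from the box right-hand side? -/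

section ExactVsBox

variable {n : ℕ}

theorem flat_dotProduct_udPt (W : Matrix (Fin n) (Fin n) ℝ) (b : Finset (Fin n)) :
    flat W ⬝ᵥ udPt b = ∑ i, ∑ m, W i m * (udInd b i * udInd b m) := by
  show flat W ⬝ᵥ vecOuter n (udInd b) = _
  rw [flat_dotProduct_vecOuter]

/-- one box term dominates the corresponding read term at a vertex. -/
theorem read_le_box_term (W : Matrix (Fin n) (Fin n) ℝ) (b : Finset (Fin n)) (i m : Fin n) :
    W i m * (udInd b i * udInd b m) ≤ max (W i m) 0 := by
  rw [udInd_apply, udInd_apply]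
  split_ifs <;> simp

/-- ★★ `h_COR(W) = box(W)` **iff the sign pattern of `W` is clique-realizable.** -/
theorem hCOR_eq_box_iff (W : Matrix (Fin n) (Fin n) ℝ) :
    hCOR W = ∑ i, ∑ m, max (W i m) 0 ↔
      ∃ b : Finset (Fin n), ∀ i m, (0 < W i m → i ∈ b ∧ m ∈ b) ∧ (W i m < 0 → ¬ (i ∈ b ∧ m ∈ b)) := by
  constructor
  · intro h
    obtain ⟨b, hb⟩ := exists_eq_hCOR W
    rw [h, flat_dotProduct_udPt] at hb
    have hnn : ∀ i m, 0 ≤ max (W i m) 0 - W i m * (udInd b i * udInd b m) :=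
      fun i m => sub_nonneg.mpr (read_le_box_term W b i m)
    have hzero : ∑ i, ∑ m, (max (W i m) 0 - W i m * (udInd b i * udInd b m)) = 0 := by
      simp only [Finset.sum_sub_distrib]
      linarith
    refine ⟨b, fun i m => ?_⟩
    have him : max (W i m) 0 - W i m * (udInd b i * udInd b m) = 0 := by
      have h1 := (Finset.sum_eq_zero_iff_of_nonneg
        (fun i _ => Finset.sum_nonneg fun m _ => hnn i m)).mp hzero i (Finset.mem_univ _)
      exact (Finset.sum_eq_zero_iff_of_nonneg (fun m _ => hnn i m)).mp h1 m (Finset.mem_univ _)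
    rw [udInd_apply, udInd_apply] at him
    constructor
    · intro hpos
      by_contra hnot
      have h0 : (if i ∈ b then (1:ℝ) else 0) * (if m ∈ b then 1 else 0) = 0 := by
        rcases not_and_or.mp hnot with h' | h' <;> simp [h']
      rw [h0, mul_zero, sub_zero, max_eq_left hpos.le] at him
      linarith
    · intro hneg hin
      rw [if_pos hin.1, if_pos hin.2, mul_one, mul_one, max_eq_right hneg.le] at him
      linarith
  · rintro ⟨b, hb⟩
    apply le_antisymm (hCOR_le_box W)
    have key : flat W ⬝ᵥ udPt b = ∑ i, ∑ m, max (W i m) 0 := by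
      rw [flat_dotProduct_udPt]
      refine Finset.sum_congr rfl fun i _ => Finset.sum_congr rfl fun m _ => ?_
      rw [udInd_apply, udInd_apply]
      rcases lt_trichotomy (W i m) 0 with hlt | heq | hgt
      · have hno := (hb i m).2 hlt
        have h0 : (if i ∈ b then (1:ℝ) else 0) * (if m ∈ b then 1 else 0) = 0 := by
          rcases not_and_or.mp hno with h' | h' <;> simp [h']
        rw [h0, mul_zero, max_eq_right hlt.le]
      · simp [heq]
      · obtain ⟨hi, hm⟩ := (hb i m).1 hgt
        rw [if_pos hi, if_pos hm, mul_one, mul_one, max_eq_left hgt.le]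
    rw [← key]
    exact le_hCOR W b

/-- ★ every DIAGONAL direction is clique-realizable (`b = {σ > 0}`): `h_COR(diag σ) = box(diag σ)` (`= Σ σ⁺`). -/
theorem hCOR_diagonal (σ : Fin n → ℝ) :
    hCOR (Matrix.diagonal σ) = ∑ i, ∑ m, max (Matrix.diagonal σ i m) 0 := by
  refine (hCOR_eq_box_iff _).mpr ⟨Finset.univ.filter (fun i => 0 < σ i), fun i m => ⟨fun h => ?_, fun h hin => ?_⟩⟩
  · by_cases him : i = m
    · subst him
      rw [Matrix.diagonal_apply_eq] at h
      simp [h]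
    · rw [Matrix.diagonal_apply_ne _ him] at h
      exact absurd h (lt_irrefl 0)
  · by_cases him : i = m
    · subst him
      rw [Matrix.diagonal_apply_eq] at h
      have := (Finset.mem_filter.mp hin.1).2
      linarith
    · rw [Matrix.diagonal_apply_ne _ him] at h
      exact absurd h (lt_irrefl 0)

/-- hence on diagonal tilts the exact and the box located families have the SAME right-hand side (and the same row). -/
theorem exactTilted_β_diagonal (a : Finset (Fin n)) (σ : Fin n → ℝ) :
    exactTilted.β n (a, Matrix.diagonal σ) = entryTilted.β n (a, Matrix.diagonal σ) := by
  show 1 + hCOR (Matrix.diagonal σ) = 1 + ∑ i, ∑ m, max (Matrix.diagonal σ i m) 0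
  rw [hCOR_diagonal]

theorem exactTilted_ρ_eq_entryTilted_ρ (a : Finset (Fin n) × Matrix (Fin n) (Fin n) ℝ) :
    exactTilted.ρ n a = entryTilted.ρ n a := rfl

/-- ★ a NON-realizable pattern is read STRICTLY better by the exact row (`h_COR(D_π) < box`). -/
theorem hCOR_dPair_lt_box {j m : Fin n} (hjm : j ≠ m) :
    hCOR (dPair j m) < ∑ i, ∑ i', max (dPair j m i i') 0 := by
  classical
  have hle : hCOR (dPair j m) ≤ 1 := by
    refine Finset.sup'_le _ _ fun b _ => ?_
    exact flat_dPair_dotProduct_udPt_le_one b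
  have hbox : (2 : ℝ) ≤ ∑ i, ∑ i', max (dPair j m i i') 0 := by
    have hj : (1 : ℝ) ≤ ∑ i', max (dPair j m j i') 0 := by
      have := Finset.single_le_sum (f := fun i' => max (dPair j m j i') 0) (fun i' _ => le_max_right _ _)
        (Finset.mem_univ j)
      refine le_trans ?_ this
      simp [dPair, hjm]
    have hm : (1 : ℝ) ≤ ∑ i', max (dPair j m m i') 0 := by
      have := Finset.single_le_sum (f := fun i' => max (dPair j m m i') 0) (fun i' _ => le_max_right _ _)
        (Finset.mem_univ m)
      refine le_trans ?_ this
      simp [dPair, hjm.symm]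
    have h2 := Finset.add_le_sum (f := fun i => ∑ i', max (dPair j m i i') 0)
      (fun i _ => Finset.sum_nonneg fun i' _ => le_max_right _ _) (Finset.mem_univ j) (Finset.mem_univ m) hjm
    linarith
  linarith

end ExactVsBox

/-! ## §8 (rev 5) The pair cube at the TOP law: `xc(COR_n + Q_pair) > T c n` (Yannakakis, once) -/

section TopLaw

/-- the §5 engine, columns indexed by graphs `H ⊆ PIdx n` directly, no budget hypothesis. -/
theorem exactTilted_block_qPair (c : ℕ) : ∃ n₀ : ℕ, ∀ n ≥ n₀, ∀ (r : ℕ)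
    (mm : exactTilted.A n → ℝ), (∀ a H, exactTilted.ρ n a ⬝ᵥ qPair H ≤ mm a) →
      (∀ a, ∃ H, exactTilted.ρ n a ⬝ᵥ qPair H = mm a) →
    ∀ (U : exactTilted.A n → Option (Fin r) → ℝ) (V : Finset (Fin n) × Finset (PIdx n) → Option (Fin r) → ℝ),
      (∀ a i, 0 ≤ U a i) → (∀ p i, 0 ≤ V p i) →
      (∀ a b H, (exactTilted.β n a + mm a) - exactTilted.ρ n a ⬝ᵥ (udPt b + qPair H) = ∑ i, U a i * V (b, H) i) →
      T c n < r := by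
  classical
  obtain ⟨n₀, hn₀⟩ := T_lt_of_block_half c
  refine ⟨n₀, fun n hn r mm hle hat U V hU hV hfac => hn₀ n hn r ?_⟩
  let row : Finset (Fin (kk n)) → exactTilted.A n := fun a' => (a'.map (ι₁e n), Wm n)
  let col : Finset (Fin (kk n)) → Finset (Fin n) × Finset (PIdx n) := fun S => (Bcol S, Hstar n)
  have hmm : ∀ a', mm (row a') = (udRow (a'.map (ι₁e n)) + flat (Wm n)) ⬝ᵥ qPair (Hstar n) := by
    intro a'
    obtain ⟨H₀, hH₀⟩ := hat (row a')
    have h1 := hle (row a') (Hstar n)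
    have h2 : exactTilted.ρ n (row a') ⬝ᵥ qPair H₀ ≤ (udRow (a'.map (ι₁e n)) + flat (Wm n)) ⬝ᵥ qPair (Hstar n) :=
      score_le_star _ H₀
    rw [hH₀] at h2
    exact le_antisymm h2 h1
  have key := three_pow_le_of_block (ι := Option (Fin r)) U V hU hV row col ?_
  · simpa [Fintype.card_option, Fintype.card_fin] using key
  · intro a' S
    rw [← hfac (row a') (Bcol S) (Hstar n), hmm a']
    show ((1 + hCOR (Wm n)) + (udRow (a'.map (ι₁e n)) + flat (Wm n)) ⬝ᵥ qPair (Hstar n)) -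
        (udRow (a'.map (ι₁e n)) + flat (Wm n)) ⬝ᵥ (udPt (Bcol S) + qPair (Hstar n)) = (1 - ((a' ∩ S).card : ℝ)) ^ 2
    rw [dotProduct_add, add_dotProduct _ _ (udPt (Bcol S)), hCOR_Wm, Wm_dotProduct_Bcol, ← ud_block a' S]
    ring

/-- ★★★ **THE PAIR CUBE IS DECIDED AT THE TOP LAW** (eventually in `n`). -/
theorem cor_add_qPair_decided (c : ℕ) : ∃ n₀ : ℕ, ∀ n ≥ n₀, ∀ r : ℕ,
    HasEFOfSize (corPolytope n + convexHull ℝ (Set.range (qPair (n := n)))) r → T c n < r := by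
  classical
  obtain ⟨n₀, hn₀⟩ := exactTilted_block_qPair c
  refine ⟨n₀, fun n hn r hEF => ?_⟩
  obtain ⟨pt_mem, -, -, -⟩ := ud_data n
  let mm : exactTilted.A n → ℝ := fun a =>
    Finset.univ.sup' Finset.univ_nonempty (fun H : Finset (PIdx n) => exactTilted.ρ n a ⬝ᵥ qPair H)
  have hat : ∀ a, ∃ H, exactTilted.ρ n a ⬝ᵥ qPair H = mm a := fun a => by
    obtain ⟨H, -, hH⟩ := Finset.exists_mem_eq_sup' Finset.univ_nonempty
      (fun H : Finset (PIdx n) => exactTilted.ρ n a ⬝ᵥ qPair H)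
    exact ⟨H, hH.symm⟩
  have hle : ∀ a H, exactTilted.ρ n a ⬝ᵥ qPair H ≤ mm a := fun a H =>
    Finset.le_sup' (fun H : Finset (PIdx n) => exactTilted.ρ n a ⬝ᵥ qPair H) (Finset.mem_univ H)
  have hm : ∀ a, ∀ y ∈ convexHull ℝ (Set.range (qPair (n := n))), exactTilted.ρ n a ⬝ᵥ y ≤ mm a := fun a =>
    dot_le_of_mem_convexHull _ _ _ (by rintro _ ⟨H, rfl⟩; exact hle a H)
  have hq : ∀ H : Finset (PIdx n), qPair H ∈ convexHull ℝ (Set.range (qPair (n := n))) :=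
    fun H => subset_convexHull ℝ _ ⟨H, rfl⟩
  have hv : ∀ p : Finset (Fin n) × Finset (PIdx n),
      udPt p.1 + qPair p.2 ∈ corPolytope n + convexHull ℝ (Set.range (qPair (n := n))) :=
    fun p => Set.add_mem_add (pt_mem p.1) (hq p.2)
  have hvalid : ∀ a, ∀ x ∈ corPolytope n + convexHull ℝ (Set.range (qPair (n := n))),
      exactTilted.ρ n a ⬝ᵥ x ≤ exactTilted.β n a + mm a := by
    rintro a x ⟨p, hp, y, hy, rfl⟩
    rw [dotProduct_add]
    exact add_le_add (exactTilted.valid n a p hp) (hm a y hy)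
  obtain ⟨U, V, hU, hV, hfac⟩ := Literature.Barriers.PneNP.HasEFOfSize.exists_nonneg_factorization hEF
    (fun p : Finset (Fin n) × Finset (PIdx n) => udPt p.1 + qPair p.2) hv (exactTilted.ρ n)
    (fun a => exactTilted.β n a + mm a) hvalid
  exact hn₀ n hn r mm hle hat U V hU hV (fun a b H => hfac a (b, H))

end TopLaw


/-! ## §9 (rev 6) BEYOND THE PIN CEILING: zero-diagonal difference cubes (`zgen`, the `Z_mix` shape, not `PinExposed`) are DECIDED at the
TRANSVERSAL face of `W^z` (`Wz`, `hCOR_Wz`, `zsc_le_star`): ★ `exactTilted_law_holds_on_zgenCube`, ★ `cor_add_zgenCube_decided`. -/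

section ZgenCube
variable {n : ℕ}

/-! ### the generators and the passenger (40 g5, verbatim) -/

/-- (40 g5 `LocatedRows.zgen`, verbatim) the `Z_mix` generator `E^s_{kl} − E^s_{km}` as a matrix. -/
def zgen (k l m : Fin n) : Matrix (Fin n) (Fin n) ℝ := fun p q =>
  (if (p = k ∧ q = l) ∨ (p = l ∧ q = k) then (1 : ℝ) else 0) - (if (p = k ∧ q = m) ∨ (p = m ∧ q = k) then 1 else 0)

/-- (40 g5 `LocatedRows.cubePt`, verbatim) AFFINE-CUBE passenger: vertices `q_P = flat (Q₀ + Σ_{g∈P} G g)`, `P ⊆ [N]`. -/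
def cubePt {N : ℕ} (Q₀ : Matrix (Fin n) (Fin n) ℝ) (G : Fin N → Matrix (Fin n) (Fin n) ℝ) (P : Finset (Fin N)) :
    Fin (n * n) → ℝ :=
  flat (Q₀ + ∑ g ∈ P, G g)

theorem dotProduct_cubePt {N : ℕ} (ρ : Fin (n * n) → ℝ) (Q₀ : Matrix (Fin n) (Fin n) ℝ)
    (G : Fin N → Matrix (Fin n) (Fin n) ℝ) (P : Finset (Fin N)) :
    ρ ⬝ᵥ cubePt Q₀ G P = ρ ⬝ᵥ flat Q₀ + ∑ g ∈ P, ρ ⬝ᵥ flat (G g) := by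
  unfold cubePt
  change ρ ⬝ᵥ flatLin n (Q₀ + ∑ g ∈ P, G g) = ρ ⬝ᵥ flatLin n Q₀ + ∑ g ∈ P, ρ ⬝ᵥ flatLin n (G g)
  rw [map_add, map_sum, dotProduct_add, dotProduct_sum]

/-- «every generator is a zero-diagonal difference `E^s_{kl} − E^s_{km}`» (the all-triples cube of 40 g5 §5b is one). -/
def IsZgenCube {N : ℕ} (G : Fin N → Matrix (Fin n) (Fin n) ℝ) : Prop :=
  ∀ t, ∃ k l m : Fin n, k ≠ l ∧ k ≠ m ∧ l ≠ m ∧ G t = zgen k l m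

theorem ite_or_eq_add {A B : Prop} [Decidable A] [Decidable B] (h : ¬ (A ∧ B)) :
    (if A ∨ B then (1 : ℝ) else 0) = (if A then 1 else 0) + (if B then 1 else 0) := by
  by_cases hA : A <;> by_cases hB : B
  · exact absurd ⟨hA, hB⟩ h
  all_goals simp [hA, hB]

/-- the symmetrised-entry read of a difference generator. -/
theorem flat_dotProduct_zgen (C : Matrix (Fin n) (Fin n) ℝ) {k l m : Fin n} (hkl : k ≠ l) (hkm : k ≠ m) :
    flat C ⬝ᵥ flat (zgen k l m) = (C k l + C l k) - (C k m + C m k) := by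
  rw [flat_dotProduct_flat]
  have h : ∀ i j : Fin n, C i j * zgen k l m i j =
      (C i j * (if i = k ∧ j = l then (1 : ℝ) else 0) + C i j * (if i = l ∧ j = k then (1 : ℝ) else 0)) -
      (C i j * (if i = k ∧ j = m then (1 : ℝ) else 0) + C i j * (if i = m ∧ j = k then (1 : ℝ) else 0)) := by
    intro i j
    unfold zgen
    rw [ite_or_eq_add (fun hh => hkl (hh.1.1.symm.trans hh.2.1)), ite_or_eq_add (fun hh => hkm (hh.1.1.symm.trans hh.2.1))]
    ring
  simp_rw [h]
  simp only [Finset.sum_sub_distrib, Finset.sum_add_distrib, sum_sum_mul_ite_and]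
  ring

/-- CLIQUE WEIGHT of a difference generator. -/
theorem udRow_dotProduct_zgen (a : Finset (Fin n)) {k l m : Fin n} (hkl : k ≠ l) (hkm : k ≠ m) :
    udRow a ⬝ᵥ flat (zgen k l m) = 2 * udInd a k * (udInd a m - udInd a l) := by
  rw [show udRow a = flat (udMat a) from rfl, flat_dotProduct_zgen _ hkl hkm]
  simp only [udMat, if_neg hkl, if_neg (Ne.symm hkl), if_neg hkm, if_neg (Ne.symm hkm)]
  ring

theorem abs_udRow_dotProduct_zgen_le (a : Finset (Fin n)) {k l m : Fin n} (hkl : k ≠ l) (hkm : k ≠ m) :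
    -2 ≤ udRow a ⬝ᵥ flat (zgen k l m) ∧ udRow a ⬝ᵥ flat (zgen k l m) ≤ 2 := by
  rw [udRow_dotProduct_zgen a hkl hkm, udInd_apply, udInd_apply, udInd_apply]
  split_ifs <;> norm_num

/-! ### the direction `W^z` -/

/-- the pair index: `s(t) = s(t+k) = t+1` on `[2k]`, `0` on the idle index. -/
def sIdx (x : Fin n) : ℕ := if (x : ℕ) < 2 * kk n then (x : ℕ) % kk n + 1 else 0

theorem sIdx_of_lt {x : Fin n} (hx : (x : ℕ) < kk n) : sIdx x = x + 1 := by
  unfold sIdx; rw [if_pos (by omega), Nat.mod_eq_of_lt hx]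

theorem sIdx_ι₁ (t : Fin (kk n)) : sIdx (ι₁ t : Fin n) = t + 1 := sIdx_of_lt (by simp)

theorem sIdx_ι₂ (t : Fin (kk n)) : sIdx (ι₂ t : Fin n) = t + 1 := by
  have := t.2
  simp only [sIdx, ι₂_val]
  rw [if_pos (by omega), Nat.add_mod_right, Nat.mod_eq_of_lt this]

theorem sIdx_le (x : Fin n) : sIdx x ≤ kk n := by
  unfold sIdx
  split_ifs with h
  · have hk : 0 < kk n := by omega
    have := Nat.mod_lt (x : ℕ) hk
    omega
  · exact Nat.zero_le _

/-- the penalty `μ = 2n³` (at least the total positive mass of `W^z`). -/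
def μz (n : ℕ) : ℤ := 2 * (n : ℤ) ^ 3

/-- the integer table of `W^z`. -/
def WzInt (x y : Fin n) : ℤ :=
  if x = y then 0 else if (sIdx x = sIdx y ∨ sIdx x = 0 ∨ sIdx y = 0) then -μz n else 2 * ((sIdx x + sIdx y : ℕ) : ℤ)

/-- ★ the located direction `W^z`. -/
def Wz (n : ℕ) : Matrix (Fin n) (Fin n) ℝ := fun x y => (WzInt x y : ℝ)

theorem Wz_apply (x y : Fin n) : Wz n x y = (WzInt x y : ℝ) := rfl

theorem WzInt_symm (x y : Fin n) : WzInt x y = WzInt y x := by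
  unfold WzInt
  by_cases h : x = y
  · subst h; rfl
  · rw [if_neg h, if_neg (Ne.symm h)]
    have hiff : (sIdx x = sIdx y ∨ sIdx x = 0 ∨ sIdx y = 0) ↔ (sIdx y = sIdx x ∨ sIdx y = 0 ∨ sIdx x = 0) := by
      constructor <;> rintro (h | h | h) <;> omega
    by_cases hc : sIdx x = sIdx y ∨ sIdx x = 0 ∨ sIdx y = 0
    · rw [if_pos hc, if_pos (hiff.mp hc)]
    · rw [if_neg hc, if_neg (fun h' => hc (hiff.mpr h'))]; push_cast; ring

theorem Wz_symm (x y : Fin n) : Wz n x y = Wz n y x := by rw [Wz_apply, Wz_apply, WzInt_symm]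

theorem WzInt_self (x : Fin n) : WzInt x x = 0 := by simp [WzInt]

theorem WzInt_le (x y : Fin n) : WzInt x y ≤ 2 * n := by
  unfold WzInt μz
  split_ifs
  · positivity
  · nlinarith [sq_nonneg (n : ℤ), (by positivity : (0 : ℤ) ≤ n)]
  · have h1 := sIdx_le x; have h2 := sIdx_le y
    have h3 : 2 * kk n ≤ n := by unfold kk; omega
    push_cast; omega

/-- the pencil values of `W^z` are INTEGERS: a positive difference is `≥ 1`, a negative one `≤ −1`. -/
theorem Wz_sub_trichotomy (x y y' : Fin n) :
    Wz n x y - Wz n x y' ≤ -1 ∨ Wz n x y - Wz n x y' = 0 ∨ 1 ≤ Wz n x y - Wz n x y' := by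
  rw [Wz_apply, Wz_apply, ← Int.cast_sub]
  rcases lt_trichotomy (WzInt x y - WzInt x y') 0 with h | h | h
  · left; exact_mod_cast (show WzInt x y - WzInt x y' ≤ -1 by omega)
  · right; left; exact_mod_cast h
  · right; right; exact_mod_cast (show (1 : ℤ) ≤ WzInt x y - WzInt x y' by omega)

/-- three LEFT endpoints are never unpinned: `W^z_{kl} − W^z_{km} = 2(l − m) ≠ 0`. -/
theorem Wz_sub_ne_zero_of_lt {k l m : Fin n} (hk : (k : ℕ) < kk n) (hl : (l : ℕ) < kk n) (hm : (m : ℕ) < kk n)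
    (hkl : k ≠ l) (hkm : k ≠ m) (hlm : l ≠ m) : Wz n k l - Wz n k m ≠ 0 := by
  have hkl' : (k : ℕ) ≠ l := fun h => hkl (Fin.ext h)
  have hkm' : (k : ℕ) ≠ m := fun h => hkm (Fin.ext h)
  have hlm' : (l : ℕ) ≠ m := fun h => hlm (Fin.ext h)
  rw [Wz_apply, Wz_apply]
  unfold WzInt
  rw [if_neg hkl, if_neg hkm, sIdx_of_lt hk, sIdx_of_lt hl, sIdx_of_lt hm, if_neg (by omega), if_neg (by omega)]
  push_cast
  intro h
  apply hlm'
  have : (l : ℝ) = m := by linarith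
  exact_mod_cast this

/-! ### the exact rhs: `h_COR(W^z) = F⋆`, attained exactly on the transversal face -/

/-- `Σ_{x,y ∈ b} W_{xy}` form of a located read. -/
theorem flat_dotProduct_udPt_sum (W : Matrix (Fin n) (Fin n) ℝ) (b : Finset (Fin n)) :
    flat W ⬝ᵥ udPt b = ∑ x ∈ b, ∑ y ∈ b, W x y := by
  classical
  rw [flat_dotProduct_udPt]
  have inner : ∀ x, ∑ y, W x y * (udInd b x * udInd b y) = if x ∈ b then ∑ y ∈ b, W x y else 0 := by
    intro x
    by_cases hx : x ∈ b
    · rw [if_pos hx]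
      have h : ∀ y, W x y * (udInd b x * udInd b y) = if y ∈ b then W x y else 0 := by
        intro y
        rw [udInd_apply, udInd_apply, if_pos hx]
        split_ifs <;> simp
      simp_rw [h]
      rw [← Finset.sum_filter, Finset.filter_mem_eq_inter, Finset.univ_inter]
    · rw [if_neg hx]
      exact Finset.sum_eq_zero fun y _ => by rw [udInd_apply b x, if_neg hx]; ring
  simp_rw [inner]
  rw [← Finset.sum_filter, Finset.filter_mem_eq_inter, Finset.univ_inter]

/-- the representative of pair `u` on the transversal `B_S`. -/
def rep (S : Finset (Fin (kk n))) (u : Fin (kk n)) : Fin n := if u ∈ S then ι₁ u else ι₂ u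

theorem sIdx_rep (S : Finset (Fin (kk n))) (u : Fin (kk n)) : sIdx (rep S u : Fin n) = u + 1 := by
  unfold rep; split_ifs
  exacts [sIdx_ι₁ u, sIdx_ι₂ u]

theorem rep_injective (S : Finset (Fin (kk n))) : Function.Injective (rep (n := n) S) := by
  intro u v h
  have := congrArg sIdx h
  rw [sIdx_rep, sIdx_rep] at this
  exact Fin.ext (by omega)

theorem mem_Bcol_iff_rep (S : Finset (Fin (kk n))) (x : Fin n) : x ∈ Bcol S ↔ ∃ u, x = rep S u := by
  classical
  constructor
  · intro hx
    rcases Finset.mem_union.mp hx with h | h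
    · obtain ⟨u, hu, rfl⟩ := Finset.mem_map.mp h
      exact ⟨u, by simp [rep, hu, ι₁e]⟩
    · obtain ⟨u, hu, rfl⟩ := Finset.mem_map.mp h
      rw [Finset.mem_compl] at hu
      exact ⟨u, by simp [rep, hu, ι₂e]⟩
  · rintro ⟨u, rfl⟩
    unfold rep
    split_ifs with hu
    · exact (ι₁_mem_Bcol S u).mpr hu
    · exact (ι₂_mem_Bcol S u).mpr hu

theorem sum_Bcol (g : Fin n → ℝ) (S : Finset (Fin (kk n))) : ∑ x ∈ Bcol S, g x = ∑ u, g (rep S u) := by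
  classical
  have hdisj : Disjoint (S.map (ι₁e n)) (Sᶜ.map (ι₂e n)) := by
    refine Finset.disjoint_left.mpr fun x hx hx' => ?_
    obtain ⟨u, -, rfl⟩ := Finset.mem_map.mp hx
    obtain ⟨v, -, hv⟩ := Finset.mem_map.mp hx'
    exact ι₁_ne_ι₂ u v hv.symm
  rw [Bcol, Finset.sum_union hdisj, Finset.sum_map, Finset.sum_map, ← Finset.sum_add_sum_compl S (fun u => g (rep S u))]
  congr 1
  · exact Finset.sum_congr rfl fun u hu => by simp [rep, hu, ι₁e]
  · exact Finset.sum_congr rfl fun u hu => by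
      rw [Finset.mem_compl] at hu
      simp [rep, hu, ι₂e]

/-- the TRANSVERSAL VALUE `F⋆ = Σ_{u ≠ v} 2(u+1+v+1)` (the same for every transversal). -/
def Fstar (n : ℕ) : ℝ := ∑ u : Fin (kk n), ∑ v : Fin (kk n), (if u = v then (0 : ℝ) else 2 * (((u : ℕ) : ℝ) + 1 + (((v : ℕ) : ℝ) + 1)))

theorem Wz_rep (S : Finset (Fin (kk n))) (u v : Fin (kk n)) :
    Wz n (rep S u) (rep S v) = if u = v then (0 : ℝ) else 2 * (((u : ℕ) : ℝ) + 1 + (((v : ℕ) : ℝ) + 1)) := by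
  rw [Wz_apply]
  unfold WzInt
  by_cases h : u = v
  · subst h; simp
  · have hne : rep S u ≠ rep S v := fun h' => h (rep_injective S h')
    have huv : (u : ℕ) ≠ v := fun h' => h (Fin.ext h')
    rw [if_neg hne, if_neg h, sIdx_rep, sIdx_rep, if_neg (by omega)]
    push_cast; ring

theorem Wz_rep_nonneg (S : Finset (Fin (kk n))) (u v : Fin (kk n)) : 0 ≤ Wz n (rep S u) (rep S v) := by
  rw [Wz_rep]; split_ifs <;> positivity

/-- every transversal reads `F⋆`. -/
theorem Wz_dotProduct_Bcol (S : Finset (Fin (kk n))) : flat (Wz n) ⬝ᵥ udPt (Bcol S) = Fstar n := by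
  rw [flat_dotProduct_udPt_sum, sum_Bcol]
  unfold Fstar
  refine Finset.sum_congr rfl fun u _ => ?_
  rw [sum_Bcol]
  exact Finset.sum_congr rfl fun v _ => Wz_rep S u v

theorem Fstar_nonneg : 0 ≤ Fstar n :=
  Finset.sum_nonneg fun _ _ => Finset.sum_nonneg fun _ _ => by split_ifs <;> positivity

/-- ★ VALIDITY with the exact rhs: every vertex of `COR(n)` reads `≤ F⋆` against `W^z`. -/
theorem Wz_dotProduct_udPt_le (b : Finset (Fin n)) : flat (Wz n) ⬝ᵥ udPt b ≤ Fstar n := by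
  classical
  rw [flat_dotProduct_udPt_sum]
  by_cases hbad : ∃ x ∈ b, ∃ y ∈ b, x ≠ y ∧ (sIdx x = sIdx y ∨ sIdx x = 0 ∨ sIdx y = 0)
  · -- BAD CASE: a `−μ` entry is present and dominates all positive mass
    obtain ⟨x, hx, y, hy, hxy, hb⟩ := hbad
    have hWxy : Wz n x y = -(2 * (n : ℝ) ^ 3) := by
      rw [Wz_apply]; unfold WzInt μz; rw [if_neg hxy, if_pos hb]; push_cast; ring
    rw [← Finset.sum_product']
    have hmem : (x, y) ∈ b ×ˢ b := Finset.mk_mem_product hx hy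
    rw [← Finset.add_sum_erase _ _ hmem]
    have hrest : ∑ p ∈ (b ×ˢ b).erase (x, y), Wz n p.1 p.2 ≤ ((b ×ˢ b).erase (x, y)).card • (2 * (n : ℝ)) :=
      Finset.sum_le_card_nsmul _ _ _ fun p _ => by
        rw [Wz_apply]; exact_mod_cast WzInt_le p.1 p.2
    rw [nsmul_eq_mul] at hrest
    have hcard : ((((b ×ˢ b).erase (x, y)).card : ℕ) : ℝ) ≤ (n : ℝ) ^ 2 := by
      have h1 := Finset.card_erase_le (s := b ×ˢ b) (a := (x, y))
      have h2 : (b ×ˢ b).card = b.card * b.card := Finset.card_product _ _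
      have h3 : b.card ≤ n := by simpa using Finset.card_le_univ b
      have : ((b ×ˢ b).erase (x, y)).card ≤ n ^ 2 := by
        rw [pow_two]; exact h1.trans (h2 ▸ Nat.mul_le_mul h3 h3)
      exact_mod_cast this
    have hF := Fstar_nonneg (n := n)
    have hn : (0 : ℝ) ≤ 2 * n := by positivity
    nlinarith [mul_le_mul_of_nonneg_right hcard hn]
  · -- GOOD CASE: no partners, no idle index (unless `b` is a singleton)
    push Not at hbad
    by_cases hz : ∃ x ∈ b, sIdx x = 0
    · obtain ⟨x, hx, hx0⟩ := hz
      have hb : b = {x} := by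
        refine Finset.eq_singleton_iff_unique_mem.mpr ⟨hx, fun y hy => ?_⟩
        by_contra hne
        exact (hbad y hy x hx hne).2.2 hx0
      rw [hb, Finset.sum_singleton, Finset.sum_singleton, Wz_apply, WzInt_self, Int.cast_zero]
      exact Fstar_nonneg
    · push Not at hz
      -- `b` is a partial transversal: `b ⊆ B_S` with `S = {u : ι₂ u ∉ b}`
      let S : Finset (Fin (kk n)) := Finset.univ.filter (fun u => (ι₂ u : Fin n) ∉ b)
      have hsub : b ⊆ Bcol S := by
        intro x hx
        have hx2 : (x : ℕ) < 2 * kk n := by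
          by_contra h
          exact hz x hx (by unfold sIdx; rw [if_neg h])
        by_cases hxk : (x : ℕ) < kk n
        · have hxe : x = ι₁ (⟨x, hxk⟩ : Fin (kk n)) := Fin.ext rfl
          rw [hxe, ι₁_mem_Bcol]
          simp only [S, Finset.mem_filter, Finset.mem_univ, true_and]
          intro h2
          have hne : x ≠ ι₂ (⟨x, hxk⟩ : Fin (kk n)) := by
            intro h; have := congrArg Fin.val h; simp at this; omega
          apply (hbad x hx _ h2 hne).1
          rw [sIdx_of_lt hxk, sIdx_ι₂]
        · have hu : (x : ℕ) - kk n < kk n := by omega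
          have hxe : x = ι₂ (⟨(x : ℕ) - kk n, hu⟩ : Fin (kk n)) := Fin.ext (by simp; omega)
          rw [hxe, ι₂_mem_Bcol]
          simp only [S, Finset.mem_filter, Finset.mem_univ, true_and, not_not]
          rw [← hxe]; exact hx
      have hnonneg : ∀ x ∈ Bcol S, ∀ y ∈ Bcol S, 0 ≤ Wz n x y := by
        intro x hx y hy
        obtain ⟨u, rfl⟩ := (mem_Bcol_iff_rep S x).mp hx
        obtain ⟨v, rfl⟩ := (mem_Bcol_iff_rep S y).mp hy
        exact Wz_rep_nonneg S u v
      calc ∑ x ∈ b, ∑ y ∈ b, Wz n x y ≤ ∑ x ∈ b, ∑ y ∈ Bcol S, Wz n x y :=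
            Finset.sum_le_sum fun x hx => Finset.sum_le_sum_of_subset_of_nonneg hsub fun y hy _ => hnonneg x (hsub hx) y hy
        _ ≤ ∑ x ∈ Bcol S, ∑ y ∈ Bcol S, Wz n x y :=
            Finset.sum_le_sum_of_subset_of_nonneg hsub fun x hx _ => Finset.sum_nonneg fun y hy => hnonneg x hx y hy
        _ = Fstar n := by rw [← flat_dotProduct_udPt_sum]; exact Wz_dotProduct_Bcol S

/-- ★ the EXACT RHS of the located direction `W^z`. -/
theorem hCOR_Wz : hCOR (Wz n) = Fstar n :=
  le_antisymm (Finset.sup'_le _ _ fun b _ => Wz_dotProduct_udPt_le b)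
    (by have h := le_hCOR (Wz n) (Bcol ∅); rwa [Wz_dotProduct_Bcol] at h)

/-! ### pins and the common maximiser `H⋆` on the block rows -/

theorem Wz_dotProduct_zgen {k l m : Fin n} (hkl : k ≠ l) (hkm : k ≠ m) :
    flat (Wz n) ⬝ᵥ flat (zgen k l m) = 2 * (Wz n k l - Wz n k m) := by
  rw [flat_dotProduct_zgen _ hkl hkm, Wz_symm l k, Wz_symm m k]; ring

theorem val_lt_of_mem_map_ι₁e {a' : Finset (Fin (kk n))} {x : Fin n} (hx : x ∈ a'.map (ι₁e n)) : (x : ℕ) < kk n := by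
  obtain ⟨u, -, rfl⟩ := Finset.mem_map.mp hx
  exact u.2

/-- ★ the SCORE of one difference generator against a block row `(ι₁(α'), W^z)`. -/
theorem zscore_sign (a' : Finset (Fin (kk n))) {k l m : Fin n} (hkl : k ≠ l) (hkm : k ≠ m) (hlm : l ≠ m) :
    ((0 < Wz n k l - Wz n k m ∨ (Wz n k l - Wz n k m = 0 ∧ (m : ℕ) < kk n)) →
        0 ≤ (udRow (a'.map (ι₁e n)) + flat (Wz n)) ⬝ᵥ flat (zgen k l m)) ∧
    (¬ (0 < Wz n k l - Wz n k m ∨ (Wz n k l - Wz n k m = 0 ∧ (m : ℕ) < kk n)) →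
        (udRow (a'.map (ι₁e n)) + flat (Wz n)) ⬝ᵥ flat (zgen k l m) ≤ 0) := by
  classical
  set a := a'.map (ι₁e n)
  have hcw := abs_udRow_dotProduct_zgen_le a hkl hkm
  have htri := Wz_sub_trichotomy (n := n) k l m
  rw [add_dotProduct, Wz_dotProduct_zgen hkl hkm]
  constructor
  · rintro (hpos | ⟨hzero, hmL⟩)
    · rcases htri with h | h | h <;> linarith
    · rw [hzero, udRow_dotProduct_zgen a hkl hkm, udInd_apply, udInd_apply, udInd_apply]
      by_cases hka : k ∈ a
      · by_cases hla : l ∈ a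
        · exact absurd hzero (Wz_sub_ne_zero_of_lt (val_lt_of_mem_map_ι₁e hka) (val_lt_of_mem_map_ι₁e hla) hmL hkl hkm hlm)
        · rw [if_pos hka, if_neg hla]; split_ifs <;> norm_num
      · rw [if_neg hka]; simp
  · intro hnot
    push Not at hnot
    obtain ⟨hle, hzero_imp⟩ := hnot
    rcases htri with h | h | h
    · linarith
    · have hm : kk n ≤ (m : ℕ) := hzero_imp h
      have hma : m ∉ a := fun hma => absurd (val_lt_of_mem_map_ι₁e hma) (by omega)
      rw [h, udRow_dotProduct_zgen a hkl hkm, udInd_apply a m, if_neg hma, udInd_apply, udInd_apply]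
      split_ifs <;> norm_num
    · linarith

/-! ### the common maximiser over a zgen cube -/

section Cube
variable {N : ℕ} {G : Fin N → Matrix (Fin n) (Fin n) ℝ}

/-- the indices `k_t, l_t, m_t` of generator `t` (a choice). -/
noncomputable def kOf (hz : IsZgenCube G) (t : Fin N) : Fin n := Classical.choose (hz t)
noncomputable def lOf (hz : IsZgenCube G) (t : Fin N) : Fin n := Classical.choose (Classical.choose_spec (hz t))
noncomputable def mOf (hz : IsZgenCube G) (t : Fin N) : Fin n :=
  Classical.choose (Classical.choose_spec (Classical.choose_spec (hz t)))

theorem of_spec (hz : IsZgenCube G) (t : Fin N) :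
    kOf hz t ≠ lOf hz t ∧ kOf hz t ≠ mOf hz t ∧ lOf hz t ≠ mOf hz t ∧ G t = zgen (kOf hz t) (lOf hz t) (mOf hz t) :=
  Classical.choose_spec (Classical.choose_spec (Classical.choose_spec (hz t)))

/-- the pencil difference `δ_t = W^z_{k l} − W^z_{k m}` of generator `t`. -/
noncomputable def δz (hz : IsZgenCube G) (t : Fin N) : ℝ := Wz n (kOf hz t) (lOf hz t) - Wz n (kOf hz t) (mOf hz t)

/-- ★ the COMMON MAXIMISER `H⋆ = {t : δ_t > 0} ∪ {t : δ_t = 0 ∧ m_t ∈ L}` of all block rows. -/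
noncomputable def Hz (hz : IsZgenCube G) : Finset (Fin N) :=
  Finset.univ.filter (fun t => 0 < δz hz t ∨ (δz hz t = 0 ∧ ((mOf hz t : Fin n) : ℕ) < kk n))

theorem mem_Hz (hz : IsZgenCube G) (t : Fin N) :
    t ∈ Hz hz ↔ (0 < δz hz t ∨ (δz hz t = 0 ∧ ((mOf hz t : Fin n) : ℕ) < kk n)) := by
  simp [Hz]

theorem zscore_nonneg_of_mem (hz : IsZgenCube G) (a' : Finset (Fin (kk n))) {t : Fin N} (ht : t ∈ Hz hz) :
    0 ≤ (udRow (a'.map (ι₁e n)) + flat (Wz n)) ⬝ᵥ flat (G t) := by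
  obtain ⟨hkl, hkm, hlm, hG⟩ := of_spec hz t
  rw [hG]
  exact (zscore_sign a' hkl hkm hlm).1 ((mem_Hz hz t).mp ht)

theorem zscore_nonpos_of_not_mem (hz : IsZgenCube G) (a' : Finset (Fin (kk n))) {t : Fin N} (ht : t ∉ Hz hz) :
    (udRow (a'.map (ι₁e n)) + flat (Wz n)) ⬝ᵥ flat (G t) ≤ 0 := by
  obtain ⟨hkl, hkm, hlm, hG⟩ := of_spec hz t
  rw [hG]
  exact (zscore_sign a' hkl hkm hlm).2 (fun h => ht ((mem_Hz hz t).mpr h))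

/-- ★ `H⋆` maximises EVERY block row `(ι₁(a'), W^z)` over the cube (base point and multiplicities irrelevant). -/
theorem zsc_le_star (hz : IsZgenCube G) (Q₀ : Matrix (Fin n) (Fin n) ℝ) (a' : Finset (Fin (kk n))) (P : Finset (Fin N)) :
    (udRow (a'.map (ι₁e n)) + flat (Wz n)) ⬝ᵥ cubePt Q₀ G P ≤
      (udRow (a'.map (ι₁e n)) + flat (Wz n)) ⬝ᵥ cubePt Q₀ G (Hz hz) := by
  classical
  set ρ := udRow (a'.map (ι₁e n)) + flat (Wz n)
  rw [dotProduct_cubePt, dotProduct_cubePt]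
  have hsplit := Finset.sum_filter_add_sum_filter_not P (fun t => t ∈ Hz hz) (fun t => ρ ⬝ᵥ flat (G t))
  have hneg : ∑ t ∈ P.filter (fun t => t ∉ Hz hz), ρ ⬝ᵥ flat (G t) ≤ 0 :=
    Finset.sum_nonpos fun t ht => zscore_nonpos_of_not_mem hz a' (Finset.mem_filter.mp ht).2
  have hsub : P.filter (fun t => t ∈ Hz hz) ⊆ Hz hz := fun t ht => (Finset.mem_filter.mp ht).2
  have hmono : ∑ t ∈ P.filter (fun t => t ∈ Hz hz), ρ ⬝ᵥ flat (G t) ≤ ∑ t ∈ Hz hz, ρ ⬝ᵥ flat (G t) :=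
    Finset.sum_le_sum_of_subset_of_nonneg hsub fun t ht _ => zscore_nonneg_of_mem hz a' ht
  linarith

/-! ### ★★★ the theorems -/

/-- the block engine, columns indexed by subsets `P ⊆ [N]` directly (no budget hypothesis). -/
theorem exactTilted_block_zgenCube (c : ℕ) : ∃ n₀ : ℕ, ∀ n ≥ n₀, ∀ (N : ℕ) (Q₀ : Matrix (Fin n) (Fin n) ℝ)
    (G : Fin N → Matrix (Fin n) (Fin n) ℝ), IsZgenCube G → ∀ (r : ℕ)
    (mm : exactTilted.A n → ℝ), (∀ a P, exactTilted.ρ n a ⬝ᵥ cubePt Q₀ G P ≤ mm a) →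
      (∀ a, ∃ P, exactTilted.ρ n a ⬝ᵥ cubePt Q₀ G P = mm a) →
    ∀ (U : exactTilted.A n → Option (Fin r) → ℝ) (V : Finset (Fin n) × Finset (Fin N) → Option (Fin r) → ℝ),
      (∀ a i, 0 ≤ U a i) → (∀ p i, 0 ≤ V p i) →
      (∀ a b P, (exactTilted.β n a + mm a) - exactTilted.ρ n a ⬝ᵥ (udPt b + cubePt Q₀ G P) = ∑ i, U a i * V (b, P) i) →
      T c n < r := by
  classical
  obtain ⟨n₀, hn₀⟩ := T_lt_of_block_half c
  refine ⟨n₀, fun n hn N Q₀ G hz r mm hle hat U V hU hV hfac => hn₀ n hn r ?_⟩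
  let row : Finset (Fin (kk n)) → exactTilted.A n := fun a' => (a'.map (ι₁e n), Wz n)
  let col : Finset (Fin (kk n)) → Finset (Fin n) × Finset (Fin N) := fun S => (Bcol S, Hz hz)
  have hmm : ∀ a', mm (row a') = (udRow (a'.map (ι₁e n)) + flat (Wz n)) ⬝ᵥ cubePt Q₀ G (Hz hz) := by
    intro a'
    obtain ⟨P₀, hP₀⟩ := hat (row a')
    have h1 := hle (row a') (Hz hz)
    have h2 : exactTilted.ρ n (row a') ⬝ᵥ cubePt Q₀ G P₀ ≤ (udRow (a'.map (ι₁e n)) + flat (Wz n)) ⬝ᵥ cubePt Q₀ G (Hz hz) :=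
      zsc_le_star hz Q₀ _ P₀
    rw [hP₀] at h2
    exact le_antisymm h2 h1
  have key := three_pow_le_of_block (ι := Option (Fin r)) U V hU hV row col ?_
  · simpa [Fintype.card_option, Fintype.card_fin] using key
  · intro a' S
    rw [← hfac (row a') (Bcol S) (Hz hz), hmm a']
    show ((1 + hCOR (Wz n)) + (udRow (a'.map (ι₁e n)) + flat (Wz n)) ⬝ᵥ cubePt Q₀ G (Hz hz)) -
        (udRow (a'.map (ι₁e n)) + flat (Wz n)) ⬝ᵥ (udPt (Bcol S) + cubePt Q₀ G (Hz hz)) = (1 - ((a' ∩ S).card : ℝ)) ^ 2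
    rw [dotProduct_add, add_dotProduct _ _ (udPt (Bcol S)), hCOR_Wz, Wz_dotProduct_Bcol, ← ud_block a' S]
    ring

/-- ★★★ **`exactTilted.Law` HOLDS ON EVERY ZGEN CUBE** (Law currency). -/
theorem exactTilted_law_holds_on_zgenCube : ∀ c : ℕ, ∃ n₀ : ℕ, ∀ n ≥ n₀,
    ∀ (N K : ℕ) (Q₀ : Matrix (Fin n) (Fin n) ℝ) (G : Fin N → Matrix (Fin n) (Fin n) ℝ), IsZgenCube G →
    ∀ (e : Fin (K + 1) → Finset (Fin N)), Function.Surjective e → ∀ (r : ℕ),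
    HasEFOfSize (convexHull ℝ (Set.range (cubePt Q₀ G ∘ e))) r →
    ∀ mm : exactTilted.A n → ℝ, (∀ a j, exactTilted.ρ n a ⬝ᵥ (cubePt Q₀ G ∘ e) j ≤ mm a) →
      (∀ a, ∃ j, exactTilted.ρ n a ⬝ᵥ (cubePt Q₀ G ∘ e) j = mm a) →
    ∀ (U : exactTilted.A n → Option (Fin r) → ℝ) (V : Finset (Fin n) × Fin (K + 1) → Option (Fin r) → ℝ),
      (∀ a i, 0 ≤ U a i) → (∀ p i, 0 ≤ V p i) →
      (∀ a b j, (exactTilted.β n a + mm a) - exactTilted.ρ n a ⬝ᵥ (udPt b + (cubePt Q₀ G ∘ e) j) = ∑ i, U a i * V (b, j) i) →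
      T c n < r := by
  classical
  intro c
  obtain ⟨n₀, hn₀⟩ := T_lt_of_block_half c
  refine ⟨n₀, fun n hn N K Q₀ G hz e he r _ mm hle hat U V hU hV hfac => hn₀ n hn r ?_⟩
  obtain ⟨jstar, hj⟩ := he (Hz hz)
  let row : Finset (Fin (kk n)) → exactTilted.A n := fun a' => (a'.map (ι₁e n), Wz n)
  let col : Finset (Fin (kk n)) → Finset (Fin n) × Fin (K + 1) := fun S => (Bcol S, jstar)
  have hq : (cubePt Q₀ G ∘ e) jstar = cubePt Q₀ G (Hz hz) := by simp [hj]
  have hmm : ∀ a', mm (row a') = (udRow (a'.map (ι₁e n)) + flat (Wz n)) ⬝ᵥ cubePt Q₀ G (Hz hz) := by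
    intro a'
    obtain ⟨j₀, hj₀⟩ := hat (row a')
    have h1 := hle (row a') jstar
    rw [hq] at h1
    have h2 : exactTilted.ρ n (row a') ⬝ᵥ (cubePt Q₀ G ∘ e) j₀ ≤ (udRow (a'.map (ι₁e n)) + flat (Wz n)) ⬝ᵥ cubePt Q₀ G (Hz hz) :=
      zsc_le_star hz Q₀ _ (e j₀)
    rw [hj₀] at h2
    exact le_antisymm h2 h1
  have key := three_pow_le_of_block (ι := Option (Fin r)) U V hU hV row col ?_
  · simpa [Fintype.card_option, Fintype.card_fin] using key
  · intro a' S
    rw [← hfac (row a') (Bcol S) jstar, hq, hmm a']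
    show ((1 + hCOR (Wz n)) + (udRow (a'.map (ι₁e n)) + flat (Wz n)) ⬝ᵥ cubePt Q₀ G (Hz hz)) -
        (udRow (a'.map (ι₁e n)) + flat (Wz n)) ⬝ᵥ (udPt (Bcol S) + cubePt Q₀ G (Hz hz)) = (1 - ((a' ∩ S).card : ℝ)) ^ 2
    rw [dotProduct_add, add_dotProduct _ _ (udPt (Bcol S)), hCOR_Wz, Wz_dotProduct_Bcol, ← ud_block a' S]
    ring

/-- ★★★ **EVERY ZGEN CUBE IS DECIDED AT THE TOP LAW** (eventually in `n`). -/
theorem cor_add_zgenCube_decided (c : ℕ) : ∃ n₀ : ℕ, ∀ n ≥ n₀, ∀ (N : ℕ) (Q₀ : Matrix (Fin n) (Fin n) ℝ)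
    (G : Fin N → Matrix (Fin n) (Fin n) ℝ), IsZgenCube G → ∀ r : ℕ,
    HasEFOfSize (corPolytope n + convexHull ℝ (Set.range (cubePt Q₀ G))) r → T c n < r := by
  classical
  obtain ⟨n₀, hn₀⟩ := exactTilted_block_zgenCube c
  refine ⟨n₀, fun n hn N Q₀ G hz r hEF => ?_⟩
  obtain ⟨pt_mem, -, -, -⟩ := ud_data n
  let mm : exactTilted.A n → ℝ := fun a =>
    Finset.univ.sup' Finset.univ_nonempty (fun P : Finset (Fin N) => exactTilted.ρ n a ⬝ᵥ cubePt Q₀ G P)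
  have hat : ∀ a, ∃ P, exactTilted.ρ n a ⬝ᵥ cubePt Q₀ G P = mm a := fun a => by
    obtain ⟨P, -, hP⟩ := Finset.exists_mem_eq_sup' Finset.univ_nonempty
      (fun P : Finset (Fin N) => exactTilted.ρ n a ⬝ᵥ cubePt Q₀ G P)
    exact ⟨P, hP.symm⟩
  have hle : ∀ a P, exactTilted.ρ n a ⬝ᵥ cubePt Q₀ G P ≤ mm a := fun a P =>
    Finset.le_sup' (fun P : Finset (Fin N) => exactTilted.ρ n a ⬝ᵥ cubePt Q₀ G P) (Finset.mem_univ P)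
  have hm : ∀ a, ∀ y ∈ convexHull ℝ (Set.range (cubePt Q₀ G)), exactTilted.ρ n a ⬝ᵥ y ≤ mm a := fun a =>
    dot_le_of_mem_convexHull _ _ _ (by rintro _ ⟨P, rfl⟩; exact hle a P)
  have hq : ∀ P : Finset (Fin N), cubePt Q₀ G P ∈ convexHull ℝ (Set.range (cubePt Q₀ G)) :=
    fun P => subset_convexHull ℝ _ ⟨P, rfl⟩
  have hv : ∀ p : Finset (Fin n) × Finset (Fin N),
      udPt p.1 + cubePt Q₀ G p.2 ∈ corPolytope n + convexHull ℝ (Set.range (cubePt Q₀ G)) :=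
    fun p => Set.add_mem_add (pt_mem p.1) (hq p.2)
  have hvalid : ∀ a, ∀ x ∈ corPolytope n + convexHull ℝ (Set.range (cubePt Q₀ G)),
      exactTilted.ρ n a ⬝ᵥ x ≤ exactTilted.β n a + mm a := by
    rintro a x ⟨p, hp, y, hy, rfl⟩
    rw [dotProduct_add]
    exact add_le_add (exactTilted.valid n a p hp) (hm a y hy)
  obtain ⟨U, V, hU, hV, hfac⟩ := Literature.Barriers.PneNP.HasEFOfSize.exists_nonneg_factorization hEF
    (fun p : Finset (Fin n) × Finset (Fin N) => udPt p.1 + cubePt Q₀ G p.2) hv (exactTilted.ρ n)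
    (fun a => exactTilted.β n a + mm a) hvalid
  exact hn₀ n hn N Q₀ G hz r mm hle hat U V hU hV (fun a b P => hfac a (b, P))

end Cube

/-! ### §9b (rev 7) scaled and zero generators — the zonotope shape `Q₀ + Σ_t [0, c_t·(E^s_{kl} − E^s_{km})]`, `c_t > 0` -/

/-- «every generator is `0` or a POSITIVE multiple of a zero-diagonal difference `E^s_{kl} − E^s_{km}`». -/
def IsScaledZgenCube {N : ℕ} (G : Fin N → Matrix (Fin n) (Fin n) ℝ) : Prop :=
  ∀ t, G t = 0 ∨ ∃ c : ℝ, 0 < c ∧ ∃ k l m : Fin n, k ≠ l ∧ k ≠ m ∧ l ≠ m ∧ G t = c • zgen k l m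

theorem isScaledZgenCube_of_isZgenCube {N : ℕ} {G : Fin N → Matrix (Fin n) (Fin n) ℝ} (hz : IsZgenCube G) :
    IsScaledZgenCube G := fun t => by
  obtain ⟨k, l, m, hkl, hkm, hlm, hG⟩ := hz t
  exact Or.inr ⟨1, one_pos, k, l, m, hkl, hkm, hlm, by rw [hG, one_smul]⟩

theorem flat_smul'' (c : ℝ) (M : Matrix (Fin n) (Fin n) ℝ) : flat (c • M) = c • flat M := by
  change flatLin n (c • M) = c • flatLin n M
  rw [map_smul]

theorem flat_zero'' : flat (0 : Matrix (Fin n) (Fin n) ℝ) = 0 := by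
  change flatLin n 0 = 0
  rw [map_zero]

/-- the full left block row `L = ι₁([k])`. -/
def Lrow (n : ℕ) : Finset (Fin n) := (Finset.univ : Finset (Fin (kk n))).map (ι₁e n)

theorem mem_Lrow_iff (x : Fin n) : x ∈ Lrow n ↔ (x : ℕ) < kk n := by
  constructor
  · exact fun hx => val_lt_of_mem_map_ι₁e hx
  · intro hx
    exact Finset.mem_map.mpr ⟨⟨x, hx⟩, Finset.mem_univ _, Fin.ext rfl⟩

theorem map_ι₁e_subset_Lrow (a' : Finset (Fin (kk n))) : a'.map (ι₁e n) ⊆ Lrow n := by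
  intro x hx
  exact (mem_Lrow_iff x).mpr (val_lt_of_mem_map_ι₁e hx)

/-- ★ the SCORE SIGN of a scaled difference generator against a block row, under the index-free rule. -/
theorem zscore_sign' (a' : Finset (Fin (kk n))) {c : ℝ} (hc : 0 < c) {k l m : Fin n} (hkl : k ≠ l) (hkm : k ≠ m)
    (hlm : l ≠ m) :
    ((0 < flat (Wz n) ⬝ᵥ flat (c • zgen k l m) ∨
        (flat (Wz n) ⬝ᵥ flat (c • zgen k l m) = 0 ∧ 0 ≤ udRow (Lrow n) ⬝ᵥ flat (c • zgen k l m))) →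
        0 ≤ (udRow (a'.map (ι₁e n)) + flat (Wz n)) ⬝ᵥ flat (c • zgen k l m)) ∧
    (¬ (0 < flat (Wz n) ⬝ᵥ flat (c • zgen k l m) ∨
        (flat (Wz n) ⬝ᵥ flat (c • zgen k l m) = 0 ∧ 0 ≤ udRow (Lrow n) ⬝ᵥ flat (c • zgen k l m))) →
        (udRow (a'.map (ι₁e n)) + flat (Wz n)) ⬝ᵥ flat (c • zgen k l m) ≤ 0) := by
  classical
  set a := a'.map (ι₁e n)
  have haL : a ⊆ Lrow n := map_ι₁e_subset_Lrow a'
  have hcw := abs_udRow_dotProduct_zgen_le a hkl hkm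
  have htri := Wz_sub_trichotomy (n := n) k l m
  have hc0 : c ≠ 0 := hc.ne'
  have hpin : flat (Wz n) ⬝ᵥ flat (c • zgen k l m) = c * (2 * (Wz n k l - Wz n k m)) := by
    rw [flat_smul'', dotProduct_smul, smul_eq_mul, Wz_dotProduct_zgen hkl hkm]
  have hL : udRow (Lrow n) ⬝ᵥ flat (c • zgen k l m) = c * (udRow (Lrow n) ⬝ᵥ flat (zgen k l m)) := by
    rw [flat_smul'', dotProduct_smul, smul_eq_mul]
  have hsc : (udRow a + flat (Wz n)) ⬝ᵥ flat (c • zgen k l m) =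
      c * (udRow a ⬝ᵥ flat (zgen k l m) + 2 * (Wz n k l - Wz n k m)) := by
    rw [flat_smul'', dotProduct_smul, smul_eq_mul, add_dotProduct, Wz_dotProduct_zgen hkl hkm]
  rw [hpin, hL, hsc]
  have e1 : (0 < c * (2 * (Wz n k l - Wz n k m))) ↔ 0 < Wz n k l - Wz n k m := by
    rw [mul_pos_iff_of_pos_left hc]
    constructor <;> intro h <;> linarith
  have e2 : (c * (2 * (Wz n k l - Wz n k m)) = 0) ↔ Wz n k l - Wz n k m = 0 := by
    constructor
    · intro h
      rcases mul_eq_zero.mp h with h | h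
      · exact absurd h hc0
      · linarith
    · intro h; rw [h]; ring
  have e3 : (0 ≤ c * (udRow (Lrow n) ⬝ᵥ flat (zgen k l m))) ↔ 0 ≤ udRow (Lrow n) ⬝ᵥ flat (zgen k l m) :=
    mul_nonneg_iff_of_pos_left hc
  rw [e1, e2, e3]
  have hLw : udRow (Lrow n) ⬝ᵥ flat (zgen k l m) = 2 * udInd (Lrow n) k * (udInd (Lrow n) m - udInd (Lrow n) l) :=
    udRow_dotProduct_zgen _ hkl hkm
  have haw : udRow a ⬝ᵥ flat (zgen k l m) = 2 * udInd a k * (udInd a m - udInd a l) := udRow_dotProduct_zgen _ hkl hkm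
  constructor
  · rintro (hpos | ⟨hzero, hLnn⟩)
    · apply mul_nonneg hc.le
      rcases htri with h | h | h <;> linarith [hcw.1]
    · apply mul_nonneg hc.le
      rw [hzero, mul_zero, add_zero, haw, udInd_apply, udInd_apply, udInd_apply]
      by_cases hka : k ∈ a
      · by_cases hla : l ∈ a
        · exfalso
          have hkL := haL hka
          have hlL := haL hla
          rw [hLw, udInd_apply, udInd_apply, udInd_apply, if_pos hkL, if_pos hlL] at hLnn
          have hmL : m ∈ Lrow n := by
            by_contra hm
            rw [if_neg hm] at hLnn
            norm_num at hLnn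
          exact Wz_sub_ne_zero_of_lt ((mem_Lrow_iff k).mp hkL) ((mem_Lrow_iff l).mp hlL) ((mem_Lrow_iff m).mp hmL)
            hkl hkm hlm hzero
        · rw [if_pos hka, if_neg hla]
          split_ifs <;> norm_num
      · rw [if_neg hka]; simp
  · intro hnot
    push Not at hnot
    obtain ⟨hle, hzero_imp⟩ := hnot
    rcases htri with h | h | h
    · have hx : udRow a ⬝ᵥ flat (zgen k l m) + 2 * (Wz n k l - Wz n k m) ≤ 0 := by linarith [hcw.2]
      nlinarith [mul_nonneg hc.le (show (0 : ℝ) ≤ -(udRow a ⬝ᵥ flat (zgen k l m) + 2 * (Wz n k l - Wz n k m)) by linarith)]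
    · have hLneg := hzero_imp h
      rw [hLw, udInd_apply, udInd_apply, udInd_apply] at hLneg
      have hmL : m ∉ Lrow n := by
        intro hm
        rw [if_pos hm] at hLneg
        split_ifs at hLneg <;> norm_num at hLneg
      have hma : m ∉ a := fun hma => hmL (haL hma)
      rw [h, mul_zero, add_zero, haw, udInd_apply a m, if_neg hma, udInd_apply, udInd_apply]
      split_ifs <;> nlinarith [hc]
    · exact absurd h (by linarith)

section ScaledCube
variable {N : ℕ} {G : Fin N → Matrix (Fin n) (Fin n) ℝ}

/-- ★ the INDEX-FREE common maximiser `H⋆' = {t : ⟨W^z, G t⟩ > 0} ∪ {t : ⟨W^z, G t⟩ = 0 ∧ ⟨udRow L, G t⟩ ≥ 0}`. -/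
noncomputable def Hz' (G : Fin N → Matrix (Fin n) (Fin n) ℝ) : Finset (Fin N) :=
  Finset.univ.filter (fun t => 0 < flat (Wz n) ⬝ᵥ flat (G t) ∨
    (flat (Wz n) ⬝ᵥ flat (G t) = 0 ∧ 0 ≤ udRow (Lrow n) ⬝ᵥ flat (G t)))

theorem mem_Hz' (G : Fin N → Matrix (Fin n) (Fin n) ℝ) (t : Fin N) :
    t ∈ Hz' G ↔ (0 < flat (Wz n) ⬝ᵥ flat (G t) ∨ (flat (Wz n) ⬝ᵥ flat (G t) = 0 ∧ 0 ≤ udRow (Lrow n) ⬝ᵥ flat (G t))) := by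
  simp [Hz']

theorem zscore'_nonneg_of_mem (hz : IsScaledZgenCube G) (a' : Finset (Fin (kk n))) {t : Fin N} (ht : t ∈ Hz' G) :
    0 ≤ (udRow (a'.map (ι₁e n)) + flat (Wz n)) ⬝ᵥ flat (G t) := by
  rcases hz t with h0 | ⟨c, hc, k, l, m, hkl, hkm, hlm, hG⟩
  · rw [h0, flat_zero'', dotProduct_zero]
  · have h := (mem_Hz' G t).mp ht
    rw [hG] at h ⊢
    exact (zscore_sign' a' hc hkl hkm hlm).1 h

theorem zscore'_nonpos_of_not_mem (hz : IsScaledZgenCube G) (a' : Finset (Fin (kk n))) {t : Fin N} (ht : t ∉ Hz' G) :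
    (udRow (a'.map (ι₁e n)) + flat (Wz n)) ⬝ᵥ flat (G t) ≤ 0 := by
  rcases hz t with h0 | ⟨c, hc, k, l, m, hkl, hkm, hlm, hG⟩
  · rw [h0, flat_zero'', dotProduct_zero]
  · rw [hG]
    refine (zscore_sign' a' hc hkl hkm hlm).2 fun h => ht ((mem_Hz' G t).mpr ?_)
    rw [hG]; exact h

/-- ★ `H⋆'` maximises EVERY block row over a scaled zgen cube. -/
theorem zsc_le_star' (hz : IsScaledZgenCube G) (Q₀ : Matrix (Fin n) (Fin n) ℝ) (a' : Finset (Fin (kk n))) (P : Finset (Fin N)) :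
    (udRow (a'.map (ι₁e n)) + flat (Wz n)) ⬝ᵥ cubePt Q₀ G P ≤
      (udRow (a'.map (ι₁e n)) + flat (Wz n)) ⬝ᵥ cubePt Q₀ G (Hz' G) := by
  classical
  set ρ := udRow (a'.map (ι₁e n)) + flat (Wz n)
  rw [dotProduct_cubePt, dotProduct_cubePt]
  have hsplit := Finset.sum_filter_add_sum_filter_not P (fun t => t ∈ Hz' G) (fun t => ρ ⬝ᵥ flat (G t))
  have hneg : ∑ t ∈ P.filter (fun t => t ∉ Hz' G), ρ ⬝ᵥ flat (G t) ≤ 0 :=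
    Finset.sum_nonpos fun t ht => zscore'_nonpos_of_not_mem hz a' (Finset.mem_filter.mp ht).2
  have hsub : P.filter (fun t => t ∈ Hz' G) ⊆ Hz' G := fun t ht => (Finset.mem_filter.mp ht).2
  have hmono : ∑ t ∈ P.filter (fun t => t ∈ Hz' G), ρ ⬝ᵥ flat (G t) ≤ ∑ t ∈ Hz' G, ρ ⬝ᵥ flat (G t) :=
    Finset.sum_le_sum_of_subset_of_nonneg hsub fun t ht _ => zscore'_nonneg_of_mem hz a' ht
  linarith

/-- the block engine for scaled zgen cubes (columns `P ⊆ [N]`, no budget hypothesis). -/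
theorem exactTilted_block_scaledZgenCube (c : ℕ) : ∃ n₀ : ℕ, ∀ n ≥ n₀, ∀ (N : ℕ) (Q₀ : Matrix (Fin n) (Fin n) ℝ)
    (G : Fin N → Matrix (Fin n) (Fin n) ℝ), IsScaledZgenCube G → ∀ (r : ℕ)
    (mm : exactTilted.A n → ℝ), (∀ a P, exactTilted.ρ n a ⬝ᵥ cubePt Q₀ G P ≤ mm a) →
      (∀ a, ∃ P, exactTilted.ρ n a ⬝ᵥ cubePt Q₀ G P = mm a) →
    ∀ (U : exactTilted.A n → Option (Fin r) → ℝ) (V : Finset (Fin n) × Finset (Fin N) → Option (Fin r) → ℝ),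
      (∀ a i, 0 ≤ U a i) → (∀ p i, 0 ≤ V p i) →
      (∀ a b P, (exactTilted.β n a + mm a) - exactTilted.ρ n a ⬝ᵥ (udPt b + cubePt Q₀ G P) = ∑ i, U a i * V (b, P) i) →
      T c n < r := by
  classical
  obtain ⟨n₀, hn₀⟩ := T_lt_of_block_half c
  refine ⟨n₀, fun n hn N Q₀ G hz r mm hle hat U V hU hV hfac => hn₀ n hn r ?_⟩
  let row : Finset (Fin (kk n)) → exactTilted.A n := fun a' => (a'.map (ι₁e n), Wz n)
  let col : Finset (Fin (kk n)) → Finset (Fin n) × Finset (Fin N) := fun S => (Bcol S, Hz' G)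
  have hmm : ∀ a', mm (row a') = (udRow (a'.map (ι₁e n)) + flat (Wz n)) ⬝ᵥ cubePt Q₀ G (Hz' G) := by
    intro a'
    obtain ⟨P₀, hP₀⟩ := hat (row a')
    have h1 := hle (row a') (Hz' G)
    have h2 : exactTilted.ρ n (row a') ⬝ᵥ cubePt Q₀ G P₀ ≤ (udRow (a'.map (ι₁e n)) + flat (Wz n)) ⬝ᵥ cubePt Q₀ G (Hz' G) :=
      zsc_le_star' hz Q₀ _ P₀
    rw [hP₀] at h2
    exact le_antisymm h2 h1
  have key := three_pow_le_of_block (ι := Option (Fin r)) U V hU hV row col ?_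
  · simpa [Fintype.card_option, Fintype.card_fin] using key
  · intro a' S
    rw [← hfac (row a') (Bcol S) (Hz' G), hmm a']
    show ((1 + hCOR (Wz n)) + (udRow (a'.map (ι₁e n)) + flat (Wz n)) ⬝ᵥ cubePt Q₀ G (Hz' G)) -
        (udRow (a'.map (ι₁e n)) + flat (Wz n)) ⬝ᵥ (udPt (Bcol S) + cubePt Q₀ G (Hz' G)) = (1 - ((a' ∩ S).card : ℝ)) ^ 2
    rw [dotProduct_add, add_dotProduct _ _ (udPt (Bcol S)), hCOR_Wz, Wz_dotProduct_Bcol, ← ud_block a' S]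
    ring

/-- ★★★ `exactTilted.Law` HOLDS ON EVERY SCALED ZGEN CUBE (zero generators and positive multiples allowed). -/
theorem exactTilted_law_holds_on_scaledZgenCube : ∀ c : ℕ, ∃ n₀ : ℕ, ∀ n ≥ n₀,
    ∀ (N K : ℕ) (Q₀ : Matrix (Fin n) (Fin n) ℝ) (G : Fin N → Matrix (Fin n) (Fin n) ℝ), IsScaledZgenCube G →
    ∀ (e : Fin (K + 1) → Finset (Fin N)), Function.Surjective e → ∀ (r : ℕ),
    HasEFOfSize (convexHull ℝ (Set.range (cubePt Q₀ G ∘ e))) r →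
    ∀ mm : exactTilted.A n → ℝ, (∀ a j, exactTilted.ρ n a ⬝ᵥ (cubePt Q₀ G ∘ e) j ≤ mm a) →
      (∀ a, ∃ j, exactTilted.ρ n a ⬝ᵥ (cubePt Q₀ G ∘ e) j = mm a) →
    ∀ (U : exactTilted.A n → Option (Fin r) → ℝ) (V : Finset (Fin n) × Fin (K + 1) → Option (Fin r) → ℝ),
      (∀ a i, 0 ≤ U a i) → (∀ p i, 0 ≤ V p i) →
      (∀ a b j, (exactTilted.β n a + mm a) - exactTilted.ρ n a ⬝ᵥ (udPt b + (cubePt Q₀ G ∘ e) j) = ∑ i, U a i * V (b, j) i) →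
      T c n < r := by
  classical
  intro c
  obtain ⟨n₀, hn₀⟩ := T_lt_of_block_half c
  refine ⟨n₀, fun n hn N K Q₀ G hz e he r _ mm hle hat U V hU hV hfac => hn₀ n hn r ?_⟩
  obtain ⟨jstar, hj⟩ := he (Hz' G)
  let row : Finset (Fin (kk n)) → exactTilted.A n := fun a' => (a'.map (ι₁e n), Wz n)
  let col : Finset (Fin (kk n)) → Finset (Fin n) × Fin (K + 1) := fun S => (Bcol S, jstar)
  have hq : (cubePt Q₀ G ∘ e) jstar = cubePt Q₀ G (Hz' G) := by simp [hj]
  have hmm : ∀ a', mm (row a') = (udRow (a'.map (ι₁e n)) + flat (Wz n)) ⬝ᵥ cubePt Q₀ G (Hz' G) := by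
    intro a'
    obtain ⟨j₀, hj₀⟩ := hat (row a')
    have h1 := hle (row a') jstar
    rw [hq] at h1
    have h2 : exactTilted.ρ n (row a') ⬝ᵥ (cubePt Q₀ G ∘ e) j₀ ≤ (udRow (a'.map (ι₁e n)) + flat (Wz n)) ⬝ᵥ cubePt Q₀ G (Hz' G) :=
      zsc_le_star' hz Q₀ _ (e j₀)
    rw [hj₀] at h2
    exact le_antisymm h2 h1
  have key := three_pow_le_of_block (ι := Option (Fin r)) U V hU hV row col ?_
  · simpa [Fintype.card_option, Fintype.card_fin] using key
  · intro a' S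
    rw [← hfac (row a') (Bcol S) jstar, hq, hmm a']
    show ((1 + hCOR (Wz n)) + (udRow (a'.map (ι₁e n)) + flat (Wz n)) ⬝ᵥ cubePt Q₀ G (Hz' G)) -
        (udRow (a'.map (ι₁e n)) + flat (Wz n)) ⬝ᵥ (udPt (Bcol S) + cubePt Q₀ G (Hz' G)) = (1 - ((a' ∩ S).card : ℝ)) ^ 2
    rw [dotProduct_add, add_dotProduct _ _ (udPt (Bcol S)), hCOR_Wz, Wz_dotProduct_Bcol, ← ud_block a' S]
    ring

/-- ★★★ EVERY SCALED ZGEN CUBE IS DECIDED AT THE TOP LAW: `xc(COR(n) + Q) > T c n` eventually (`(3/2)^{⌊n/2⌋} ≤ r + 1`). -/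
theorem cor_add_scaledZgenCube_decided (c : ℕ) : ∃ n₀ : ℕ, ∀ n ≥ n₀, ∀ (N : ℕ) (Q₀ : Matrix (Fin n) (Fin n) ℝ)
    (G : Fin N → Matrix (Fin n) (Fin n) ℝ), IsScaledZgenCube G → ∀ r : ℕ,
    HasEFOfSize (corPolytope n + convexHull ℝ (Set.range (cubePt Q₀ G))) r → T c n < r := by
  classical
  obtain ⟨n₀, hn₀⟩ := exactTilted_block_scaledZgenCube c
  refine ⟨n₀, fun n hn N Q₀ G hz r hEF => ?_⟩
  obtain ⟨pt_mem, -, -, -⟩ := ud_data n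
  let mm : exactTilted.A n → ℝ := fun a =>
    Finset.univ.sup' Finset.univ_nonempty (fun P : Finset (Fin N) => exactTilted.ρ n a ⬝ᵥ cubePt Q₀ G P)
  have hat : ∀ a, ∃ P, exactTilted.ρ n a ⬝ᵥ cubePt Q₀ G P = mm a := fun a => by
    obtain ⟨P, -, hP⟩ := Finset.exists_mem_eq_sup' Finset.univ_nonempty
      (fun P : Finset (Fin N) => exactTilted.ρ n a ⬝ᵥ cubePt Q₀ G P)
    exact ⟨P, hP.symm⟩
  have hle : ∀ a P, exactTilted.ρ n a ⬝ᵥ cubePt Q₀ G P ≤ mm a := fun a P =>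
    Finset.le_sup' (fun P : Finset (Fin N) => exactTilted.ρ n a ⬝ᵥ cubePt Q₀ G P) (Finset.mem_univ P)
  have hm : ∀ a, ∀ y ∈ convexHull ℝ (Set.range (cubePt Q₀ G)), exactTilted.ρ n a ⬝ᵥ y ≤ mm a := fun a =>
    dot_le_of_mem_convexHull _ _ _ (by rintro _ ⟨P, rfl⟩; exact hle a P)
  have hq : ∀ P : Finset (Fin N), cubePt Q₀ G P ∈ convexHull ℝ (Set.range (cubePt Q₀ G)) :=
    fun P => subset_convexHull ℝ _ ⟨P, rfl⟩
  have hv : ∀ p : Finset (Fin n) × Finset (Fin N),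
      udPt p.1 + cubePt Q₀ G p.2 ∈ corPolytope n + convexHull ℝ (Set.range (cubePt Q₀ G)) :=
    fun p => Set.add_mem_add (pt_mem p.1) (hq p.2)
  have hvalid : ∀ a, ∀ x ∈ corPolytope n + convexHull ℝ (Set.range (cubePt Q₀ G)),
      exactTilted.ρ n a ⬝ᵥ x ≤ exactTilted.β n a + mm a := by
    rintro a x ⟨p, hp, y, hy, rfl⟩
    rw [dotProduct_add]
    exact add_le_add (exactTilted.valid n a p hp) (hm a y hy)
  obtain ⟨U, V, hU, hV, hfac⟩ := Literature.Barriers.PneNP.HasEFOfSize.exists_nonneg_factorization hEF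
    (fun p : Finset (Fin n) × Finset (Fin N) => udPt p.1 + cubePt Q₀ G p.2) hv (exactTilted.ρ n)
    (fun a => exactTilted.β n a + mm a) hvalid
  exact hn₀ n hn N Q₀ G hz r mm hle hat U V hU hV (fun a b P => hfac a (b, P))

end ScaledCube

end ZgenCube

/-! ## §10 The transversal-face TEMPLATE CEILING (W6-P1's named obstruction): interactions are mixed second differences of transversals, hence
unread; the interaction DIFFERENCE has clique weights `−2 / +2` on two block rows ⇒ `no_exact_column_of_interDiff`. -/

section InteractionCeiling

variable {n : ℕ}

theorem flat_sub'' (A B : Matrix (Fin n) (Fin n) ℝ) : flat (A - B) = flat A - flat B := by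
  change flatLin n (A - B) = flatLin n A - flatLin n B
  rw [map_sub]

/-- the INTERACTION of the pairs `u, v` (a mixed second difference of transversal vertices). -/
def inter (u v : Fin (kk n)) : Matrix (Fin n) (Fin n) ℝ :=
  zgen (ι₁ u) (ι₁ v) (ι₂ v) - zgen (ι₂ u) (ι₁ v) (ι₂ v)

theorem flat_dotProduct_inter (C : Matrix (Fin n) (Fin n) ℝ) {u v : Fin (kk n)} (huv : u ≠ v) :
    flat C ⬝ᵥ flat (inter u v) =
      ((C (ι₁ u) (ι₁ v) + C (ι₁ v) (ι₁ u)) - (C (ι₁ u) (ι₂ v) + C (ι₂ v) (ι₁ u))) -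
      ((C (ι₂ u) (ι₁ v) + C (ι₁ v) (ι₂ u)) - (C (ι₂ u) (ι₂ v) + C (ι₂ v) (ι₂ u))) := by
  unfold inter
  rw [flat_sub'', dotProduct_sub,
    flat_dotProduct_zgen C (fun h => huv (ι₁_injective h)) (ι₁_ne_ι₂ u v),
    flat_dotProduct_zgen C (fun h => ι₁_ne_ι₂ v u h.symm) (fun h => huv (ι₂_injective h))]

/-! ### the four transversals `B_{uv}, B_{v}, B_{u}, B_∅` and their representatives -/

theorem rep_insert_left (u v : Fin (kk n)) : rep ({u, v} : Finset (Fin (kk n))) u = ι₁ u := by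
  unfold rep; rw [if_pos (Finset.mem_insert_self u {v})]

theorem rep_insert_right (u v : Fin (kk n)) : rep ({u, v} : Finset (Fin (kk n))) v = ι₁ v := by
  unfold rep; rw [if_pos (Finset.mem_insert_of_mem (Finset.mem_singleton_self v))]

theorem rep_insert_other {u v w : Fin (kk n)} (h1 : w ≠ u) (h2 : w ≠ v) :
    rep ({u, v} : Finset (Fin (kk n))) w = ι₂ w := by
  unfold rep; rw [if_neg (by simp [h1, h2])]

theorem rep_singleton_self (u : Fin (kk n)) : rep ({u} : Finset (Fin (kk n))) u = ι₁ u := by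
  unfold rep; rw [if_pos (Finset.mem_singleton_self u)]

theorem rep_singleton_other {u w : Fin (kk n)} (h : w ≠ u) : rep ({u} : Finset (Fin (kk n))) w = ι₂ w := by
  unfold rep; rw [if_neg (by simp [h])]

theorem rep_empty (w : Fin (kk n)) : rep (∅ : Finset (Fin (kk n))) w = ι₂ w := by
  simp [rep]

/-- `⟨W, x_{B_T}⟩ = Σ_{u'} Σ_{v'} W (rep_T u') (rep_T v')`. -/
theorem transversal_read (W : Matrix (Fin n) (Fin n) ℝ) (T : Finset (Fin (kk n))) :
    flat W ⬝ᵥ udPt (Bcol T) = ∑ u', ∑ v', W (rep T u') (rep T v') := by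
  rw [flat_dotProduct_udPt_sum, sum_Bcol]
  exact Finset.sum_congr rfl fun u' _ => sum_Bcol (fun y => W (rep T u') y) T

/-- the termwise mixed difference over the four transversals: only the `(u,v)` and `(v,u)` terms survive. -/
theorem alt_term (W : Matrix (Fin n) (Fin n) ℝ) {u v : Fin (kk n)} (huv : u ≠ v) (u' v' : Fin (kk n)) :
    W (rep ({u, v} : Finset (Fin (kk n))) u') (rep ({u, v} : Finset (Fin (kk n))) v')
      - W (rep ({v} : Finset (Fin (kk n))) u') (rep ({v} : Finset (Fin (kk n))) v')
      - W (rep ({u} : Finset (Fin (kk n))) u') (rep ({u} : Finset (Fin (kk n))) v')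
      + W (rep (∅ : Finset (Fin (kk n))) u') (rep (∅ : Finset (Fin (kk n))) v') =
    (if u' = u ∧ v' = v then
        W (ι₁ u) (ι₁ v) - W (ι₂ u) (ι₁ v) - W (ι₁ u) (ι₂ v) + W (ι₂ u) (ι₂ v) else 0) +
      (if u' = v ∧ v' = u then
        W (ι₁ v) (ι₁ u) - W (ι₁ v) (ι₂ u) - W (ι₂ v) (ι₁ u) + W (ι₂ v) (ι₂ u) else 0) := by
  rcases eq_or_ne u' u with h1 | h1
  · rcases eq_or_ne v' v with h2 | h2
    · rw [h1, h2, rep_insert_left, rep_insert_right, rep_singleton_other huv, rep_singleton_self v,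
        rep_singleton_self u, rep_singleton_other huv.symm, rep_empty, rep_empty, if_pos ⟨rfl, rfl⟩,
        if_neg (fun h => huv h.1)]
      ring
    · rcases eq_or_ne v' u with h3 | h3
      · rw [h1, h3, rep_insert_left, rep_singleton_other huv, rep_singleton_self u, rep_empty,
          if_neg (fun h => huv h.2), if_neg (fun h => huv h.1)]
        ring
      · rw [h1, rep_insert_left, rep_insert_other h3 h2, rep_singleton_other huv, rep_singleton_other h2,
          rep_singleton_self u, rep_singleton_other h3, rep_empty, rep_empty, if_neg (fun h => h2 h.2),
          if_neg (fun h => huv h.1)]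
        ring
  · rcases eq_or_ne u' v with h3 | h3
    · rcases eq_or_ne v' u with h4 | h4
      · rw [h3, h4, rep_insert_right, rep_insert_left, rep_singleton_self v, rep_singleton_other huv,
          rep_singleton_other huv.symm, rep_singleton_self u, rep_empty, rep_empty,
          if_neg (fun h => huv.symm h.1), if_pos ⟨rfl, rfl⟩]
        ring
      · rcases eq_or_ne v' v with h5 | h5
        · rw [h3, h5, rep_insert_right, rep_singleton_self v, rep_singleton_other huv.symm, rep_empty,
            if_neg (fun h => huv.symm h.1), if_neg (fun h => huv.symm h.2)]
          ring
        · rw [h3, rep_insert_right, rep_insert_other h4 h5, rep_singleton_self v, rep_singleton_other h5,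
            rep_singleton_other huv.symm, rep_singleton_other h4, rep_empty, rep_empty,
            if_neg (fun h => huv.symm h.1), if_neg (fun h => h4 h.2)]
          ring
    · rw [rep_insert_other h1 h3, rep_singleton_other h3, rep_singleton_other h1, rep_empty u',
        if_neg (fun h => h1 h.1), if_neg (fun h => h3 h.1)]
      rcases eq_or_ne v' u with h4 | h4
      · rw [h4, rep_insert_left, rep_singleton_other huv, rep_singleton_self u, rep_empty]
        ring
      · rcases eq_or_ne v' v with h5 | h5
        · rw [h5, rep_insert_right, rep_singleton_self v, rep_singleton_other huv.symm, rep_empty]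
          ring
        · rw [rep_insert_other h4 h5, rep_singleton_other h5, rep_singleton_other h4, rep_empty]
          ring

theorem sum_sum_ite_and (c : ℝ) (j m : Fin (kk n)) :
    ∑ i : Fin (kk n), ∑ i' : Fin (kk n), (if i = j ∧ i' = m then c else 0) = c := by
  have h := sum_sum_ite_and_mul (n := kk n) (fun _ _ => (1 : ℝ)) c j m
  simp only [mul_one] at h
  exact h

/-- ★ **MIXED SECOND DIFFERENCE OF FOUR TRANSVERSALS = THE INTERACTION READ**. -/
theorem transversal_mixed_diff (W : Matrix (Fin n) (Fin n) ℝ) {u v : Fin (kk n)} (huv : u ≠ v) :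
    flat W ⬝ᵥ udPt (Bcol ({u, v} : Finset (Fin (kk n)))) - flat W ⬝ᵥ udPt (Bcol ({v} : Finset (Fin (kk n))))
      - flat W ⬝ᵥ udPt (Bcol ({u} : Finset (Fin (kk n)))) + flat W ⬝ᵥ udPt (Bcol (∅ : Finset (Fin (kk n))))
      = flat W ⬝ᵥ flat (inter u v) := by
  rw [transversal_read, transversal_read, transversal_read, transversal_read, ← Finset.sum_sub_distrib,
    ← Finset.sum_sub_distrib, ← Finset.sum_add_distrib]
  simp_rw [← Finset.sum_sub_distrib, ← Finset.sum_add_distrib, alt_term W huv]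
  simp_rw [Finset.sum_add_distrib]
  rw [sum_sum_ite_and, sum_sum_ite_and, flat_dotProduct_inter W huv]
  ring

/-- ★ **UNREAD**: a direction constant on the transversals reads zero on every interaction (any tilt exposing `F_π`). -/
theorem transversal_unread_inter (W : Matrix (Fin n) (Fin n) ℝ) {u v : Fin (kk n)} (huv : u ≠ v)
    (hW : ∀ S : Finset (Fin (kk n)), flat W ⬝ᵥ udPt (Bcol S) = flat W ⬝ᵥ udPt (Bcol ∅)) :
    flat W ⬝ᵥ flat (inter u v) = 0 := by
  rw [← transversal_mixed_diff W huv, hW ({u, v} : Finset (Fin (kk n))), hW ({v} : Finset (Fin (kk n))),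
    hW ({u} : Finset (Fin (kk n)))]
  ring

/-- in particular every EXACT located direction tight on the transversal face is blind to interaction differences. -/
theorem transversal_unread_interDiff (W : Matrix (Fin n) (Fin n) ℝ) {u v v' : Fin (kk n)} (huv : u ≠ v) (huv' : u ≠ v')
    (hW : ∀ S : Finset (Fin (kk n)), flat W ⬝ᵥ udPt (Bcol S) = hCOR W) :
    flat W ⬝ᵥ flat (inter u v - inter u v') = 0 := by
  have h0 : ∀ S : Finset (Fin (kk n)), flat W ⬝ᵥ udPt (Bcol S) = flat W ⬝ᵥ udPt (Bcol ∅) := fun S => by rw [hW, hW]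
  rw [flat_sub'', dotProduct_sub, transversal_unread_inter W huv h0, transversal_unread_inter W huv' h0, sub_zero]

/-! ### clique weights of interactions on the one-sided block rows: BOTH SIGNS -/

theorem udInd_map_ι₁ (a' : Finset (Fin (kk n))) (w : Fin (kk n)) :
    udInd (a'.map (ι₁e n)) (ι₁ w) = if w ∈ a' then 1 else 0 := by
  rw [udInd_apply]
  by_cases h : w ∈ a'
  · rw [if_pos (show ι₁ w ∈ a'.map (ι₁e n) from Finset.mem_map.mpr ⟨w, h, rfl⟩), if_pos h]
  · rw [if_neg (fun hm => ?_), if_neg h]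
    obtain ⟨w', hw', he⟩ := Finset.mem_map.mp hm
    have hww : w' = w := ι₁_injective he
    exact h (hww ▸ hw')

theorem udInd_map_ι₂ (a' : Finset (Fin (kk n))) (w : Fin (kk n)) : udInd (a'.map (ι₁e n)) (ι₂ w) = 0 := by
  rw [udInd_apply, if_neg]
  intro hm
  obtain ⟨w', -, he⟩ := Finset.mem_map.mp hm
  exact ι₁_ne_ι₂ w' w he

/-- `⟨udRow ι₁(α'), I_{u,v}⟩ = −2·[u ∈ α']·[v ∈ α']`. -/
theorem udRow_map_dotProduct_inter (a' : Finset (Fin (kk n))) {u v : Fin (kk n)} (huv : u ≠ v) :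
    udRow (a'.map (ι₁e n)) ⬝ᵥ flat (inter u v) =
      -2 * (if u ∈ a' then (1 : ℝ) else 0) * (if v ∈ a' then (1 : ℝ) else 0) := by
  unfold inter
  rw [flat_sub'', dotProduct_sub,
    udRow_dotProduct_zgen _ (fun h => huv (ι₁_injective h)) (ι₁_ne_ι₂ u v),
    udRow_dotProduct_zgen _ (fun h => ι₁_ne_ι₂ v u h.symm) (fun h => huv (ι₂_injective h)),
    udInd_map_ι₁, udInd_map_ι₁, udInd_map_ι₂, udInd_map_ι₂]
  ring

/-- ★ `⟨udRow ι₁(α'), I_{u,v} − I_{u,v'}⟩ = −2·[u ∈ α']·([v ∈ α'] − [v' ∈ α'])` — SIGN-INDEFINITE across block rows. -/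
theorem udRow_map_dotProduct_interDiff (a' : Finset (Fin (kk n))) {u v v' : Fin (kk n)} (huv : u ≠ v) (huv' : u ≠ v') :
    udRow (a'.map (ι₁e n)) ⬝ᵥ flat (inter u v - inter u v') =
      -2 * (if u ∈ a' then (1 : ℝ) else 0) * ((if v ∈ a' then (1 : ℝ) else 0) - (if v' ∈ a' then (1 : ℝ) else 0)) := by
  rw [flat_sub'', dotProduct_sub, udRow_map_dotProduct_inter a' huv, udRow_map_dotProduct_inter a' huv']
  ring

theorem interDiff_cw_neg {u v v' : Fin (kk n)} (huv : u ≠ v) (huv' : u ≠ v') (hvv' : v ≠ v') :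
    udRow (({u, v} : Finset (Fin (kk n))).map (ι₁e n)) ⬝ᵥ flat (inter u v - inter u v') = -2 := by
  rw [udRow_map_dotProduct_interDiff _ huv huv', if_pos (Finset.mem_insert_self u _),
    if_pos (Finset.mem_insert_of_mem (Finset.mem_singleton_self v)),
    if_neg (by simp [huv'.symm, hvv'.symm] : v' ∉ ({u, v} : Finset (Fin (kk n))))]
  norm_num

theorem interDiff_cw_pos {u v v' : Fin (kk n)} (huv : u ≠ v) (huv' : u ≠ v') (hvv' : v ≠ v') :
    udRow (({u, v'} : Finset (Fin (kk n))).map (ι₁e n)) ⬝ᵥ flat (inter u v - inter u v') = 2 := by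
  rw [udRow_map_dotProduct_interDiff _ huv huv', if_pos (Finset.mem_insert_self u _),
    if_neg (by simp [huv.symm, hvv'] : v ∉ ({u, v'} : Finset (Fin (kk n)))),
    if_pos (Finset.mem_insert_of_mem (Finset.mem_singleton_self v'))]
  norm_num

/-! ### ★★ the ceiling: no common maximising vertex for the two rows, for ANY tilt tight on the transversals -/

/-- ★★ **TRANSVERSAL-FACE TEMPLATE CEILING** (no tight tilt on the transversals with a common maximising vertex). -/
theorem no_common_argmax_of_interDiff {N : ℕ} (Q₀ : Matrix (Fin n) (Fin n) ℝ) (G : Fin N → Matrix (Fin n) (Fin n) ℝ)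
    {u v v' : Fin (kk n)} (huv : u ≠ v) (huv' : u ≠ v') (hvv' : v ≠ v') {t₀ : Fin N}
    (ht₀ : G t₀ = inter u v - inter u v') (W : Matrix (Fin n) (Fin n) ℝ)
    (hW : ∀ S : Finset (Fin (kk n)), flat W ⬝ᵥ udPt (Bcol S) = hCOR W) :
    ¬ ∃ P : Finset (Fin N),
      (∀ P', (udRow (({u, v} : Finset (Fin (kk n))).map (ι₁e n)) + flat W) ⬝ᵥ cubePt Q₀ G P' ≤
          (udRow (({u, v} : Finset (Fin (kk n))).map (ι₁e n)) + flat W) ⬝ᵥ cubePt Q₀ G P) ∧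
      (∀ P', (udRow (({u, v'} : Finset (Fin (kk n))).map (ι₁e n)) + flat W) ⬝ᵥ cubePt Q₀ G P' ≤
          (udRow (({u, v'} : Finset (Fin (kk n))).map (ι₁e n)) + flat W) ⬝ᵥ cubePt Q₀ G P) := by
  classical
  rintro ⟨P, h1, h2⟩
  have hs1 : (udRow (({u, v} : Finset (Fin (kk n))).map (ι₁e n)) + flat W) ⬝ᵥ flat (G t₀) = -2 := by
    rw [add_dotProduct, ht₀, interDiff_cw_neg huv huv' hvv', transversal_unread_interDiff W huv huv' hW, add_zero]
  have hs2 : (udRow (({u, v'} : Finset (Fin (kk n))).map (ι₁e n)) + flat W) ⬝ᵥ flat (G t₀) = 2 := by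
    rw [add_dotProduct, ht₀, interDiff_cw_pos huv huv' hvv', transversal_unread_interDiff W huv huv' hW, add_zero]
  by_cases ht : t₀ ∈ P
  · have h := h1 (P.erase t₀)
    rw [dotProduct_cubePt, dotProduct_cubePt, ← Finset.add_sum_erase P _ ht, hs1] at h
    linarith
  · have h := h2 (insert t₀ P)
    rw [dotProduct_cubePt, dotProduct_cubePt, Finset.sum_insert ht, hs2] at h
    linarith

/-- the same ceiling in the law's currency. -/
theorem no_exact_column_of_interDiff {N K : ℕ} (Q₀ : Matrix (Fin n) (Fin n) ℝ) (G : Fin N → Matrix (Fin n) (Fin n) ℝ)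
    {u v v' : Fin (kk n)} (huv : u ≠ v) (huv' : u ≠ v') (hvv' : v ≠ v') {t₀ : Fin N}
    (ht₀ : G t₀ = inter u v - inter u v') (W : Matrix (Fin n) (Fin n) ℝ)
    (hW : ∀ S : Finset (Fin (kk n)), flat W ⬝ᵥ udPt (Bcol S) = hCOR W)
    (e : Fin (K + 1) → Finset (Fin N)) (he : Function.Surjective e) (j : Fin (K + 1)) :
    ¬ ((∀ j', (udRow (({u, v} : Finset (Fin (kk n))).map (ι₁e n)) + flat W) ⬝ᵥ (cubePt Q₀ G ∘ e) j' ≤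
          (udRow (({u, v} : Finset (Fin (kk n))).map (ι₁e n)) + flat W) ⬝ᵥ (cubePt Q₀ G ∘ e) j) ∧
       (∀ j', (udRow (({u, v'} : Finset (Fin (kk n))).map (ι₁e n)) + flat W) ⬝ᵥ (cubePt Q₀ G ∘ e) j' ≤
          (udRow (({u, v'} : Finset (Fin (kk n))).map (ι₁e n)) + flat W) ⬝ᵥ (cubePt Q₀ G ∘ e) j)) := by
  rintro ⟨h1, h2⟩
  refine no_common_argmax_of_interDiff Q₀ G huv huv' hvv' ht₀ W hW ⟨e j, fun P' => ?_, fun P' => ?_⟩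
  · obtain ⟨j', hj'⟩ := he P'
    have := h1 j'
    simp only [Function.comp, hj'] at this
    exact this
  · obtain ⟨j', hj'⟩ := he P'
    have := h2 j'
    simp only [Function.comp, hj'] at this
    exact this

end InteractionCeiling

/-! ## §11 TOGETHER FACES (memo §2f): blocks `A_i = β⁻¹ i`, transversal `σ`, face `{b_S = ⋃_{i∈S} A_i}` (`bUn`) exposed by `W^β` (`Wtog`,
`hCOR_Wtog`), block reads `ud_block_tog`, pins and the pinning engine `cor_add_cube_bound_of_pinning`. -/

section TogetherFace

variable {n k : ℕ}

/-- the column vertex `b_S := ⋃_{i ∈ S} A_i`. -/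
def bUn (β : Fin n → Fin k) (S : Finset (Fin k)) : Finset (Fin n) := Finset.univ.filter (fun x => β x ∈ S)

theorem mem_bUn (β : Fin n → Fin k) (S : Finset (Fin k)) (x : Fin n) : x ∈ bUn β S ↔ β x ∈ S := by
  simp [bUn]

theorem σ_injective {β : Fin n → Fin k} {σ : Fin k → Fin n} (hβσ : ∀ i, β (σ i) = i) : Function.Injective σ :=
  fun i j h => by rw [← hβσ i, ← hβσ j, h]

theorem image_inter_bUn {β : Fin n → Fin k} {σ : Fin k → Fin n} (hβσ : ∀ i, β (σ i) = i) (α' S : Finset (Fin k)) :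
    α'.image σ ∩ bUn β S = (α' ∩ S).image σ := by
  classical
  ext x
  rw [Finset.mem_inter, Finset.mem_image, Finset.mem_image, mem_bUn]
  constructor
  · rintro ⟨⟨i, hi, rfl⟩, hx⟩
    rw [hβσ] at hx
    exact ⟨i, Finset.mem_inter.mpr ⟨hi, hx⟩, rfl⟩
  · rintro ⟨i, hi, rfl⟩
    exact ⟨⟨i, (Finset.mem_inter.mp hi).1, rfl⟩, by rw [hβσ]; exact (Finset.mem_inter.mp hi).2⟩

/-- the clique part of the block at a together face: `1 − ⟨udRow σ(α'), x_{b_S}⟩ = (1 − |α' ∩ S|)²`. -/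
theorem ud_block_tog {β : Fin n → Fin k} {σ : Fin k → Fin n} (hβσ : ∀ i, β (σ i) = i) (α' S : Finset (Fin k)) :
    1 - udRow (α'.image σ) ⬝ᵥ udPt (bUn β S) = (1 - ((α' ∩ S).card : ℝ)) ^ 2 := by
  classical
  rw [(ud_data n).2.2.1, image_inter_bUn hβσ, Finset.card_image_of_injective _ (σ_injective hβσ)]

/-! ### uniform pinning and the common maximiser -/

/-- `W` PINS the cube `G` UNIFORMLY (located scores constant in the clique index, of the recorded sign). -/
def Pins (W : Matrix (Fin n) (Fin n) ℝ) {N : ℕ} (G : Fin N → Matrix (Fin n) (Fin n) ℝ) : Prop :=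
  ∀ t, (∀ a : Finset (Fin n), 0 ≤ (udRow a + flat W) ⬝ᵥ flat (G t)) ∨
    (∀ a : Finset (Fin n), (udRow a + flat W) ⬝ᵥ flat (G t) ≤ 0)

/-- the common maximiser: the nonnegatively pinned generators. -/
noncomputable def Hpin (W : Matrix (Fin n) (Fin n) ℝ) {N : ℕ} (G : Fin N → Matrix (Fin n) (Fin n) ℝ) : Finset (Fin N) :=
  Finset.univ.filter (fun t => ∀ a : Finset (Fin n), 0 ≤ (udRow a + flat W) ⬝ᵥ flat (G t))

theorem mem_Hpin (W : Matrix (Fin n) (Fin n) ℝ) {N : ℕ} (G : Fin N → Matrix (Fin n) (Fin n) ℝ) (t : Fin N) :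
    t ∈ Hpin W G ↔ ∀ a : Finset (Fin n), 0 ≤ (udRow a + flat W) ⬝ᵥ flat (G t) := by
  simp [Hpin]

/-- ★ under uniform pinning `Hpin` maximises EVERY located row over the cube. -/
theorem pin_le_star {W : Matrix (Fin n) (Fin n) ℝ} {N : ℕ} {G : Fin N → Matrix (Fin n) (Fin n) ℝ} (hp : Pins W G)
    (Q₀ : Matrix (Fin n) (Fin n) ℝ) (a : Finset (Fin n)) (P : Finset (Fin N)) :
    (udRow a + flat W) ⬝ᵥ cubePt Q₀ G P ≤ (udRow a + flat W) ⬝ᵥ cubePt Q₀ G (Hpin W G) := by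
  classical
  set ρ := udRow a + flat W
  rw [dotProduct_cubePt, dotProduct_cubePt]
  have hsplit := Finset.sum_filter_add_sum_filter_not P (fun t => t ∈ Hpin W G) (fun t => ρ ⬝ᵥ flat (G t))
  have hneg : ∑ t ∈ P.filter (fun t => t ∉ Hpin W G), ρ ⬝ᵥ flat (G t) ≤ 0 := by
    refine Finset.sum_nonpos fun t ht => ?_
    have ht' : t ∉ Hpin W G := (Finset.mem_filter.mp ht).2
    rcases hp t with h | h
    · exact absurd ((mem_Hpin W G t).mpr h) ht'
    · exact h a
  have hsub : P.filter (fun t => t ∈ Hpin W G) ⊆ Hpin W G := fun t ht => (Finset.mem_filter.mp ht).2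
  have hmono : ∑ t ∈ P.filter (fun t => t ∈ Hpin W G), ρ ⬝ᵥ flat (G t) ≤ ∑ t ∈ Hpin W G, ρ ⬝ᵥ flat (G t) :=
    Finset.sum_le_sum_of_subset_of_nonneg hsub fun t ht _ => (mem_Hpin W G t).mp ht a
  linarith

/-! ### ★★ the engine: a tight, uniformly pinning direction at a together face forces `UDISJ_k` -/

/-- ★★ **PINNING ENGINE AT A TOGETHER FACE** (listed-passenger currency, budget-free): `3^k ≤ (r+1)·2^k`. -/
theorem cube_block_of_pinning {β : Fin n → Fin k} {σ : Fin k → Fin n} (hβσ : ∀ i, β (σ i) = i)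
    {N K : ℕ} (Q₀ : Matrix (Fin n) (Fin n) ℝ) (G : Fin N → Matrix (Fin n) (Fin n) ℝ) (W : Matrix (Fin n) (Fin n) ℝ)
    (htight : ∀ S : Finset (Fin k), flat W ⬝ᵥ udPt (bUn β S) = hCOR W) (hp : Pins W G)
    (e : Fin (K + 1) → Finset (Fin N)) (he : Function.Surjective e) (r : ℕ)
    (mm : exactTilted.A n → ℝ) (hle : ∀ a j, exactTilted.ρ n a ⬝ᵥ (cubePt Q₀ G ∘ e) j ≤ mm a)
    (hat : ∀ a, ∃ j, exactTilted.ρ n a ⬝ᵥ (cubePt Q₀ G ∘ e) j = mm a)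
    (U : exactTilted.A n → Option (Fin r) → ℝ) (V : Finset (Fin n) × Fin (K + 1) → Option (Fin r) → ℝ)
    (hU : ∀ a i, 0 ≤ U a i) (hV : ∀ p i, 0 ≤ V p i)
    (hfac : ∀ a b j, (exactTilted.β n a + mm a) - exactTilted.ρ n a ⬝ᵥ (udPt b + (cubePt Q₀ G ∘ e) j) = ∑ i, U a i * V (b, j) i) :
    3 ^ k ≤ (r + 1) * 2 ^ k := by
  classical
  obtain ⟨jstar, hj⟩ := he (Hpin W G)
  let row : Finset (Fin k) → exactTilted.A n := fun α' => (α'.image σ, W)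
  let col : Finset (Fin k) → Finset (Fin n) × Fin (K + 1) := fun S => (bUn β S, jstar)
  have hq : (cubePt Q₀ G ∘ e) jstar = cubePt Q₀ G (Hpin W G) := by simp [hj]
  have hmm : ∀ α', mm (row α') = (udRow (α'.image σ) + flat W) ⬝ᵥ cubePt Q₀ G (Hpin W G) := by
    intro α'
    obtain ⟨j₀, hj₀⟩ := hat (row α')
    have h1 := hle (row α') jstar
    rw [hq] at h1
    have h2 : exactTilted.ρ n (row α') ⬝ᵥ (cubePt Q₀ G ∘ e) j₀ ≤ (udRow (α'.image σ) + flat W) ⬝ᵥ cubePt Q₀ G (Hpin W G) :=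
      pin_le_star hp Q₀ _ (e j₀)
    rw [hj₀] at h2
    exact le_antisymm h2 h1
  have key := three_pow_le_of_block (ι := Option (Fin r)) U V hU hV row col ?_
  · simpa [Fintype.card_option, Fintype.card_fin] using key
  · intro α' S
    rw [← hfac (row α') (bUn β S) jstar, hq, hmm α']
    show ((1 + hCOR W) + (udRow (α'.image σ) + flat W) ⬝ᵥ cubePt Q₀ G (Hpin W G)) -
        (udRow (α'.image σ) + flat W) ⬝ᵥ (udPt (bUn β S) + cubePt Q₀ G (Hpin W G)) = (1 - ((α' ∩ S).card : ℝ)) ^ 2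
    rw [dotProduct_add, add_dotProduct _ _ (udPt (bUn β S)), htight S, ← ud_block_tog hβσ α' S]
    ring

/-- ★★ **TOP LAW, budget-free**: a tilt tight on the together face pinning the cube uniformly ⇒ `3^k ≤ (r+1)·2^k`. -/
theorem cor_add_cube_bound_of_pinning {β : Fin n → Fin k} {σ : Fin k → Fin n} (hβσ : ∀ i, β (σ i) = i)
    {N : ℕ} (Q₀ : Matrix (Fin n) (Fin n) ℝ) (G : Fin N → Matrix (Fin n) (Fin n) ℝ) (W : Matrix (Fin n) (Fin n) ℝ)
    (htight : ∀ S : Finset (Fin k), flat W ⬝ᵥ udPt (bUn β S) = hCOR W) (hp : Pins W G) (r : ℕ)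
    (hEF : HasEFOfSize (corPolytope n + convexHull ℝ (Set.range (cubePt Q₀ G))) r) :
    3 ^ k ≤ (r + 1) * 2 ^ k := by
  classical
  obtain ⟨pt_mem, -, -, -⟩ := ud_data n
  let mm : exactTilted.A n → ℝ := fun a =>
    Finset.univ.sup' Finset.univ_nonempty (fun P : Finset (Fin N) => exactTilted.ρ n a ⬝ᵥ cubePt Q₀ G P)
  have hat : ∀ a, ∃ P, exactTilted.ρ n a ⬝ᵥ cubePt Q₀ G P = mm a := fun a => by
    obtain ⟨P, -, hP⟩ := Finset.exists_mem_eq_sup' Finset.univ_nonempty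
      (fun P : Finset (Fin N) => exactTilted.ρ n a ⬝ᵥ cubePt Q₀ G P)
    exact ⟨P, hP.symm⟩
  have hle : ∀ a P, exactTilted.ρ n a ⬝ᵥ cubePt Q₀ G P ≤ mm a := fun a P =>
    Finset.le_sup' (fun P : Finset (Fin N) => exactTilted.ρ n a ⬝ᵥ cubePt Q₀ G P) (Finset.mem_univ P)
  have hm : ∀ a, ∀ y ∈ convexHull ℝ (Set.range (cubePt Q₀ G)), exactTilted.ρ n a ⬝ᵥ y ≤ mm a := fun a =>
    dot_le_of_mem_convexHull _ _ _ (by rintro _ ⟨P, rfl⟩; exact hle a P)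
  have hq : ∀ P : Finset (Fin N), cubePt Q₀ G P ∈ convexHull ℝ (Set.range (cubePt Q₀ G)) :=
    fun P => subset_convexHull ℝ _ ⟨P, rfl⟩
  have hv : ∀ p : Finset (Fin n) × Finset (Fin N),
      udPt p.1 + cubePt Q₀ G p.2 ∈ corPolytope n + convexHull ℝ (Set.range (cubePt Q₀ G)) :=
    fun p => Set.add_mem_add (pt_mem p.1) (hq p.2)
  have hvalid : ∀ a, ∀ x ∈ corPolytope n + convexHull ℝ (Set.range (cubePt Q₀ G)),
      exactTilted.ρ n a ⬝ᵥ x ≤ exactTilted.β n a + mm a := by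
    rintro a x ⟨p, hp, y, hy, rfl⟩
    rw [dotProduct_add]
    exact add_le_add (exactTilted.valid n a p hp) (hm a y hy)
  obtain ⟨U, V, hU, hV, hfac⟩ := Literature.Barriers.PneNP.HasEFOfSize.exists_nonneg_factorization hEF
    (fun p : Finset (Fin n) × Finset (Fin N) => udPt p.1 + cubePt Q₀ G p.2) hv (exactTilted.ρ n)
    (fun a => exactTilted.β n a + mm a) hvalid
  -- list the cube by the identity listing of `Finset (Fin N)` through an equivalence with `Fin (K+1)`
  obtain ⟨K, eqv⟩ : ∃ K, Nonempty (Fin (K + 1) ≃ Finset (Fin N)) := by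
    refine ⟨Fintype.card (Finset (Fin N)) - 1, ⟨(Fintype.equivFinOfCardEq ?_).symm⟩⟩
    have : 0 < Fintype.card (Finset (Fin N)) := Fintype.card_pos
    omega
  obtain ⟨eK⟩ := eqv
  exact cube_block_of_pinning hβσ Q₀ G W htight hp eK eK.surjective r mm
    (fun a j => hle a (eK j)) (fun a => by obtain ⟨P, hP⟩ := hat a; exact ⟨eK.symm P, by simpa using hP⟩)
    U (fun p i => V (p.1, eK p.2) i) hU (fun p i => hV _ i) (fun a b j => hfac a (b, eK j))

/-! ### the together-face direction `W^β` itself (the face exists; `h_COR = 0`) -/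

/-- block sizes `|A_i|`. -/
def bsize (β : Fin n → Fin k) (i : Fin k) : ℕ := (Finset.univ.filter (fun y => β y = i)).card

/-- `W^β := Σ_i (𝟙_{A_i}𝟙_{A_i}ᵀ − |A_i|·I_{A_i})`. -/
def Wtog (β : Fin n → Fin k) : Matrix (Fin n) (Fin n) ℝ := fun x y =>
  (if β y = β x then (1 : ℝ) else 0) - (if y = x then (bsize β (β x) : ℝ) else 0)

theorem Wtog_row_sum (β : Fin n → Fin k) (b : Finset (Fin n)) {x : Fin n} (hx : x ∈ b) :
    ∑ y ∈ b, Wtog β x y = ((b.filter (fun y => β y = β x)).card : ℝ) - (bsize β (β x) : ℝ) := by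
  classical
  unfold Wtog
  rw [Finset.sum_sub_distrib, Finset.sum_boole, Finset.sum_ite_eq' b x, if_pos hx]

theorem Wtog_dotProduct_udPt (β : Fin n → Fin k) (b : Finset (Fin n)) :
    flat (Wtog β) ⬝ᵥ udPt b = ∑ x ∈ b, (((b.filter (fun y => β y = β x)).card : ℝ) - (bsize β (β x) : ℝ)) := by
  rw [flat_dotProduct_udPt_sum]
  exact Finset.sum_congr rfl fun x hx => Wtog_row_sum β b hx

/-- `⟨W^β, x_b⟩ = Σ_{x∈b} (|b ∩ A_{β x}| − |A_{β x}|) ≤ 0`. -/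
theorem Wtog_dotProduct_udPt_le (β : Fin n → Fin k) (b : Finset (Fin n)) : flat (Wtog β) ⬝ᵥ udPt b ≤ 0 := by
  classical
  rw [Wtog_dotProduct_udPt]
  refine Finset.sum_nonpos fun x _ => ?_
  have : (b.filter (fun y => β y = β x)).card ≤ bsize β (β x) :=
    Finset.card_le_card (fun y hy => by
      rw [Finset.mem_filter] at hy ⊢
      exact ⟨Finset.mem_univ y, hy.2⟩)
  have h' : ((b.filter (fun y => β y = β x)).card : ℝ) ≤ (bsize β (β x) : ℝ) := by exact_mod_cast this
  linarith

/-- `= 0` on every union of blocks `b_S`. -/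
theorem Wtog_dotProduct_bUn (β : Fin n → Fin k) (S : Finset (Fin k)) : flat (Wtog β) ⬝ᵥ udPt (bUn β S) = 0 := by
  classical
  rw [Wtog_dotProduct_udPt]
  refine Finset.sum_eq_zero fun x hx => ?_
  have hS : β x ∈ S := (mem_bUn β S x).mp hx
  have : (bUn β S).filter (fun y => β y = β x) = Finset.univ.filter (fun y => β y = β x) := by
    ext y
    simp only [Finset.mem_filter, Finset.mem_univ, true_and, mem_bUn]
    constructor
    · exact fun h => h.2
    · intro h; exact ⟨h ▸ hS, h⟩
  rw [this]
  show ((Finset.univ.filter (fun y => β y = β x)).card : ℝ) - (bsize β (β x) : ℝ) = 0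
  simp [bsize]

/-- ★ the together face is EXACTLY exposed with support value `0`: `h_COR(W^β) = 0`, attained on every `b_S`. -/
theorem hCOR_Wtog (β : Fin n → Fin k) : hCOR (Wtog β) = 0 :=
  le_antisymm (Finset.sup'_le _ _ fun b _ => Wtog_dotProduct_udPt_le β b)
    (by have h := le_hCOR (Wtog β) (bUn β ∅); rwa [Wtog_dotProduct_bUn] at h)

theorem Wtog_tight (β : Fin n → Fin k) (S : Finset (Fin k)) : flat (Wtog β) ⬝ᵥ udPt (bUn β S) = hCOR (Wtog β) := by
  rw [hCOR_Wtog, Wtog_dotProduct_bUn]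

/-- COROLLARY: a cube PINNED UNIFORMLY BY `W^β` ITSELF is decided with `3^k ≤ (r+1)·2^k` (no extra tilt needed). -/
theorem cor_add_cube_bound_of_Wtog_pins {β : Fin n → Fin k} {σ : Fin k → Fin n} (hβσ : ∀ i, β (σ i) = i)
    {N : ℕ} (Q₀ : Matrix (Fin n) (Fin n) ℝ) (G : Fin N → Matrix (Fin n) (Fin n) ℝ) (hp : Pins (Wtog β) G) (r : ℕ)
    (hEF : HasEFOfSize (corPolytope n + convexHull ℝ (Set.range (cubePt Q₀ G))) r) :
    3 ^ k ≤ (r + 1) * 2 ^ k :=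
  cor_add_cube_bound_of_pinning hβσ Q₀ G (Wtog β) (Wtog_tight β) hp r hEF

end TogetherFace

/-! ## §12 W7-K1 IN KERNEL: every SPARSE-GENERATOR cube is pinned at a together face (`exists_witness_of_sparse`, `exists_reads_ne_of_closed`,
`exists_pins_of_sparse`), hence decided: ★★★ `cor_add_sparseCube_bound : 3^k ≤ (r+1)·2^k` (budget-free). -/

section SparsePins

variable {n k : ℕ}

theorem flat_add'' (A B : Matrix (Fin n) (Fin n) ℝ) : flat (A + B) = flat A + flat B := by
  change flatLin n (A + B) = flatLin n A + flatLin n B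
  rw [map_add]

theorem abs_udInd_le_one (a : Finset (Fin n)) (x : Fin n) : |udInd a x| ≤ 1 := by
  rw [udInd_apply]; split_ifs <;> simp

theorem abs_udMat_le_one (a : Finset (Fin n)) (x y : Fin n) : |udMat a x y| ≤ 1 := by
  unfold udMat
  rw [udInd_apply, udInd_apply]
  by_cases hxy : x = y
  · subst hxy
    by_cases hx : x ∈ a
    · simp [hx]; norm_num
    · simp [hx]
  · by_cases hx : x ∈ a <;> by_cases hy : y ∈ a <;> simp [hxy, hx, hy]

/-- clique weights are bounded by the `ℓ¹` mass of the generator. -/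
theorem abs_udRow_dotProduct_flat_le (a : Finset (Fin n)) (g : Matrix (Fin n) (Fin n) ℝ) :
    |udRow a ⬝ᵥ flat g| ≤ ∑ x, ∑ y, |g x y| := by
  unfold udRow
  rw [flat_dotProduct_flat]
  refine (Finset.abs_sum_le_sum_abs _ _).trans (Finset.sum_le_sum fun x _ =>
    (Finset.abs_sum_le_sum_abs _ _).trans (Finset.sum_le_sum fun y _ => ?_))
  rw [abs_mul]
  calc |udMat a x y| * |g x y| ≤ 1 * |g x y| := mul_le_mul_of_nonneg_right (abs_udMat_le_one a x y) (abs_nonneg _)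
    _ = |g x y| := one_mul _

/-- located reads at vertices are bounded by the `ℓ¹` mass of the direction. -/
theorem abs_flat_dotProduct_udPt_le (V : Matrix (Fin n) (Fin n) ℝ) (b : Finset (Fin n)) :
    |flat V ⬝ᵥ udPt b| ≤ ∑ x, ∑ y, |V x y| := by
  rw [flat_dotProduct_udPt]
  refine (Finset.abs_sum_le_sum_abs _ _).trans (Finset.sum_le_sum fun x _ =>
    (Finset.abs_sum_le_sum_abs _ _).trans (Finset.sum_le_sum fun y _ => ?_))
  rw [abs_mul, abs_mul]
  calc |V x y| * (|udInd b x| * |udInd b y|) ≤ |V x y| * (1 * 1) :=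
        mul_le_mul_of_nonneg_left (mul_le_mul (abs_udInd_le_one b x) (abs_udInd_le_one b y) (abs_nonneg _) zero_le_one)
          (abs_nonneg _)
    _ = |V x y| := by ring

/-! ### face-zero directions -/

/-- directions reading zero on the whole together face `F_β`. -/
def faceZero (β : Fin n → Fin k) (V : Matrix (Fin n) (Fin n) ℝ) : Prop := ∀ S : Finset (Fin k), flat V ⬝ᵥ udPt (bUn β S) = 0

theorem faceZero_zero (β : Fin n → Fin k) : faceZero β 0 := fun S => by
  rw [flat_zero'', zero_dotProduct]

theorem faceZero_add {β : Fin n → Fin k} {V V' : Matrix (Fin n) (Fin n) ℝ} (h : faceZero β V) (h' : faceZero β V') :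
    faceZero β (V + V') := fun S => by
  rw [flat_add'', add_dotProduct, h S, h' S, add_zero]

theorem faceZero_smul {β : Fin n → Fin k} {V : Matrix (Fin n) (Fin n) ℝ} (c : ℝ) (h : faceZero β V) :
    faceZero β (c • V) := fun S => by
  rw [flat_smul'', smul_dotProduct, h S, smul_zero]

/-- the explicit face-zero direction `E_{xy} − E_{xy'}`. -/
def Ed (x y y' : Fin n) : Matrix (Fin n) (Fin n) ℝ := fun p q =>
  if p = x then (if q = y then (1 : ℝ) else 0) - (if q = y' then (1 : ℝ) else 0) else 0

theorem flat_Ed_dotProduct_flat (x y y' : Fin n) (g : Matrix (Fin n) (Fin n) ℝ) :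
    flat (Ed x y y') ⬝ᵥ flat g = g x y - g x y' := by
  classical
  rw [flat_dotProduct_flat]
  have h : ∀ p, ∑ q, Ed x y y' p q * g p q = if p = x then g x y - g x y' else 0 := by
    intro p
    unfold Ed
    by_cases hp : p = x
    · subst hp
      simp only [if_true, sub_mul, Finset.sum_sub_distrib, ite_mul, one_mul, zero_mul, Finset.sum_ite_eq',
        Finset.mem_univ]
    · simp [hp]
  rw [Finset.sum_congr rfl fun p _ => h p, Finset.sum_ite_eq' Finset.univ x, if_pos (Finset.mem_univ x)]

theorem Ed_faceZero (β : Fin n → Fin k) {x y y' : Fin n} (hyy' : β y = β y') : faceZero β (Ed x y y') := by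
  classical
  intro S
  rw [flat_dotProduct_udPt_sum]
  refine Finset.sum_eq_zero fun p _ => ?_
  unfold Ed
  by_cases hp : p = x
  · subst hp
    simp only [if_true]
    rw [Finset.sum_sub_distrib, Finset.sum_ite_eq' (bUn β S) y, Finset.sum_ite_eq' (bUn β S) y']
    have : (y ∈ bUn β S) ↔ (y' ∈ bUn β S) := by rw [mem_bUn, mem_bUn, hyy']
    by_cases hy : y ∈ bUn β S
    · rw [if_pos hy, if_pos (this.mp hy), sub_self]
    · rw [if_neg hy, if_neg (fun h => hy (this.mpr h)), sub_self]
  · simp [hp]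

/-- ★ the NON-BLOCKY LEMMA as a witness (column support smaller than every block ⇒ read by a row move). -/
theorem exists_witness_of_sparse (β : Fin n → Fin k) {N : ℕ} (G : Fin N → Matrix (Fin n) (Fin n) ℝ)
    (Vs : Fin N → Finset (Fin n)) (hG : ∀ t x y, G t x y ≠ 0 → y ∈ Vs t) (hs : ∀ t i, (Vs t).card < bsize β i)
    (t : Fin N) (ht : G t ≠ 0) : ∃ U, faceZero β U ∧ flat U ⬝ᵥ flat (G t) ≠ 0 := by
  classical
  obtain ⟨x, y, hxy⟩ : ∃ x y, G t x y ≠ 0 := by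
    by_contra h
    push Not at h
    exact ht (Matrix.ext fun x y => by rw [h x y]; rfl)
  obtain ⟨y', hy'A, hy'V⟩ : ∃ y' ∈ Finset.univ.filter (fun z => β z = β y), y' ∉ Vs t := by
    by_contra h
    push Not at h
    exact absurd (Finset.card_le_card (fun z hz => h z hz)) (not_le.mpr (hs t (β y)))
  have hβ : β y' = β y := (Finset.mem_filter.mp hy'A).2
  have h0 : G t x y' = 0 := by
    by_contra h
    exact hy'V (hG t x y' h)
  refine ⟨Ed x y y', Ed_faceZero β hβ.symm, ?_⟩
  rw [flat_Ed_dotProduct_flat, h0, sub_zero]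
  exact hxy

/-- FINITE AVOIDANCE for any class of directions closed under `0, +, •` (generalises `exists_faceZero_reads_ne`). -/
theorem exists_reads_ne_of_closed (P : Matrix (Fin n) (Fin n) ℝ → Prop) (h0 : P 0) (hadd : ∀ V V', P V → P V' → P (V + V'))
    (hsmul : ∀ (c : ℝ) V, P V → P (c • V)) {N : ℕ} (G : Fin N → Matrix (Fin n) (Fin n) ℝ)
    (hw : ∀ t, G t ≠ 0 → ∃ U, P U ∧ flat U ⬝ᵥ flat (G t) ≠ 0) :
    ∀ T : Finset (Fin N), ∃ V, P V ∧ ∀ t ∈ T, G t ≠ 0 → flat V ⬝ᵥ flat (G t) ≠ 0 := by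
  classical
  intro T
  induction T using Finset.induction_on with
  | empty => exact ⟨0, h0, fun t ht => absurd ht (Finset.notMem_empty t)⟩
  | insert m T hm ih =>
    obtain ⟨V, hV, hVT⟩ := ih
    by_cases hm0 : G m = 0
    · refine ⟨V, hV, fun t ht h0' => ?_⟩
      rcases Finset.mem_insert.mp ht with rfl | ht'
      · exact absurd hm0 h0'
      · exact hVT t ht' h0'
    · obtain ⟨U, hU, hUm⟩ := hw m hm0
      let rU : Fin N → ℝ := fun t => flat U ⬝ᵥ flat (G t)
      let rV : Fin N → ℝ := fun t => flat V ⬝ᵥ flat (G t)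
      let f : Fin N → ℝ := fun t => -(rU t) / rV t
      let L : ℝ := 1 + ∑ t ∈ insert m T, |f t|
      have hL : ∀ t ∈ insert m T, L ≠ f t := by
        intro t ht hLt
        have h1 : |f t| ≤ ∑ t ∈ insert m T, |f t| :=
          Finset.single_le_sum (f := fun t => |f t|) (fun t _ => abs_nonneg _) ht
        have h2 : f t ≤ |f t| := le_abs_self _
        have h3 : L = 1 + ∑ t ∈ insert m T, |f t| := rfl
        linarith
      have hkey : ∀ t ∈ insert m T, rV t ≠ 0 → L * rV t + rU t ≠ 0 := by
        intro t ht hrV heq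
        apply hL t ht
        show L = -(rU t) / rV t
        rw [eq_div_iff hrV]
        linarith
      refine ⟨L • V + U, hadd _ _ (hsmul L _ hV) hU, fun t ht h0' => ?_⟩
      rw [flat_add'', flat_smul'', add_dotProduct, smul_dotProduct, smul_eq_mul]
      show L * rV t + rU t ≠ 0
      rcases Finset.mem_insert.mp ht with rfl | ht'
      · by_cases hrV : rV t = 0
        · rw [hrV, mul_zero, zero_add]; exact hUm
        · exact hkey t ht hrV
      · exact hkey t ht (hVT t ht' h0')

/-- FINITE AVOIDANCE: one face-zero direction reading every (nonzero) generator of a finite set. -/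
theorem exists_faceZero_reads_ne (β : Fin n → Fin k) {N : ℕ} (G : Fin N → Matrix (Fin n) (Fin n) ℝ)
    (hw : ∀ t, G t ≠ 0 → ∃ U, faceZero β U ∧ flat U ⬝ᵥ flat (G t) ≠ 0) :
    ∀ T : Finset (Fin N), ∃ V, faceZero β V ∧ ∀ t ∈ T, G t ≠ 0 → flat V ⬝ᵥ flat (G t) ≠ 0 :=
  exists_reads_ne_of_closed (faceZero β) (faceZero_zero β) (fun _ _ h h' => faceZero_add h h')
    (fun c _ h => faceZero_smul c h) G hw

/-! ### the off-face margin of `W^β` -/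

theorem Wtog_term_nonpos (β : Fin n → Fin k) (b : Finset (Fin n)) (z : Fin n) :
    ((b.filter (fun y => β y = β z)).card : ℝ) - (bsize β (β z) : ℝ) ≤ 0 := by
  classical
  have : (b.filter (fun y => β y = β z)).card ≤ bsize β (β z) :=
    Finset.card_le_card (fun y hy => by
      rw [Finset.mem_filter] at hy ⊢
      exact ⟨Finset.mem_univ y, hy.2⟩)
  have h' : ((b.filter (fun y => β y = β z)).card : ℝ) ≤ (bsize β (β z) : ℝ) := by exact_mod_cast this
  linarith

/-- off the together face `W^β` reads `≤ −1`: if `x ∈ b`, `y ∉ b` lie in one block. -/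
theorem Wtog_dotProduct_udPt_le_neg_one (β : Fin n → Fin k) {b : Finset (Fin n)} {x y : Fin n}
    (hx : x ∈ b) (hy : y ∉ b) (hβ : β x = β y) : flat (Wtog β) ⬝ᵥ udPt b ≤ -1 := by
  classical
  rw [Wtog_dotProduct_udPt, ← Finset.add_sum_erase b _ hx]
  have hrest : ∑ z ∈ b.erase x, (((b.filter (fun y => β y = β z)).card : ℝ) - (bsize β (β z) : ℝ)) ≤ 0 :=
    Finset.sum_nonpos fun z _ => Wtog_term_nonpos β b z
  have hlt : (b.filter (fun y => β y = β x)).card < bsize β (β x) := by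
    refine Finset.card_lt_card (Finset.ssubset_iff_subset_ne.mpr ⟨?_, ?_⟩)
    · intro z hz
      rw [Finset.mem_filter] at hz ⊢
      exact ⟨Finset.mem_univ z, hz.2⟩
    · intro h
      have : y ∈ b.filter (fun y => β y = β x) := by
        rw [h, Finset.mem_filter]; exact ⟨Finset.mem_univ y, hβ.symm⟩
      exact hy (Finset.mem_filter.mp this).1
  have hx' : ((b.filter (fun y => β y = β x)).card : ℝ) + 1 ≤ (bsize β (β x) : ℝ) := by
    exact_mod_cast Nat.lt_iff_add_one_le.mp hlt
  linarith

/-- a set closed under the block relation is a union of blocks. -/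
theorem eq_bUn_image (β : Fin n → Fin k) {b : Finset (Fin n)} (hb : ∀ x y, β x = β y → x ∈ b → y ∈ b) :
    b = bUn β (b.image β) := by
  classical
  ext z
  rw [mem_bUn, Finset.mem_image]
  constructor
  · exact fun hz => ⟨z, hz, rfl⟩
  · rintro ⟨x, hx, hxz⟩
    exact hb x z hxz hx

/-! ### ★★★ W7-K1 -/

/-- ★★★ **EVERY SPARSE-GENERATOR CUBE IS PINNED AT A TOGETHER FACE** (generator column supports smaller than every block). -/
theorem exists_pins_of_sparse (β : Fin n → Fin k) {N : ℕ} (G : Fin N → Matrix (Fin n) (Fin n) ℝ)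
    (Vs : Fin N → Finset (Fin n)) (hG : ∀ t x y, G t x y ≠ 0 → y ∈ Vs t) (hs : ∀ t i, (Vs t).card < bsize β i) :
    ∃ W : Matrix (Fin n) (Fin n) ℝ, (∀ S, flat W ⬝ᵥ udPt (bUn β S) = hCOR W) ∧ Pins W G := by
  classical
  obtain ⟨V, hV, hVr⟩ := exists_faceZero_reads_ne β G (exists_witness_of_sparse β G Vs hG hs) Finset.univ
  -- constants
  let C : Fin N → ℝ := fun t => ∑ x, ∑ y, |G t x y|
  have hC0 : ∀ t, 0 ≤ C t := fun t => Finset.sum_nonneg fun x _ => Finset.sum_nonneg fun y _ => abs_nonneg _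
  let rV : Fin N → ℝ := fun t => flat V ⬝ᵥ flat (G t)
  let lam : ℝ := 1 + ∑ t, (if rV t = 0 then 0 else (C t + 1) / |rV t|)
  have hlam_term : ∀ t, 0 ≤ (if rV t = 0 then 0 else (C t + 1) / |rV t|) := fun t => by
    split_ifs
    · exact le_refl _
    · exact div_nonneg (by linarith [hC0 t]) (abs_nonneg _)
  have hlam0 : 0 ≤ lam := by
    have := Finset.sum_nonneg fun t (_ : t ∈ Finset.univ) => hlam_term t
    show 0 ≤ 1 + _
    linarith
  have hlam_ge : ∀ t, rV t ≠ 0 → (C t + 1) / |rV t| ≤ lam := by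
    intro t ht
    have h1 := Finset.single_le_sum (f := fun t => if rV t = 0 then 0 else (C t + 1) / |rV t|)
      (fun t _ => hlam_term t) (Finset.mem_univ t)
    simp only [if_neg ht] at h1
    show _ ≤ 1 + _
    linarith
  let V₁ : Matrix (Fin n) (Fin n) ℝ := lam • V
  have hV₁ : faceZero β V₁ := faceZero_smul lam hV
  let v : Fin N → ℝ := fun t => flat V₁ ⬝ᵥ flat (G t)
  have hv : ∀ t, v t = lam * rV t := fun t => by
    show flat (lam • V) ⬝ᵥ flat (G t) = lam * (flat V ⬝ᵥ flat (G t))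
    rw [flat_smul'', smul_dotProduct, smul_eq_mul]
  -- every nonzero generator NOT read by `W^β` is read by `V₁` above its clique weights
  have hv_big : ∀ t, G t ≠ 0 → C t < |v t| := by
    intro t ht
    have hr : rV t ≠ 0 := hVr t (Finset.mem_univ t) ht
    have hrpos : 0 < |rV t| := abs_pos.mpr hr
    rw [hv t, abs_mul, abs_of_nonneg hlam0]
    have : (C t + 1) / |rV t| * |rV t| ≤ lam * |rV t| := mul_le_mul_of_nonneg_right (hlam_ge t hr) (abs_nonneg _)
    rw [div_mul_cancel₀ _ (ne_of_gt hrpos)] at this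
    linarith
  let B : ℝ := ∑ x, ∑ y, |V₁ x y|
  let w : Fin N → ℝ := fun t => flat (Wtog β) ⬝ᵥ flat (G t)
  let μ : ℝ := 1 + B + ∑ t, (if w t = 0 then 0 else (C t + |v t| + 1) / |w t|)
  have hμ_term : ∀ t, 0 ≤ (if w t = 0 then 0 else (C t + |v t| + 1) / |w t|) := fun t => by
    split_ifs
    · exact le_refl _
    · exact div_nonneg (by linarith [hC0 t, abs_nonneg (v t)]) (abs_nonneg _)
  have hB0 : 0 ≤ B := Finset.sum_nonneg fun x _ => Finset.sum_nonneg fun y _ => abs_nonneg _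
  have hμB : 1 + B ≤ μ := by
    have := Finset.sum_nonneg fun t (_ : t ∈ Finset.univ) => hμ_term t
    show 1 + B ≤ 1 + B + _
    linarith
  have hμ0 : 0 ≤ μ := by linarith
  have hμ_ge : ∀ t, w t ≠ 0 → (C t + |v t| + 1) / |w t| ≤ μ := by
    intro t ht
    have h1 := Finset.single_le_sum (f := fun t => if w t = 0 then 0 else (C t + |v t| + 1) / |w t|)
      (fun t _ => hμ_term t) (Finset.mem_univ t)
    simp only [if_neg ht] at h1
    show _ ≤ 1 + B + _
    linarith
  -- the direction
  let W : Matrix (Fin n) (Fin n) ℝ := μ • Wtog β + V₁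
  have hWread : ∀ b, flat W ⬝ᵥ udPt b = μ * (flat (Wtog β) ⬝ᵥ udPt b) + flat V₁ ⬝ᵥ udPt b := fun b => by
    show flat (μ • Wtog β + V₁) ⬝ᵥ udPt b = _
    rw [flat_add'', flat_smul'', add_dotProduct, smul_dotProduct, smul_eq_mul]
  have hWS : ∀ S, flat W ⬝ᵥ udPt (bUn β S) = 0 := fun S => by
    rw [hWread, Wtog_dotProduct_bUn, hV₁ S, mul_zero, add_zero]
  have hWle : ∀ b, flat W ⬝ᵥ udPt b ≤ 0 := by
    intro b
    by_cases hb : ∀ x y, β x = β y → x ∈ b → y ∈ b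
    · rw [eq_bUn_image β hb, hWS]
    · push Not at hb
      obtain ⟨x, y, hβ, hx, hy⟩ := hb
      rw [hWread]
      have h1 : flat (Wtog β) ⬝ᵥ udPt b ≤ -1 := Wtog_dotProduct_udPt_le_neg_one β hx hy hβ
      have h2 : flat V₁ ⬝ᵥ udPt b ≤ B := (le_abs_self _).trans (abs_flat_dotProduct_udPt_le V₁ b)
      have h3 : μ * (flat (Wtog β) ⬝ᵥ udPt b) ≤ μ * (-1) := mul_le_mul_of_nonneg_left h1 hμ0
      linarith
  have hCOR_W : hCOR W = 0 :=
    le_antisymm (Finset.sup'_le _ _ fun b _ => hWle b) (by have h := le_hCOR W (bUn β ∅); rwa [hWS] at h)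
  refine ⟨W, fun S => by rw [hWS, hCOR_W], fun t => ?_⟩
  -- pins
  by_cases h0 : G t = 0
  · left
    intro a
    rw [h0, flat_zero'', dotProduct_zero]
  have hscore : ∀ a, (udRow a + flat W) ⬝ᵥ flat (G t) = udRow a ⬝ᵥ flat (G t) + (μ * w t + v t) := fun a => by
    show (udRow a + flat (μ • Wtog β + V₁)) ⬝ᵥ flat (G t) = _
    rw [add_dotProduct, flat_add'', flat_smul'', add_dotProduct, smul_dotProduct, smul_eq_mul]
  have hpin : C t < |μ * w t + v t| := by
    by_cases hw0 : w t = 0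
    · rw [hw0, mul_zero, zero_add]; exact hv_big t h0
    · have hwpos : 0 < |w t| := abs_pos.mpr hw0
      have h1 : (C t + |v t| + 1) / |w t| * |w t| ≤ μ * |w t| := mul_le_mul_of_nonneg_right (hμ_ge t hw0) (abs_nonneg _)
      rw [div_mul_cancel₀ _ (ne_of_gt hwpos)] at h1
      have h2 : |μ * w t| = μ * |w t| := by rw [abs_mul, abs_of_nonneg hμ0]
      have h3 : |μ * w t| ≤ |μ * w t + v t| + |v t| := by
        have := abs_sub (μ * w t + v t) (v t)
        rwa [add_sub_cancel_right] at this
      linarith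
  have hcw : ∀ a, |udRow a ⬝ᵥ flat (G t)| ≤ C t := fun a => abs_udRow_dotProduct_flat_le a (G t)
  rcases lt_abs.mp hpin with hpos | hneg
  · left
    intro a
    rw [hscore a]
    have := (abs_le.mp (hcw a)).1
    linarith
  · right
    intro a
    rw [hscore a]
    have := (abs_le.mp (hcw a)).2
    linarith

/-- ★★★ **EVERY SPARSE-GENERATOR CUBE IS DECIDED** (top law, budget-free): `3^k ≤ (r+1)·2^k`. -/
theorem cor_add_sparseCube_bound {β : Fin n → Fin k} {σ : Fin k → Fin n} (hβσ : ∀ i, β (σ i) = i)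
    {N : ℕ} (Q₀ : Matrix (Fin n) (Fin n) ℝ) (G : Fin N → Matrix (Fin n) (Fin n) ℝ)
    (Vs : Fin N → Finset (Fin n)) (hG : ∀ t x y, G t x y ≠ 0 → y ∈ Vs t) (hs : ∀ t i, (Vs t).card < bsize β i) (r : ℕ)
    (hEF : HasEFOfSize (corPolytope n + convexHull ℝ (Set.range (cubePt Q₀ G))) r) :
    3 ^ k ≤ (r + 1) * 2 ^ k := by
  obtain ⟨W, ht, hp⟩ := exists_pins_of_sparse β G Vs hG hs
  exact cor_add_cube_bound_of_pinning hβσ Q₀ G W ht hp r hEF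

/-- the same in `ExactPencilLaw` / listed-passenger currency. -/
theorem sparseCube_block {β : Fin n → Fin k} {σ : Fin k → Fin n} (hβσ : ∀ i, β (σ i) = i)
    {N K : ℕ} (Q₀ : Matrix (Fin n) (Fin n) ℝ) (G : Fin N → Matrix (Fin n) (Fin n) ℝ)
    (Vs : Fin N → Finset (Fin n)) (hG : ∀ t x y, G t x y ≠ 0 → y ∈ Vs t) (hs : ∀ t i, (Vs t).card < bsize β i)
    (e : Fin (K + 1) → Finset (Fin N)) (he : Function.Surjective e) (r : ℕ)
    (mm : exactTilted.A n → ℝ) (hle : ∀ a j, exactTilted.ρ n a ⬝ᵥ (cubePt Q₀ G ∘ e) j ≤ mm a)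
    (hat : ∀ a, ∃ j, exactTilted.ρ n a ⬝ᵥ (cubePt Q₀ G ∘ e) j = mm a)
    (U : exactTilted.A n → Option (Fin r) → ℝ) (V : Finset (Fin n) × Fin (K + 1) → Option (Fin r) → ℝ)
    (hU : ∀ a i, 0 ≤ U a i) (hV : ∀ p i, 0 ≤ V p i)
    (hfac : ∀ a b j, (exactTilted.β n a + mm a) - exactTilted.ρ n a ⬝ᵥ (udPt b + (cubePt Q₀ G ∘ e) j) = ∑ i, U a i * V (b, j) i) :
    3 ^ k ≤ (r + 1) * 2 ^ k := by
  obtain ⟨W, ht, hp⟩ := exists_pins_of_sparse β G Vs hG hs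
  exact cube_block_of_pinning hβσ Q₀ G W ht hp e he r mm hle hat U V hU hV hfac

end SparsePins

/-! ### §12b the rate in `n`: standard blocks of size `≥ s`, `k = ⌊n/s⌋`, and `T c n < r` eventually -/

section SparseRate

/-- the standard block assignment `x ↦ min(⌊x/s⌋, ⌊n/s⌋ − 1)` (the last block absorbs the remainder). -/
def βstd {n s : ℕ} (hs : 0 < s) (hns : s ≤ n) : Fin n → Fin (n / s) := fun x =>
  ⟨min (x.val / s) (n / s - 1), by
    have : 1 ≤ n / s := (Nat.le_div_iff_mul_le hs).mpr (by simpa using hns)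
    omega⟩

/-- representatives `i ↦ i·s`. -/
def σstd {n s : ℕ} (hs : 0 < s) (hns : s ≤ n) : Fin (n / s) → Fin n := fun i =>
  ⟨i.val * s, by
    have h1 : (i.val + 1) * s ≤ n / s * s := Nat.mul_le_mul_right s (Nat.succ_le_of_lt i.isLt)
    have h2 : n / s * s ≤ n := Nat.div_mul_le_self n s
    have _ := hns
    nlinarith⟩

theorem βstd_σstd {n s : ℕ} (hs : 0 < s) (hns : s ≤ n) (i : Fin (n / s)) : βstd hs hns (σstd hs hns i) = i := by
  apply Fin.ext
  show min (i.val * s / s) (n / s - 1) = i.val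
  rw [Nat.mul_div_cancel _ hs]
  have := i.isLt
  omega

/-- every standard block has at least `s` elements. -/
theorem le_bsize_βstd {n s : ℕ} (hs : 0 < s) (hns : s ≤ n) (i : Fin (n / s)) : s ≤ bsize (βstd hs hns) i := by
  classical
  have hi := i.isLt
  have hbound : ∀ j : Fin s, i.val * s + j.val < n := by
    intro j
    have h1 : (i.val + 1) * s ≤ n / s * s := Nat.mul_le_mul_right s (Nat.succ_le_of_lt hi)
    have h2 : n / s * s ≤ n := Nat.div_mul_le_self n s
    have h3 := j.isLt
    nlinarith
  let emb : Fin s → Fin n := fun j => ⟨i.val * s + j.val, hbound j⟩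
  have hemb : Function.Injective emb := by
    intro j j' h
    have : i.val * s + j.val = i.val * s + j'.val := congrArg Fin.val h
    exact Fin.ext (by omega)
  have hβ : ∀ j : Fin s, βstd hs hns (emb j) = i := by
    intro j
    apply Fin.ext
    show min ((i.val * s + j.val) / s) (n / s - 1) = i.val
    have : (i.val * s + j.val) / s = i.val := by
      rw [add_comm, Nat.add_mul_div_right _ _ hs, Nat.div_eq_of_lt j.isLt, zero_add]
    rw [this]
    omega
  have hsub : (Finset.univ : Finset (Fin s)).image emb ⊆ Finset.univ.filter (fun y => βstd hs hns y = i) := by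
    intro y hy
    obtain ⟨j, -, rfl⟩ := Finset.mem_image.mp hy
    exact Finset.mem_filter.mpr ⟨Finset.mem_univ _, hβ j⟩
  have hcard : ((Finset.univ : Finset (Fin s)).image emb).card = s := by
    rw [Finset.card_image_of_injective _ hemb, Finset.card_univ, Fintype.card_fin]
  unfold bsize
  calc s = ((Finset.univ : Finset (Fin s)).image emb).card := hcard.symm
    _ ≤ _ := Finset.card_le_card hsub

/-- RATE: `3^{⌊n/s⌋} ≤ (r+1)·2^{⌊n/s⌋} ⟹ T c n < r`, eventually in `n` (for fixed `s ≥ 1`). -/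
theorem T_lt_of_block_div (s : ℕ) (hs : 0 < s) (c : ℕ) :
    ∃ n₀ : ℕ, ∀ n ≥ n₀, ∀ r : ℕ, 3 ^ (n / s) ≤ (r + 1) * 2 ^ (n / s) → T c n < r := by
  have hc₀ : (0 : ℝ) < 1 / (5 * s) := by
    have : (0 : ℝ) < s := by exact_mod_cast hs
    positivity
  obtain ⟨t₁, ht₁⟩ := four_T_lt_two_pow c hc₀
  refine ⟨max t₁ (2 * s), fun n hn r hr => ?_⟩
  have hn2 : 2 * s ≤ n := le_of_max_le_right hn
  have hq : 2 ≤ n / s := (Nat.le_div_iff_mul_le hs).mpr (by linarith)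
  have hdiv : n ≤ 5 * s * (n / s / 2) := by
    have h1 : n < n / s * s + s := Nat.lt_div_mul_add hs
    have h2 : n / s ≤ 2 * (n / s / 2) + 1 := by omega
    have hp : 1 ≤ n / s / 2 := by omega
    have h3 : n / s * s ≤ (2 * (n / s / 2) + 1) * s := Nat.mul_le_mul_right s h2
    have h4 : s ≤ (n / s / 2) * s := Nat.le_mul_of_pos_left s hp
    nlinarith
  have hreal : (1 / (5 * s) : ℝ) * n ≤ ((n / s / 2 : ℕ) : ℝ) := by
    have hs' : (0 : ℝ) < s := by exact_mod_cast hs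
    have : (n : ℝ) ≤ 5 * s * ((n / s / 2 : ℕ) : ℝ) := by exact_mod_cast hdiv
    rw [div_mul_eq_mul_div, one_mul, div_le_iff₀ (by positivity)]
    linarith
  have h4 := ht₁ n (le_of_max_le_left hn) (n / s / 2) hreal
  have hpow : 2 ^ (n / s / 2) * 2 ^ (n / s) ≤ (r + 1) * 2 ^ (n / s) := (two_pow_half_mul_le (n / s)).trans hr
  have hle : 2 ^ (n / s / 2) ≤ r + 1 := Nat.le_of_mul_le_mul_right hpow (Nat.pos_of_ne_zero (by positivity))
  show 2 ^ ((Nat.log 2 n + c) ^ c) < r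
  have hT' : (1 : ℕ) ≤ 2 ^ ((Nat.log 2 n + c) ^ c) := Nat.one_le_two_pow
  omega

/-- ★★★ **EVERY SPARSE-GENERATOR CUBE IS DECIDED AT THE TOP LAW**, eventually in `n`, for any fixed column-support bound `s`. -/
theorem cor_add_sparseCube_decided (s c : ℕ) (hs : 0 < s) : ∃ n₀ : ℕ, ∀ n ≥ n₀, ∀ (N : ℕ) (Q₀ : Matrix (Fin n) (Fin n) ℝ)
    (G : Fin N → Matrix (Fin n) (Fin n) ℝ) (Vs : Fin N → Finset (Fin n)),
    (∀ t x y, G t x y ≠ 0 → y ∈ Vs t) → (∀ t, (Vs t).card < s) → ∀ r : ℕ,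
    HasEFOfSize (corPolytope n + convexHull ℝ (Set.range (cubePt Q₀ G))) r → T c n < r := by
  obtain ⟨n₀, hn₀⟩ := T_lt_of_block_div s hs c
  refine ⟨max n₀ s, fun n hn N Q₀ G Vs hG hVs r hEF => hn₀ n (le_of_max_le_left hn) r ?_⟩
  have hns : s ≤ n := le_of_max_le_right hn
  exact cor_add_sparseCube_bound (βstd_σstd hs hns) Q₀ G Vs hG (fun t i => lt_of_lt_of_le (hVs t) (le_bsize_βstd hs hns i)) r hEF

/-- ★ UNIFORM RATE (the window closed from above, R334 (2)): `2·(log₂ n + c)^c + 6 ≤ k ⟹ (T c n + 1)·2^k < 3^k`, for EVERY `n`. -/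
theorem T_succ_mul_two_pow_lt (c n k : ℕ) (hk : 2 * (Nat.log 2 n + c) ^ c + 6 ≤ k) : (T c n + 1) * 2 ^ k < 3 ^ k := by
  obtain ⟨j, rfl⟩ := Nat.exists_eq_add_of_le hk
  have hM : ∀ M : ℕ, (2 ^ M + 1) * 2 ^ (2 * M + 6) < 3 ^ (2 * M + 6) := by
    intro M
    have h8 : (8 : ℕ) ^ M ≤ 9 ^ M := Nat.pow_le_pow_left (by norm_num) M
    have h4 : (4 : ℕ) ^ M ≤ 9 ^ M := Nat.pow_le_pow_left (by norm_num) M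
    have e2 : (2 : ℕ) ^ (2 * M + 6) = 64 * 4 ^ M := by rw [pow_add, pow_mul]; norm_num; ring
    have e3 : (3 : ℕ) ^ (2 * M + 6) = 729 * 9 ^ M := by rw [pow_add, pow_mul]; norm_num; ring
    have e8 : (2 : ℕ) ^ M * 4 ^ M = 8 ^ M := by rw [← mul_pow]; norm_num
    have h9 : 0 < (9 : ℕ) ^ M := by positivity
    rw [e2, e3]
    calc (2 ^ M + 1) * (64 * 4 ^ M) = 64 * (2 ^ M * 4 ^ M) + 64 * 4 ^ M := by ring
      _ = 64 * 8 ^ M + 64 * 4 ^ M := by rw [e8]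
      _ ≤ 64 * 9 ^ M + 64 * 9 ^ M := add_le_add (Nat.mul_le_mul_left _ h8) (Nat.mul_le_mul_left _ h4)
      _ < 729 * 9 ^ M := by linarith
  have h1 := hM ((Nat.log 2 n + c) ^ c)
  have h3 : (2 : ℕ) ^ j ≤ 3 ^ j := Nat.pow_le_pow_left (by norm_num) j
  show (2 ^ ((Nat.log 2 n + c) ^ c) + 1) * 2 ^ (2 * (Nat.log 2 n + c) ^ c + 6 + j) < 3 ^ (2 * (Nat.log 2 n + c) ^ c + 6 + j)
  rw [pow_add, pow_add (3 : ℕ), ← mul_assoc]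
  calc (2 ^ ((Nat.log 2 n + c) ^ c) + 1) * 2 ^ (2 * (Nat.log 2 n + c) ^ c + 6) * 2 ^ j
      < 3 ^ (2 * (Nat.log 2 n + c) ^ c + 6) * 2 ^ j := Nat.mul_lt_mul_of_pos_right h1 (Nat.two_pow_pos j)
    _ ≤ 3 ^ (2 * (Nat.log 2 n + c) ^ c + 6) * 3 ^ j := Nat.mul_le_mul_left _ h3

/-- ★ uniform conversion: a `3^k ≤ (r+1)·2^k` block with `k ≥ 2(log₂ n + c)^c + 6` live blocks gives `T c n < r` — no `n₀`, no fixed `s`. -/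
theorem T_lt_of_block_uniform (c n k r : ℕ) (hk : 2 * (Nat.log 2 n + c) ^ c + 6 ≤ k) (h : 3 ^ k ≤ (r + 1) * 2 ^ k) : T c n < r := by
  have := lt_of_lt_of_le (T_succ_mul_two_pow_lt c n k hk) h
  have := Nat.lt_of_mul_lt_mul_right this
  omega

/-- ★★★ **THE WINDOW CLOSED FROM ABOVE** (R334 (2) prover half; NINE's kernel threshold is `s = n / K(c,n)`, not `O(1)`): for EVERY `n` and
`s ≥ 1` with `s·(2(log₂ n + c)^c + 6) ≤ n`, every affine cube whose generator column supports have size `< s` is decided. -/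
theorem cor_add_sparseCube_decided_window (c n s : ℕ) (hs : 0 < s) (hwin : s * (2 * (Nat.log 2 n + c) ^ c + 6) ≤ n)
    {N : ℕ} (Q₀ : Matrix (Fin n) (Fin n) ℝ) (G : Fin N → Matrix (Fin n) (Fin n) ℝ) (Vs : Fin N → Finset (Fin n))
    (hG : ∀ t x y, G t x y ≠ 0 → y ∈ Vs t) (hVs : ∀ t, (Vs t).card < s) (r : ℕ)
    (hEF : HasEFOfSize (corPolytope n + convexHull ℝ (Set.range (cubePt Q₀ G))) r) : T c n < r := by
  have hns : s ≤ n := le_trans (Nat.le_mul_of_pos_right s (by omega)) hwin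
  have hk : 2 * (Nat.log 2 n + c) ^ c + 6 ≤ n / s := (Nat.le_div_iff_mul_le hs).mpr (by rw [mul_comm]; exact hwin)
  exact T_lt_of_block_uniform c n (n / s) r hk (cor_add_sparseCube_bound (βstd_σstd hs hns) Q₀ G Vs hG
    (fun t i => lt_of_lt_of_le (hVs t) (le_bsize_βstd hs hns i)) r hEF)

end SparseRate

/-! ### §12c FORCED-OUT SETS (dead blocks `D`, `Z := β⁻¹(D)`; memo §2g): live face, dead readers, engine (law-body + top law), EDGE-form genericity -/

section DeadBlocks

variable {n k : ℕ}

/-- directions vanishing on the live part of the together face. -/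
def faceZeroD (β : Fin n → Fin k) (D : Finset (Fin k)) (V : Matrix (Fin n) (Fin n) ℝ) : Prop :=
  ∀ S : Finset (Fin k), Disjoint S D → flat V ⬝ᵥ udPt (bUn β S) = 0

theorem faceZeroD_zero (β : Fin n → Fin k) (D : Finset (Fin k)) : faceZeroD β D 0 := fun S _ => by
  rw [flat_zero'', zero_dotProduct]

theorem faceZeroD_add {β : Fin n → Fin k} {D : Finset (Fin k)} {V V' : Matrix (Fin n) (Fin n) ℝ}
    (h : faceZeroD β D V) (h' : faceZeroD β D V') : faceZeroD β D (V + V') := fun S hS => by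
  rw [flat_add'', add_dotProduct, h S hS, h' S hS, add_zero]

theorem faceZeroD_smul {β : Fin n → Fin k} {D : Finset (Fin k)} {V : Matrix (Fin n) (Fin n) ℝ} (c : ℝ)
    (h : faceZeroD β D V) : faceZeroD β D (c • V) := fun S hS => by
  rw [flat_smul'', smul_dotProduct, h S hS, smul_zero]

theorem faceZero.toD {β : Fin n → Fin k} (D : Finset (Fin k)) {V : Matrix (Fin n) (Fin n) ℝ} (h : faceZero β V) :
    faceZeroD β D V := fun S _ => h S

/-- the single-entry matrix `E_{xy}`. -/
def Es (x y : Fin n) : Matrix (Fin n) (Fin n) ℝ := fun p q => if p = x then (if q = y then (1 : ℝ) else 0) else 0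

theorem flat_Es_dotProduct_flat (x y : Fin n) (g : Matrix (Fin n) (Fin n) ℝ) : flat (Es x y) ⬝ᵥ flat g = g x y := by
  classical
  rw [flat_dotProduct_flat]
  have h : ∀ p, ∑ q, Es x y p q * g p q = if p = x then g x y else 0 := by
    intro p
    unfold Es
    by_cases hp : p = x
    · subst hp
      simp only [if_true, ite_mul, one_mul, zero_mul, Finset.sum_ite_eq', Finset.mem_univ]
    · simp [hp]
  rw [Finset.sum_congr rfl fun p _ => h p, Finset.sum_ite_eq' Finset.univ x, if_pos (Finset.mem_univ x)]

theorem flat_Es_dotProduct_udPt (x y : Fin n) (b : Finset (Fin n)) :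
    flat (Es x y) ⬝ᵥ udPt b = if x ∈ b then (if y ∈ b then (1 : ℝ) else 0) else 0 := by
  classical
  rw [flat_dotProduct_udPt_sum]
  have h : ∀ p ∈ b, ∑ q ∈ b, Es x y p q = if p = x then (if y ∈ b then (1 : ℝ) else 0) else 0 := by
    intro p _
    unfold Es
    by_cases hp : p = x
    · subst hp
      simp only [if_true, Finset.sum_ite_eq']
    · simp [hp]
  rw [Finset.sum_congr rfl h, Finset.sum_ite_eq' b x]

/-- ★ NEW READERS: an entry with a dead row or a dead column is face-zero for the live face. -/
theorem Es_faceZeroD (β : Fin n → Fin k) (D : Finset (Fin k)) {x y : Fin n} (hdead : β x ∈ D ∨ β y ∈ D) :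
    faceZeroD β D (Es x y) := by
  intro S hS
  rw [flat_Es_dotProduct_udPt]
  have key : ∀ z : Fin n, β z ∈ D → z ∉ bUn β S := fun z hz hzS =>
    Finset.disjoint_left.mp hS ((mem_bUn β S z).mp hzS) hz
  rcases hdead with hx | hy
  · rw [if_neg (key x hx)]
  · by_cases hxb : x ∈ bUn β S
    · rw [if_pos hxb, if_neg (key y hy)]
    · rw [if_neg hxb]

/-- the dead diagonal `I_Z`, `Z = β⁻¹(D)`. -/
def diagD (β : Fin n → Fin k) (D : Finset (Fin k)) : Matrix (Fin n) (Fin n) ℝ :=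
  Matrix.diagonal (fun z => if β z ∈ D then (1 : ℝ) else 0)

theorem diagD_dotProduct_udPt (β : Fin n → Fin k) (D : Finset (Fin k)) (b : Finset (Fin n)) :
    flat (diagD β D) ⬝ᵥ udPt b = ((b.filter (fun z => β z ∈ D)).card : ℝ) := by
  classical
  unfold diagD
  rw [(ud_data n).2.2.2, Finset.sum_boole]

/-- the exposing direction of the live face: `W^β − I_Z`. -/
def WD (β : Fin n → Fin k) (D : Finset (Fin k)) : Matrix (Fin n) (Fin n) ℝ := Wtog β - diagD β D

theorem WD_dotProduct_udPt (β : Fin n → Fin k) (D : Finset (Fin k)) (b : Finset (Fin n)) :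
    flat (WD β D) ⬝ᵥ udPt b = flat (Wtog β) ⬝ᵥ udPt b - ((b.filter (fun z => β z ∈ D)).card : ℝ) := by
  unfold WD
  rw [flat_sub'', sub_dotProduct, diagD_dotProduct_udPt]

theorem WD_dotProduct_bUn (β : Fin n → Fin k) {D S : Finset (Fin k)} (hS : Disjoint S D) :
    flat (WD β D) ⬝ᵥ udPt (bUn β S) = 0 := by
  classical
  rw [WD_dotProduct_udPt, Wtog_dotProduct_bUn]
  have : (bUn β S).filter (fun z => β z ∈ D) = ∅ := by
    apply Finset.filter_false_of_mem
    intro z hz hzD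
    exact Finset.disjoint_left.mp hS ((mem_bUn β S z).mp hz) hzD
  rw [this, Finset.card_empty, Nat.cast_zero, sub_zero]

theorem WD_dotProduct_udPt_le (β : Fin n → Fin k) (D : Finset (Fin k)) (b : Finset (Fin n)) :
    flat (WD β D) ⬝ᵥ udPt b ≤ 0 := by
  rw [WD_dotProduct_udPt]
  have h1 := Wtog_dotProduct_udPt_le β b
  have h2 : (0 : ℝ) ≤ ((b.filter (fun z => β z ∈ D)).card : ℝ) := Nat.cast_nonneg _
  linarith

/-- ON/OFF the live face: either `b` is a live union of blocks, or `W^β − I_Z` reads `≤ −1`. -/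
theorem WD_face_or_le_neg_one (β : Fin n → Fin k) (D : Finset (Fin k)) (b : Finset (Fin n)) :
    (∃ S, Disjoint S D ∧ b = bUn β S) ∨ flat (WD β D) ⬝ᵥ udPt b ≤ -1 := by
  classical
  by_cases hb : ∀ x y, β x = β y → x ∈ b → y ∈ b
  · by_cases hD : Disjoint (b.image β) D
    · exact Or.inl ⟨b.image β, hD, eq_bUn_image β hb⟩
    · right
      obtain ⟨i, hiS, hiD⟩ := Finset.not_disjoint_iff.mp hD
      obtain ⟨x, hxb, rfl⟩ := Finset.mem_image.mp hiS
      have hcard : 1 ≤ (b.filter (fun z => β z ∈ D)).card :=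
        Finset.card_pos.mpr ⟨x, Finset.mem_filter.mpr ⟨hxb, hiD⟩⟩
      have hcard' : (1 : ℝ) ≤ ((b.filter (fun z => β z ∈ D)).card : ℝ) := by exact_mod_cast hcard
      rw [WD_dotProduct_udPt]
      have h1 := Wtog_dotProduct_udPt_le β b
      linarith
  · right
    push Not at hb
    obtain ⟨x, y, hβ, hx, hy⟩ := hb
    rw [WD_dotProduct_udPt]
    have h1 : flat (Wtog β) ⬝ᵥ udPt b ≤ -1 := Wtog_dotProduct_udPt_le_neg_one β hx hy hβ
    have h2 : (0 : ℝ) ≤ ((b.filter (fun z => β z ∈ D)).card : ℝ) := Nat.cast_nonneg _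
    linarith

/-- ★★ **MECHANISM α's ENGINE in the LITERAL LAW-BODY CURRENCY of `exactTilted`** (maxima `mm`, a nonnegative factorization of the augmented
slack of `COR + Q` through `r + 1` slots): a tilt tight on the live face + ONE point maximising every located row ⇒ `3^{k−|D|} ≤ (r+1)·2^{k−|D|}`. -/
theorem lawBody_bound_of_commonMaxD {β : Fin n → Fin k} {σ : Fin k → Fin n} (hβσ : ∀ i, β (σ i) = i) (D : Finset (Fin k))
    {ι : Type*} (q : ι → (Fin (n * n) → ℝ)) (W : Matrix (Fin n) (Fin n) ℝ)
    (htight : ∀ S : Finset (Fin k), Disjoint S D → flat W ⬝ᵥ udPt (bUn β S) = hCOR W) (jstar : ι)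
    (hmax : ∀ (a : Finset (Fin n)) (j : ι), (udRow a + flat W) ⬝ᵥ q j ≤ (udRow a + flat W) ⬝ᵥ q jstar) (r : ℕ)
    (mm : exactTilted.A n → ℝ) (hle : ∀ a j, exactTilted.ρ n a ⬝ᵥ q j ≤ mm a) (hat : ∀ a, ∃ j, exactTilted.ρ n a ⬝ᵥ q j = mm a)
    (U : exactTilted.A n → Option (Fin r) → ℝ) (V : Finset (Fin n) × ι → Option (Fin r) → ℝ)
    (hU : ∀ a i, 0 ≤ U a i) (hV : ∀ p i, 0 ≤ V p i)
    (hfac : ∀ a b j, (exactTilted.β n a + mm a) - exactTilted.ρ n a ⬝ᵥ (udPt b + q j) = ∑ i, U a i * V (b, j) i) :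
    3 ^ (k - D.card) ≤ (r + 1) * 2 ^ (k - D.card) := by
  classical
  let emb : {i : Fin k // i ∉ D} ↪ Fin k := Function.Embedding.subtype _
  let row : Finset {i : Fin k // i ∉ D} → exactTilted.A n := fun α' => ((α'.map emb).image σ, W)
  let col : Finset {i : Fin k // i ∉ D} → Finset (Fin n) × ι := fun S => (bUn β (S.map emb), jstar)
  have hdisj : ∀ S : Finset {i : Fin k // i ∉ D}, Disjoint (S.map emb) D := by
    intro S
    rw [Finset.disjoint_left]
    rintro i hi
    obtain ⟨i', -, rfl⟩ := Finset.mem_map.mp hi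
    exact i'.property
  have hmm : ∀ α', mm (row α') = (udRow ((α'.map emb).image σ) + flat W) ⬝ᵥ q jstar := by
    intro α'
    obtain ⟨j₀, hj₀⟩ := hat (row α')
    have h1 := hle (row α') jstar
    have h2 : exactTilted.ρ n (row α') ⬝ᵥ q j₀ ≤ (udRow ((α'.map emb).image σ) + flat W) ⬝ᵥ q jstar := hmax _ j₀
    rw [hj₀] at h2
    exact le_antisymm h2 h1
  have key := three_pow_le_of_block (ι := Option (Fin r)) U (fun p => V (p.1, p.2)) hU (fun p i => hV _ i) row col ?_
  · have hc : Fintype.card {i : Fin k // i ∉ D} = k - D.card := by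
      rw [Fintype.card_subtype]
      have : (Finset.univ.filter (fun i : Fin k => i ∉ D)) = Finset.univ \ D := by
        ext i; simp
      rw [this, Finset.card_univ_sdiff, Fintype.card_fin]
    rw [hc] at key
    simpa [Fintype.card_option, Fintype.card_fin] using key
  · intro α' S
    show ∑ i, U (row α') i * V (bUn β (S.map emb), jstar) i = _
    rw [← hfac (row α') (bUn β (S.map emb)) jstar, hmm α']
    show ((1 + hCOR W) + (udRow ((α'.map emb).image σ) + flat W) ⬝ᵥ q jstar) -
        (udRow ((α'.map emb).image σ) + flat W) ⬝ᵥ (udPt (bUn β (S.map emb)) + q jstar) = (1 - ((α' ∩ S).card : ℝ)) ^ 2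
    rw [dotProduct_add, add_dotProduct _ _ (udPt (bUn β (S.map emb))), htight _ (hdisj S), ← Finset.card_map emb,
      Finset.map_inter, ← ud_block_tog hβσ (α'.map emb) (S.map emb)]
    ring

/-- ★★ **MECHANISM α's ENGINE with dead blocks, TOP LAW** (budget-free, any passenger): Yannakakis once, then `lawBody_bound_of_commonMaxD`. -/
theorem cor_add_bound_of_commonMaxD {β : Fin n → Fin k} {σ : Fin k → Fin n} (hβσ : ∀ i, β (σ i) = i) (D : Finset (Fin k))
    {ι : Type*} [Fintype ι] (q : ι → (Fin (n * n) → ℝ)) (W : Matrix (Fin n) (Fin n) ℝ)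
    (htight : ∀ S : Finset (Fin k), Disjoint S D → flat W ⬝ᵥ udPt (bUn β S) = hCOR W) (jstar : ι)
    (hmax : ∀ (a : Finset (Fin n)) (j : ι), (udRow a + flat W) ⬝ᵥ q j ≤ (udRow a + flat W) ⬝ᵥ q jstar) (r : ℕ)
    (hEF : HasEFOfSize (corPolytope n + convexHull ℝ (Set.range q)) r) :
    3 ^ (k - D.card) ≤ (r + 1) * 2 ^ (k - D.card) := by
  classical
  obtain ⟨pt_mem, -, -, -⟩ := ud_data n
  have hne : (Finset.univ : Finset ι).Nonempty := ⟨jstar, Finset.mem_univ _⟩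
  let mm : exactTilted.A n → ℝ := fun a => Finset.univ.sup' hne (fun j : ι => exactTilted.ρ n a ⬝ᵥ q j)
  have hle : ∀ a j, exactTilted.ρ n a ⬝ᵥ q j ≤ mm a := fun a j =>
    Finset.le_sup' (fun j : ι => exactTilted.ρ n a ⬝ᵥ q j) (Finset.mem_univ j)
  have hat : ∀ a, ∃ j, exactTilted.ρ n a ⬝ᵥ q j = mm a := fun a => by
    obtain ⟨j₀, -, hj₀⟩ := Finset.exists_mem_eq_sup' hne (fun j : ι => exactTilted.ρ n a ⬝ᵥ q j)
    exact ⟨j₀, hj₀.symm⟩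
  have hm : ∀ a, ∀ y ∈ convexHull ℝ (Set.range q), exactTilted.ρ n a ⬝ᵥ y ≤ mm a := fun a =>
    dot_le_of_mem_convexHull _ _ _ (by rintro _ ⟨j, rfl⟩; exact hle a j)
  have hq : ∀ j : ι, q j ∈ convexHull ℝ (Set.range q) := fun j => subset_convexHull ℝ _ ⟨j, rfl⟩
  have hv : ∀ p : Finset (Fin n) × ι, udPt p.1 + q p.2 ∈ corPolytope n + convexHull ℝ (Set.range q) :=
    fun p => Set.add_mem_add (pt_mem p.1) (hq p.2)
  have hvalid : ∀ a, ∀ x ∈ corPolytope n + convexHull ℝ (Set.range q), exactTilted.ρ n a ⬝ᵥ x ≤ exactTilted.β n a + mm a := by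
    rintro a x ⟨p, hp, y, hy, rfl⟩
    rw [dotProduct_add]
    exact add_le_add (exactTilted.valid n a p hp) (hm a y hy)
  obtain ⟨U, V, hU, hV, hfac⟩ := Literature.Barriers.PneNP.HasEFOfSize.exists_nonneg_factorization hEF
    (fun p : Finset (Fin n) × ι => udPt p.1 + q p.2) hv (exactTilted.ρ n) (fun a => exactTilted.β n a + mm a) hvalid
  exact lawBody_bound_of_commonMaxD hβσ D q W htight jstar hmax r mm hle hat U V hU hV (fun a b j => hfac a (b, j))

/-- ★ the WITNESS with dead blocks: nonzero entries in dead columns or in a live column set smaller than every live block ⇒ read. -/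
theorem exists_witnessD (β : Fin n → Fin k) (D : Finset (Fin k)) (g : Matrix (Fin n) (Fin n) ℝ) (hg : g ≠ 0)
    (Vs : Finset (Fin n)) (hVs : ∀ x y, g x y ≠ 0 → β y ∈ D ∨ y ∈ Vs) (hs : ∀ i, i ∉ D → Vs.card < bsize β i) :
    ∃ U, faceZeroD β D U ∧ flat U ⬝ᵥ flat g ≠ 0 := by
  classical
  obtain ⟨x, y, hxy⟩ : ∃ x y, g x y ≠ 0 := by
    by_contra h
    push Not at h
    exact hg (Matrix.ext fun x y => by rw [h x y]; rfl)
  by_cases hyD : β y ∈ D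
  · exact ⟨Es x y, Es_faceZeroD β D (Or.inr hyD), by rw [flat_Es_dotProduct_flat]; exact hxy⟩
  · have hyV : y ∈ Vs := (hVs x y hxy).resolve_left hyD
    obtain ⟨y', hy'A, hy'V⟩ : ∃ y' ∈ Finset.univ.filter (fun z => β z = β y), y' ∉ Vs := by
      by_contra h
      push Not at h
      exact absurd (Finset.card_le_card (fun z hz => h z hz)) (not_le.mpr (hs (β y) hyD))
    have hβ : β y' = β y := (Finset.mem_filter.mp hy'A).2
    have h0 : g x y' = 0 := by
      by_contra h
      rcases hVs x y' h with h1 | h1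
      · exact hyD (hβ ▸ h1)
      · exact hy'V h1
    refine ⟨Ed x y y', (Ed_faceZero β hβ.symm).toD D, ?_⟩
    rw [flat_Ed_dotProduct_flat, h0, sub_zero]
    exact hxy

/-- ★★★ **GENERICITY, EDGE FORM with dead blocks = CLAIM α in kernel** (memo §2g): neighbour structure `N` + CONE CERTIFICATE + every nonzero
EDGE direction read by a live-face-zero direction ⇒ a tilt tight on the live face and ONE point maximising EVERY located row. -/
theorem exists_commonMax_of_edgesReadD (β : Fin n → Fin k) (D : Finset (Fin k)) {ι : Type*} [Fintype ι] [Nonempty ι]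
    (Qm : ι → Matrix (Fin n) (Fin n) ℝ) (N : ι → Finset ι)
    (hcone : ∀ j j', ∃ c : ι → ℝ, (∀ e, 0 ≤ c e) ∧ flat (Qm j') - flat (Qm j) = ∑ e ∈ N j, c e • (flat (Qm e) - flat (Qm j)))
    (hw : ∀ j, ∀ e ∈ N j, Qm e ≠ Qm j → ∃ U, faceZeroD β D U ∧ flat U ⬝ᵥ flat (Qm e - Qm j) ≠ 0) :
    ∃ W : Matrix (Fin n) (Fin n) ℝ, ∃ jstar : ι, (∀ S, Disjoint S D → flat W ⬝ᵥ udPt (bUn β S) = hCOR W) ∧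
      ∀ (a : Finset (Fin n)) (j : ι), (udRow a + flat W) ⬝ᵥ flat (Qm j) ≤ (udRow a + flat W) ⬝ᵥ flat (Qm jstar) := by
  classical
  let e := Fintype.equivFin (ι × ι)
  let G : Fin (Fintype.card (ι × ι)) → Matrix (Fin n) (Fin n) ℝ := fun t =>
    if (e.symm t).1 ∈ N (e.symm t).2 then Qm (e.symm t).1 - Qm (e.symm t).2 else 0
  have hwG : ∀ t, G t ≠ 0 → ∃ U, faceZeroD β D U ∧ flat U ⬝ᵥ flat (G t) ≠ 0 := by
    intro t ht
    by_cases hN : (e.symm t).1 ∈ N (e.symm t).2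
    · have hG : G t = Qm (e.symm t).1 - Qm (e.symm t).2 := if_pos hN
      rw [hG] at ht ⊢
      exact hw _ _ hN (fun h => ht (by rw [h, sub_self]))
    · exact absurd (if_neg hN : G t = 0) ht
  obtain ⟨V, hV, hVr⟩ := exists_reads_ne_of_closed (faceZeroD β D) (faceZeroD_zero β D) (fun _ _ h h' => faceZeroD_add h h')
    (fun c _ h => faceZeroD_smul c h) G hwG Finset.univ
  have hVread : ∀ j', ∀ j ∈ N j', Qm j ≠ Qm j' → flat V ⬝ᵥ flat (Qm j) ≠ flat V ⬝ᵥ flat (Qm j') := by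
    intro j' j hjN hne h
    have hG : G (e (j, j')) = Qm j - Qm j' := by
      show (if (e.symm (e (j, j'))).1 ∈ N (e.symm (e (j, j'))).2 then _ else _) = _
      rw [Equiv.symm_apply_apply, if_pos hjN]
    have h1 := hVr (e (j, j')) (Finset.mem_univ _) (by rw [hG]; exact sub_ne_zero.mpr hne)
    apply h1
    rw [hG, flat_sub'', dotProduct_sub, h, sub_self]
  let w : ι → ℝ := fun j => flat (WD β D) ⬝ᵥ flat (Qm j)
  let v : ι → ℝ := fun j => flat V ⬝ᵥ flat (Qm j)
  let wmax : ℝ := Finset.univ.sup' Finset.univ_nonempty w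
  have hwle : ∀ j, w j ≤ wmax := fun j => Finset.le_sup' w (Finset.mem_univ j)
  let Jw : Finset ι := Finset.univ.filter (fun j => w j = wmax)
  have hJw : Jw.Nonempty := by
    obtain ⟨j, -, hj⟩ := Finset.exists_mem_eq_sup' Finset.univ_nonempty w
    exact ⟨j, Finset.mem_filter.mpr ⟨Finset.mem_univ _, hj.symm⟩⟩
  obtain ⟨jstar, hjJ, hjmax⟩ := Finset.exists_max_image Jw v hJw
  have hwstar : w jstar = wmax := (Finset.mem_filter.mp hjJ).2
  let C : ℝ := ∑ j, ∑ x, ∑ y, |Qm j x y|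
  have hCj : ∀ j (a : Finset (Fin n)), |udRow a ⬝ᵥ flat (Qm j)| ≤ C := fun j a =>
    (abs_udRow_dotProduct_flat_le a (Qm j)).trans
      (Finset.single_le_sum (f := fun j => ∑ x, ∑ y, |Qm j x y|)
        (fun j _ => Finset.sum_nonneg fun x _ => Finset.sum_nonneg fun y _ => abs_nonneg _) (Finset.mem_univ j))
  have hC0 : 0 ≤ C := (abs_nonneg _).trans (hCj (Classical.arbitrary ι) ∅)
  let lam : ℝ := 1 + ∑ j, (if v j = v jstar then 0 else (2 * C + 1) / |v jstar - v j|)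
  have hlam_term : ∀ j, 0 ≤ (if v j = v jstar then 0 else (2 * C + 1) / |v jstar - v j|) := fun j => by
    split_ifs
    · exact le_refl _
    · exact div_nonneg (by linarith) (abs_nonneg _)
  have hlam1 : 1 ≤ lam := by
    have := Finset.sum_nonneg fun j (_ : j ∈ Finset.univ) => hlam_term j
    show 1 ≤ 1 + _
    linarith
  have hlam_ge : ∀ j, v j ≠ v jstar → (2 * C + 1) / |v jstar - v j| ≤ lam := by
    intro j hj
    have h1 := Finset.single_le_sum (f := fun j => if v j = v jstar then 0 else (2 * C + 1) / |v jstar - v j|)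
      (fun j _ => hlam_term j) (Finset.mem_univ j)
    simp only [if_neg hj] at h1
    show _ ≤ 1 + _
    linarith
  let V₁ : Matrix (Fin n) (Fin n) ℝ := lam • V
  have hV₁ : faceZeroD β D V₁ := faceZeroD_smul lam hV
  let v₁ : ι → ℝ := fun j => flat V₁ ⬝ᵥ flat (Qm j)
  have hv₁ : ∀ j, v₁ j = lam * v j := fun j => by
    show flat (lam • V) ⬝ᵥ flat (Qm j) = lam * (flat V ⬝ᵥ flat (Qm j))
    rw [flat_smul'', smul_dotProduct, smul_eq_mul]
  have hgap_v : ∀ j ∈ N jstar, w j = wmax → Qm j ≠ Qm jstar → 2 * C + 1 ≤ v₁ jstar - v₁ j := by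
    intro j hjN hj hne
    have hvne : v j ≠ v jstar := hVread jstar j hjN hne
    have hvle : v j ≤ v jstar := hjmax j (Finset.mem_filter.mpr ⟨Finset.mem_univ _, hj⟩)
    have hpos : 0 < v jstar - v j := sub_pos.mpr (lt_of_le_of_ne hvle hvne)
    have h1 : (2 * C + 1) / |v jstar - v j| * |v jstar - v j| ≤ lam * |v jstar - v j| :=
      mul_le_mul_of_nonneg_right (hlam_ge j hvne) (abs_nonneg _)
    rw [div_mul_cancel₀ _ (ne_of_gt (abs_pos.mpr (ne_of_gt hpos))), abs_of_pos hpos] at h1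
    rw [hv₁, hv₁, ← mul_sub]
    exact h1
  let Bv : ℝ := ∑ j, |v₁ j|
  have hBv : ∀ j, |v₁ j| ≤ Bv := fun j =>
    Finset.single_le_sum (f := fun j => |v₁ j|) (fun j _ => abs_nonneg _) (Finset.mem_univ j)
  let B : ℝ := ∑ x, ∑ y, |V₁ x y|
  have hB0 : 0 ≤ B := Finset.sum_nonneg fun x _ => Finset.sum_nonneg fun y _ => abs_nonneg _
  let μ : ℝ := 1 + B + ∑ j, (if w j = wmax then 0 else (2 * C + 2 * Bv + 1) / (wmax - w j))
  have hμ_term : ∀ j, 0 ≤ (if w j = wmax then 0 else (2 * C + 2 * Bv + 1) / (wmax - w j)) := fun j => by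
    split_ifs with h
    · exact le_refl _
    · have : 0 ≤ Bv := (abs_nonneg _).trans (hBv j)
      exact div_nonneg (by linarith) (by linarith [hwle j])
  have hμB : 1 + B ≤ μ := by
    have := Finset.sum_nonneg fun j (_ : j ∈ Finset.univ) => hμ_term j
    show 1 + B ≤ 1 + B + _
    linarith
  have hμ0 : 0 ≤ μ := by linarith
  have hgap_w : ∀ j, w j ≠ wmax → 2 * C + 2 * Bv + 1 ≤ μ * (wmax - w j) := by
    intro j hj
    have hpos : 0 < wmax - w j := sub_pos.mpr (lt_of_le_of_ne (hwle j) hj)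
    have h1 := Finset.single_le_sum (f := fun j => if w j = wmax then 0 else (2 * C + 2 * Bv + 1) / (wmax - w j))
      (fun j _ => hμ_term j) (Finset.mem_univ j)
    simp only [if_neg hj] at h1
    have h2 : (2 * C + 2 * Bv + 1) / (wmax - w j) ≤ μ := by show _ ≤ 1 + B + _; linarith
    have h3 := mul_le_mul_of_nonneg_right h2 (le_of_lt hpos)
    rwa [div_mul_cancel₀ _ (ne_of_gt hpos)] at h3
  let W : Matrix (Fin n) (Fin n) ℝ := μ • WD β D + V₁
  have hWread : ∀ b, flat W ⬝ᵥ udPt b = μ * (flat (WD β D) ⬝ᵥ udPt b) + flat V₁ ⬝ᵥ udPt b := fun b => by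
    show flat (μ • WD β D + V₁) ⬝ᵥ udPt b = _
    rw [flat_add'', flat_smul'', add_dotProduct, smul_dotProduct, smul_eq_mul]
  have hWS : ∀ S, Disjoint S D → flat W ⬝ᵥ udPt (bUn β S) = 0 := fun S hS => by
    rw [hWread, WD_dotProduct_bUn β hS, hV₁ S hS, mul_zero, add_zero]
  have hWle : ∀ b, flat W ⬝ᵥ udPt b ≤ 0 := by
    intro b
    rcases WD_face_or_le_neg_one β D b with ⟨S, hS, rfl⟩ | h1
    · rw [hWS S hS]
    · rw [hWread]
      have h2 : flat V₁ ⬝ᵥ udPt b ≤ B := (le_abs_self _).trans (abs_flat_dotProduct_udPt_le V₁ b)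
      have h3 : μ * (flat (WD β D) ⬝ᵥ udPt b) ≤ μ * (-1) := mul_le_mul_of_nonneg_left h1 hμ0
      linarith
  have hCOR_W : hCOR W = 0 :=
    le_antisymm (Finset.sup'_le _ _ fun b _ => hWle b)
      (by have h := le_hCOR W (bUn β ∅); rwa [hWS ∅ (Finset.disjoint_empty_left D)] at h)
  refine ⟨W, jstar, fun S hS => by rw [hWS S hS, hCOR_W], fun a j => ?_⟩
  have hscore : ∀ j, (udRow a + flat W) ⬝ᵥ flat (Qm j) = udRow a ⬝ᵥ flat (Qm j) + (μ * w j + v₁ j) := fun j => by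
    show (udRow a + flat (μ • WD β D + V₁)) ⬝ᵥ flat (Qm j) = _
    rw [add_dotProduct, flat_add'', flat_smul'', add_dotProduct, smul_dotProduct, smul_eq_mul]
  -- the NEIGHBOURS of `jstar` lose against `jstar` on every located row
  have hnb : ∀ j ∈ N jstar, (udRow a + flat W) ⬝ᵥ flat (Qm j) ≤ (udRow a + flat W) ⬝ᵥ flat (Qm jstar) := by
    intro j hjN
    rw [hscore, hscore, hwstar]
    have ha1 := abs_le.mp (hCj j a)
    have ha2 := abs_le.mp (hCj jstar a)
    by_cases hj : w j = wmax
    · rw [hj]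
      by_cases hne : Qm j = Qm jstar
      · have hv : v₁ j = v₁ jstar := by
          show flat V₁ ⬝ᵥ flat (Qm j) = flat V₁ ⬝ᵥ flat (Qm jstar)
          rw [hne]
        rw [hne, hv]
      · have := hgap_v j hjN hj hne
        linarith
    · have h1 := hgap_w j hj
      have h2 := abs_le.mp (hBv j)
      have h3 := abs_le.mp (hBv jstar)
      nlinarith [mul_sub μ wmax (w j)]
  -- every other point is `jstar` plus a nonnegative combination of edge directions at `jstar` (cone certificate)
  obtain ⟨c, hc0, hdec⟩ := hcone jstar j
  have hsub : (udRow a + flat W) ⬝ᵥ flat (Qm j) - (udRow a + flat W) ⬝ᵥ flat (Qm jstar) =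
      ∑ e ∈ N jstar, c e * ((udRow a + flat W) ⬝ᵥ flat (Qm e) - (udRow a + flat W) ⬝ᵥ flat (Qm jstar)) := by
    rw [← dotProduct_sub, hdec, dotProduct_sum]
    refine Finset.sum_congr rfl fun e _ => ?_
    rw [dotProduct_smul, smul_eq_mul, dotProduct_sub]
  have : (udRow a + flat W) ⬝ᵥ flat (Qm j) - (udRow a + flat W) ⬝ᵥ flat (Qm jstar) ≤ 0 := by
    rw [hsub]
    exact Finset.sum_nonpos fun e he => mul_nonpos_of_nonneg_of_nonpos (hc0 e) (by linarith [hnb e he])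
  linarith

/-- ★★ the VERTEX-PAIR form (every pair a neighbour): every nonzero pairwise difference read ⇒ tight `W` + common maximiser. -/
theorem exists_commonMax_of_pairsReadD (β : Fin n → Fin k) (D : Finset (Fin k)) {ι : Type*} [Fintype ι] [Nonempty ι]
    (Qm : ι → Matrix (Fin n) (Fin n) ℝ)
    (hw : ∀ j j', Qm j ≠ Qm j' → ∃ U, faceZeroD β D U ∧ flat U ⬝ᵥ flat (Qm j - Qm j') ≠ 0) :
    ∃ W : Matrix (Fin n) (Fin n) ℝ, ∃ jstar : ι, (∀ S, Disjoint S D → flat W ⬝ᵥ udPt (bUn β S) = hCOR W) ∧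
      ∀ (a : Finset (Fin n)) (j : ι), (udRow a + flat W) ⬝ᵥ flat (Qm j) ≤ (udRow a + flat W) ⬝ᵥ flat (Qm jstar) := by
  classical
  refine exists_commonMax_of_edgesReadD β D Qm (fun _ => Finset.univ) (fun j j' => ⟨fun e => if e = j' then 1 else 0,
    fun e => by dsimp only; split_ifs <;> norm_num, ?_⟩) (fun j e _ hne => hw e j hne)
  have h : ∀ e ∈ (Finset.univ : Finset ι), (fun e => if e = j' then (1 : ℝ) else 0) e • (flat (Qm e) - flat (Qm j)) =
      if e = j' then flat (Qm e) - flat (Qm j) else 0 := fun e _ => by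
    dsimp only
    split_ifs
    · rw [one_smul]
    · rw [zero_smul]
  rw [Finset.sum_congr rfl h, Finset.sum_ite_eq' Finset.univ j', if_pos (Finset.mem_univ _)]

/-- ★★★ **EDGE FORM, DECIDED**: a cone-certified neighbour structure all of whose nonzero edge directions are read by the live face. -/
theorem cor_add_bound_of_edgesReadD {β : Fin n → Fin k} {σ : Fin k → Fin n} (hβσ : ∀ i, β (σ i) = i) (D : Finset (Fin k))
    {ι : Type*} [Fintype ι] [Nonempty ι] (Qm : ι → Matrix (Fin n) (Fin n) ℝ) (N : ι → Finset ι)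
    (hcone : ∀ j j', ∃ c : ι → ℝ, (∀ e, 0 ≤ c e) ∧ flat (Qm j') - flat (Qm j) = ∑ e ∈ N j, c e • (flat (Qm e) - flat (Qm j)))
    (hw : ∀ j, ∀ e ∈ N j, Qm e ≠ Qm j → ∃ U, faceZeroD β D U ∧ flat U ⬝ᵥ flat (Qm e - Qm j) ≠ 0) (r : ℕ)
    (hEF : HasEFOfSize (corPolytope n + convexHull ℝ (Set.range (fun j => flat (Qm j)))) r) :
    3 ^ (k - D.card) ≤ (r + 1) * 2 ^ (k - D.card) := by
  obtain ⟨W, jstar, ht, hmax⟩ := exists_commonMax_of_edgesReadD β D Qm N hcone hw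
  exact cor_add_bound_of_commonMaxD hβσ D (fun j => flat (Qm j)) W ht jstar hmax r hEF

/-- ★★★ **C′ IN ITS LITERAL LAW-BODY CURRENCY** for every cone-certified edge-read passenger (budget-free). -/
theorem exactTilted_lawBody_of_edgesReadD {β : Fin n → Fin k} {σ : Fin k → Fin n} (hβσ : ∀ i, β (σ i) = i) (D : Finset (Fin k))
    {ι : Type*} [Fintype ι] [Nonempty ι] (Qm : ι → Matrix (Fin n) (Fin n) ℝ) (N : ι → Finset ι)
    (hcone : ∀ j j', ∃ c : ι → ℝ, (∀ e, 0 ≤ c e) ∧ flat (Qm j') - flat (Qm j) = ∑ e ∈ N j, c e • (flat (Qm e) - flat (Qm j)))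
    (hw : ∀ j, ∀ e ∈ N j, Qm e ≠ Qm j → ∃ U, faceZeroD β D U ∧ flat U ⬝ᵥ flat (Qm e - Qm j) ≠ 0) (r : ℕ)
    (mm : exactTilted.A n → ℝ) (hle : ∀ a j, exactTilted.ρ n a ⬝ᵥ flat (Qm j) ≤ mm a) (hat : ∀ a, ∃ j, exactTilted.ρ n a ⬝ᵥ flat (Qm j) = mm a)
    (U : exactTilted.A n → Option (Fin r) → ℝ) (V : Finset (Fin n) × ι → Option (Fin r) → ℝ) (hU : ∀ a i, 0 ≤ U a i) (hV : ∀ p i, 0 ≤ V p i)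
    (hfac : ∀ a b j, (exactTilted.β n a + mm a) - exactTilted.ρ n a ⬝ᵥ (udPt b + flat (Qm j)) = ∑ i, U a i * V (b, j) i) :
    3 ^ (k - D.card) ≤ (r + 1) * 2 ^ (k - D.card) := by
  obtain ⟨W, jstar, ht, hmax⟩ := exists_commonMax_of_edgesReadD β D Qm N hcone hw
  exact lawBody_bound_of_commonMaxD hβσ D (fun j => flat (Qm j)) W ht jstar hmax r mm hle hat U V hU hV hfac

/-- ★★★ **DECIDED WITH A FORCED-OUT SET**: every passenger whose nonzero pairwise vertex differences are read by the live face. -/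
theorem cor_add_bound_of_pairsReadD {β : Fin n → Fin k} {σ : Fin k → Fin n} (hβσ : ∀ i, β (σ i) = i) (D : Finset (Fin k))
    {ι : Type*} [Fintype ι] [Nonempty ι] (Qm : ι → Matrix (Fin n) (Fin n) ℝ)
    (hw : ∀ j j', Qm j ≠ Qm j' → ∃ U, faceZeroD β D U ∧ flat U ⬝ᵥ flat (Qm j - Qm j') ≠ 0) (r : ℕ)
    (hEF : HasEFOfSize (corPolytope n + convexHull ℝ (Set.range (fun j => flat (Qm j)))) r) :
    3 ^ (k - D.card) ≤ (r + 1) * 2 ^ (k - D.card) := by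
  obtain ⟨W, jstar, ht, hmax⟩ := exists_commonMax_of_pairsReadD β D Qm hw
  exact cor_add_bound_of_commonMaxD hβσ D (fun j => flat (Qm j)) W ht jstar hmax r hEF

/-- ★★★ **TOUCH-Z-OR-SPARSE**: differences living in dead columns or in few live columns ⇒ decided with the live blocks. -/
theorem cor_add_touchOrSparse_bound {β : Fin n → Fin k} {σ : Fin k → Fin n} (hβσ : ∀ i, β (σ i) = i) (D : Finset (Fin k))
    {ι : Type*} [Fintype ι] [Nonempty ι] (Qm : ι → Matrix (Fin n) (Fin n) ℝ) (Vs : ι → ι → Finset (Fin n))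
    (hG : ∀ j j' x y, (Qm j - Qm j') x y ≠ 0 → β y ∈ D ∨ y ∈ Vs j j')
    (hs : ∀ j j' i, i ∉ D → (Vs j j').card < bsize β i) (r : ℕ)
    (hEF : HasEFOfSize (corPolytope n + convexHull ℝ (Set.range (fun j => flat (Qm j)))) r) :
    3 ^ (k - D.card) ≤ (r + 1) * 2 ^ (k - D.card) :=
  cor_add_bound_of_pairsReadD hβσ D Qm
    (fun j j' hne => exists_witnessD β D _ (sub_ne_zero.mpr hne) (Vs j j') (hG j j') (hs j j')) r hEF

end DeadBlocks

/-! ### §12d MECHANISM α — the ENGINE, case `D = ∅` of §12c -/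

section CommonMax

variable {n k : ℕ}

/-- ★★ **TOP LAW, budget-free, ANY passenger** (the case `D = ∅` of `cor_add_bound_of_commonMaxD`). -/
theorem cor_add_bound_of_commonMax {β : Fin n → Fin k} {σ : Fin k → Fin n} (hβσ : ∀ i, β (σ i) = i)
    {ι : Type*} [Fintype ι] (q : ι → (Fin (n * n) → ℝ)) (W : Matrix (Fin n) (Fin n) ℝ)
    (htight : ∀ S : Finset (Fin k), flat W ⬝ᵥ udPt (bUn β S) = hCOR W) (jstar : ι)
    (hmax : ∀ (a : Finset (Fin n)) (j : ι), (udRow a + flat W) ⬝ᵥ q j ≤ (udRow a + flat W) ⬝ᵥ q jstar) (r : ℕ)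
    (hEF : HasEFOfSize (corPolytope n + convexHull ℝ (Set.range q)) r) :
    3 ^ k ≤ (r + 1) * 2 ^ k := by
  simpa using cor_add_bound_of_commonMaxD hβσ ∅ q W (fun S _ => htight S) jstar hmax r hEF

/-- the same with the standard blocks. -/
theorem cor_add_decided_of_commonMax (s c : ℕ) (hs : 0 < s) : ∃ n₀ : ℕ, ∀ n ≥ n₀, ∀ (hns : s ≤ n) {ι : Type} [Fintype ι]
    (q : ι → (Fin (n * n) → ℝ)) (W : Matrix (Fin n) (Fin n) ℝ),
    (∀ S : Finset (Fin (n / s)), flat W ⬝ᵥ udPt (bUn (βstd hs hns) S) = hCOR W) →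
    ∀ jstar : ι, (∀ (a : Finset (Fin n)) (j : ι), (udRow a + flat W) ⬝ᵥ q j ≤ (udRow a + flat W) ⬝ᵥ q jstar) →
    ∀ r : ℕ, HasEFOfSize (corPolytope n + convexHull ℝ (Set.range q)) r → T c n < r := by
  obtain ⟨n₀, hn₀⟩ := T_lt_of_block_div s hs c
  refine ⟨n₀, fun n hn hns ι _ q W htight jstar hmax r hEF => hn₀ n hn r ?_⟩
  exact cor_add_bound_of_commonMax (βstd_σstd hs hns) q W htight jstar hmax r hEF

end CommonMax

/-! ### §12e vertex differences read by the face-zero directions (case `D = ∅`): sparse differences -/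

section PairsRead

variable {n k : ℕ}

/-- ★★ **GENERICITY, vertex-pair version** (the case `D = ∅` of `exists_commonMax_of_pairsReadD`). -/
theorem exists_commonMax_of_pairsRead (β : Fin n → Fin k) {ι : Type*} [Fintype ι] [Nonempty ι]
    (Qm : ι → Matrix (Fin n) (Fin n) ℝ)
    (hw : ∀ j j', Qm j ≠ Qm j' → ∃ U, faceZero β U ∧ flat U ⬝ᵥ flat (Qm j - Qm j') ≠ 0) :
    ∃ W : Matrix (Fin n) (Fin n) ℝ, ∃ jstar : ι, (∀ S, flat W ⬝ᵥ udPt (bUn β S) = hCOR W) ∧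
      ∀ (a : Finset (Fin n)) (j : ι), (udRow a + flat W) ⬝ᵥ flat (Qm j) ≤ (udRow a + flat W) ⬝ᵥ flat (Qm jstar) := by
  obtain ⟨W, jstar, ht, hmax⟩ := exists_commonMax_of_pairsReadD β ∅ Qm
    (fun j j' hne => by obtain ⟨U, hU, hr⟩ := hw j j' hne; exact ⟨U, hU.toD ∅, hr⟩)
  exact ⟨W, jstar, fun S => ht S (Finset.disjoint_empty_right S), hmax⟩

/-- ★★★ **EVERY PASSENGER WHOSE VERTEX DIFFERENCES ARE READ BY THE FACE IS DECIDED** (top law, budget-free, any shape). -/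
theorem cor_add_bound_of_pairsRead {β : Fin n → Fin k} {σ : Fin k → Fin n} (hβσ : ∀ i, β (σ i) = i)
    {ι : Type*} [Fintype ι] [Nonempty ι] (Qm : ι → Matrix (Fin n) (Fin n) ℝ)
    (hw : ∀ j j', Qm j ≠ Qm j' → ∃ U, faceZero β U ∧ flat U ⬝ᵥ flat (Qm j - Qm j') ≠ 0) (r : ℕ)
    (hEF : HasEFOfSize (corPolytope n + convexHull ℝ (Set.range (fun j => flat (Qm j)))) r) :
    3 ^ k ≤ (r + 1) * 2 ^ k := by
  obtain ⟨W, jstar, ht, hmax⟩ := exists_commonMax_of_pairsRead β Qm hw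
  exact cor_add_bound_of_commonMax hβσ (fun j => flat (Qm j)) W ht jstar hmax r hEF

/-- ★★★ **SPARSE DIFFERENCES**: pairwise differences with column support smaller than every block ⇒ `3^k ≤ (r+1)·2^k`. -/
theorem cor_add_sparseDiff_bound {β : Fin n → Fin k} {σ : Fin k → Fin n} (hβσ : ∀ i, β (σ i) = i)
    {ι : Type*} [Fintype ι] [Nonempty ι] (Qm : ι → Matrix (Fin n) (Fin n) ℝ) (Vs : ι → ι → Finset (Fin n))
    (hG : ∀ j j' x y, (Qm j - Qm j') x y ≠ 0 → y ∈ Vs j j') (hs : ∀ j j' i, (Vs j j').card < bsize β i) (r : ℕ)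
    (hEF : HasEFOfSize (corPolytope n + convexHull ℝ (Set.range (fun j => flat (Qm j)))) r) :
    3 ^ k ≤ (r + 1) * 2 ^ k := by
  classical
  refine cor_add_bound_of_pairsRead hβσ Qm (fun j j' hne => ?_) r hEF
  let e := Fintype.equivFin (ι × ι)
  have h := exists_witness_of_sparse β (fun t : Fin (Fintype.card (ι × ι)) => Qm (e.symm t).1 - Qm (e.symm t).2)
    (fun t => Vs (e.symm t).1 (e.symm t).2) (fun t x y hxy => hG _ _ x y hxy) (fun t i => hs _ _ i) (e (j, j'))
  simp only [e, Equiv.symm_apply_apply] at h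
  exact h (sub_ne_zero.mpr hne)

/-- the rate in `n` for a fixed column-support bound `s`. -/
theorem cor_add_sparseDiff_decided (s c : ℕ) (hs : 0 < s) : ∃ n₀ : ℕ, ∀ n ≥ n₀, ∀ {ι : Type} [Fintype ι] [Nonempty ι]
    (Qm : ι → Matrix (Fin n) (Fin n) ℝ) (Vs : ι → ι → Finset (Fin n)),
    (∀ j j' x y, (Qm j - Qm j') x y ≠ 0 → y ∈ Vs j j') → (∀ j j', (Vs j j').card < s) → ∀ r : ℕ,
    HasEFOfSize (corPolytope n + convexHull ℝ (Set.range (fun j => flat (Qm j)))) r → T c n < r := by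
  obtain ⟨n₀, hn₀⟩ := T_lt_of_block_div s hs c
  refine ⟨max n₀ s, fun n hn ι _ _ Qm Vs hG hVs r hEF => hn₀ n (le_of_max_le_left hn) r ?_⟩
  have hns : s ≤ n := le_of_max_le_right hn
  exact cor_add_sparseDiff_bound (βstd_σstd hs hns) Qm Vs hG (fun j j' i => lt_of_lt_of_le (hVs j j') (le_bsize_βstd hs hns i)) r hEF

/-- ★★★ the WINDOW form for SPARSE DIFFERENCES (any passenger; every `n`). -/
theorem cor_add_sparseDiff_decided_window (c n s : ℕ) (hs : 0 < s) (hwin : s * (2 * (Nat.log 2 n + c) ^ c + 6) ≤ n)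
    {ι : Type*} [Fintype ι] [Nonempty ι] (Qm : ι → Matrix (Fin n) (Fin n) ℝ) (Vs : ι → ι → Finset (Fin n))
    (hG : ∀ j j' x y, (Qm j - Qm j') x y ≠ 0 → y ∈ Vs j j') (hVs : ∀ j j', (Vs j j').card < s) (r : ℕ)
    (hEF : HasEFOfSize (corPolytope n + convexHull ℝ (Set.range (fun j => flat (Qm j)))) r) : T c n < r := by
  have hns : s ≤ n := le_trans (Nat.le_mul_of_pos_right s (by omega)) hwin
  have hk : 2 * (Nat.log 2 n + c) ^ c + 6 ≤ n / s := (Nat.le_div_iff_mul_le hs).mpr (by rw [mul_comm]; exact hwin)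
  exact T_lt_of_block_uniform c n (n / s) r hk (cor_add_sparseDiff_bound (βstd_σstd hs hns) Qm Vs hG
    (fun j j' i => lt_of_lt_of_le (hVs j j') (le_bsize_βstd hs hns i)) r hEF)

end PairsRead

/-! ### §12f the RATE with a forced-out set `Z` of at most half the blocks -/

section DeadRate

variable {n k : ℕ}

theorem three_two_pow_mono {m m' r : ℕ} (hm : m' ≤ m) (h : 3 ^ m ≤ (r + 1) * 2 ^ m) : 3 ^ m' ≤ (r + 1) * 2 ^ m' := by
  obtain ⟨d, rfl⟩ := Nat.exists_eq_add_of_le hm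
  have h2 : 0 < 2 ^ d := Nat.two_pow_pos d
  have h23 : 2 ^ d ≤ 3 ^ d := Nat.pow_le_pow_left (by norm_num) d
  have h1 : 3 ^ m' * 2 ^ d ≤ (r + 1) * 2 ^ m' * 2 ^ d := by
    calc 3 ^ m' * 2 ^ d ≤ 3 ^ m' * 3 ^ d := Nat.mul_le_mul_left _ h23
      _ = 3 ^ (m' + d) := (pow_add 3 m' d).symm
      _ ≤ (r + 1) * 2 ^ (m' + d) := h
      _ = (r + 1) * 2 ^ m' * 2 ^ d := by rw [pow_add, mul_assoc]
  exact Nat.le_of_mul_le_mul_right h1 h2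

/-- ★★★ **TOUCH-Z-OR-SPARSE, RATE FORM** (blocks of size `s`, `2|Z| ≤ n/s`; `Z = ∅`: `cor_add_sparseDiff_decided`). -/
theorem cor_add_touchOrSparse_decided (s c : ℕ) (hs : 0 < s) : ∃ n₀ : ℕ, ∀ n ≥ n₀, ∀ Z : Finset (Fin n), 2 * Z.card ≤ n / s →
    ∀ {ι : Type} [Fintype ι] [Nonempty ι] (Qm : ι → Matrix (Fin n) (Fin n) ℝ) (Vs : ι → ι → Finset (Fin n)),
    (∀ j j' x y, (Qm j - Qm j') x y ≠ 0 → y ∈ Z ∨ y ∈ Vs j j') → (∀ j j', (Vs j j').card < s) → ∀ r : ℕ,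
    HasEFOfSize (corPolytope n + convexHull ℝ (Set.range (fun j => flat (Qm j)))) r → T c n < r := by
  classical
  obtain ⟨n₀, hn₀⟩ := T_lt_of_block_div (s * 2) (by omega) c
  refine ⟨max n₀ s, fun n hn Z hZ ι _ _ Qm Vs hG hVs r hEF => hn₀ n (le_of_max_le_left hn) r ?_⟩
  have hns : s ≤ n := le_of_max_le_right hn
  let β := βstd hs hns
  let D : Finset (Fin (n / s)) := Z.image β
  have hD : D.card ≤ Z.card := Finset.card_image_le
  have key := cor_add_touchOrSparse_bound (βstd_σstd hs hns) D Qm Vs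
    (fun j j' x y h => (hG j j' x y h).imp_left fun hy => Finset.mem_image_of_mem β hy)
    (fun j j' i _ => lt_of_lt_of_le (hVs j j') (le_bsize_βstd hs hns i)) r hEF
  refine three_two_pow_mono ?_ key
  rw [← Nat.div_div_eq_div_mul]
  omega

end DeadRate

/-! ### §12g ★★★ COLUMN-HIT PASSENGERS (singleton live blocks): few vertices, `CUT_n` -/

section ColumnHit

variable {n : ℕ}

/-- ★★★ **COLUMN-HIT BOUND.** -/
theorem cor_add_bound_of_columnHit {ι : Type*} [Fintype ι] [Nonempty ι] (Qm : ι → Matrix (Fin n) (Fin n) ℝ) (Z : Finset (Fin n))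
    (hZ : ∀ j j', Qm j ≠ Qm j' → ∃ x, ∃ y ∈ Z, (Qm j - Qm j') x y ≠ 0) (r : ℕ)
    (hEF : HasEFOfSize (corPolytope n + convexHull ℝ (Set.range (fun j => flat (Qm j)))) r) :
    3 ^ (n - Z.card) ≤ (r + 1) * 2 ^ (n - Z.card) :=
  cor_add_bound_of_pairsReadD (β := id) (σ := id) (fun _ => rfl) Z Qm
    (fun j j' hne => by
      obtain ⟨x, y, hy, hxy⟩ := hZ j j' hne
      exact ⟨Es x y, Es_faceZeroD id Z (Or.inr hy), by rw [flat_Es_dotProduct_flat]; exact hxy⟩) r hEF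

/-- rate form: `2|Z| ≤ n` ⇒ `xc > T c n` eventually. -/
theorem cor_add_columnHit_decided (c : ℕ) : ∃ n₀ : ℕ, ∀ n ≥ n₀, ∀ {ι : Type} [Fintype ι] [Nonempty ι]
    (Qm : ι → Matrix (Fin n) (Fin n) ℝ) (Z : Finset (Fin n)), 2 * Z.card ≤ n →
    (∀ j j', Qm j ≠ Qm j' → ∃ x, ∃ y ∈ Z, (Qm j - Qm j') x y ≠ 0) → ∀ r : ℕ,
    HasEFOfSize (corPolytope n + convexHull ℝ (Set.range (fun j => flat (Qm j)))) r → T c n < r := by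
  obtain ⟨n₀, hn₀⟩ := T_lt_of_block_div 2 (by norm_num) c
  refine ⟨n₀, fun n hn ι _ _ Qm Z hZ hread r hEF => hn₀ n hn r ?_⟩
  refine three_two_pow_mono ?_ (cor_add_bound_of_columnHit Qm Z hread r hEF)
  omega

/-- ★★★ **FEW-VERTEX PASSENGERS ARE DECIDED** (`2K² ≤ n` vertices, any shape). -/
theorem cor_add_fewVertex_decided (c : ℕ) : ∃ n₀ : ℕ, ∀ n ≥ n₀, ∀ {ι : Type} [Fintype ι] [Nonempty ι]
    (Qm : ι → Matrix (Fin n) (Fin n) ℝ), 2 * Fintype.card ι ^ 2 ≤ n → ∀ r : ℕ,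
    HasEFOfSize (corPolytope n + convexHull ℝ (Set.range (fun j => flat (Qm j)))) r → T c n < r := by
  classical
  obtain ⟨n₀, hn₀⟩ := cor_add_columnHit_decided c
  refine ⟨n₀, fun n hn ι _ _ Qm hK r hEF => ?_⟩
  -- one nonzero column per ordered pair of distinct vertices
  have hcol : ∀ p : ι × ι, Qm p.1 ≠ Qm p.2 → ∃ x y, (Qm p.1 - Qm p.2) x y ≠ 0 := by
    intro p hne
    by_contra h
    push Not at h
    exact hne (sub_eq_zero.mp (Matrix.ext fun x y => by rw [h x y]; rfl))
  let col : ι × ι → Finset (Fin n) := fun p =>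
    if h : Qm p.1 ≠ Qm p.2 then {(Classical.choose_spec (hcol p h)).choose} else ∅
  let Z : Finset (Fin n) := Finset.univ.biUnion col
  have hZcard : Z.card ≤ Fintype.card ι ^ 2 := by
    calc Z.card ≤ ∑ p : ι × ι, (col p).card := Finset.card_biUnion_le
      _ ≤ ∑ _p : ι × ι, 1 := Finset.sum_le_sum fun p _ => by
          show (col p).card ≤ 1
          dsimp only [col]
          split_ifs
          · rw [Finset.card_singleton]
          · simp
      _ = Fintype.card ι ^ 2 := by simp [sq, Fintype.card_prod]
  refine hn₀ n hn Qm Z (by omega) (fun j j' hne => ?_) r hEF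
  have h1 := (Classical.choose_spec (hcol (j, j') hne)).choose_spec
  refine ⟨Classical.choose (hcol (j, j') hne), (Classical.choose_spec (hcol (j, j') hne)).choose, ?_, h1⟩
  refine Finset.mem_biUnion.mpr ⟨(j, j'), Finset.mem_univ _, ?_⟩
  show _ ∈ (if h : Qm (j, j').1 ≠ Qm (j, j').2 then _ else _)
  rw [dif_pos hne]
  exact Finset.mem_singleton_self _

/-- the cut matrices `δ(S)_{uv} = [u ∈ S ⊕ v ∈ S]`. -/
def cutMat (S : Finset (Fin n)) : Matrix (Fin n) (Fin n) ℝ := fun u v => if (u ∈ S ↔ v ∈ S) then 0 else 1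

theorem cutMat_eq_of_column {S S' : Finset (Fin n)} (y₀ : Fin n) (h : ∀ x, cutMat S x y₀ = cutMat S' x y₀) : cutMat S = cutMat S' := by
  have h' : ∀ x, ((x ∈ S ↔ y₀ ∈ S) ↔ (x ∈ S' ↔ y₀ ∈ S')) := by
    intro x
    have hx := h x
    unfold cutMat at hx
    by_cases h1 : (x ∈ S ↔ y₀ ∈ S)
    · by_cases h2 : (x ∈ S' ↔ y₀ ∈ S')
      · exact iff_of_true h1 h2
      · rw [if_pos h1, if_neg h2] at hx; exact absurd hx zero_ne_one
    · by_cases h2 : (x ∈ S' ↔ y₀ ∈ S')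
      · rw [if_neg h1, if_pos h2] at hx; exact absurd hx one_ne_zero
      · exact iff_of_false h1 h2
  have key : ∀ u v, ((u ∈ S ↔ v ∈ S) ↔ (u ∈ S' ↔ v ∈ S')) := fun u v => by
    have hu := h' u
    have hv := h' v
    tauto
  ext u v
  unfold cutMat
  by_cases h1 : (u ∈ S ↔ v ∈ S)
  · rw [if_pos h1, if_pos ((key u v).mp h1)]
  · rw [if_neg h1, if_neg (fun h2 => h1 ((key u v).mpr h2))]

/-- ★★★ **`COR_n + CUT_n` is hard**: `3^{n−1} ≤ (r+1)·2^{n−1}` (`Z` = one column). -/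
theorem cor_add_cut_bound (hn : 0 < n) (r : ℕ)
    (hEF : HasEFOfSize (corPolytope n + convexHull ℝ (Set.range (fun S : Finset (Fin n) => flat (cutMat S)))) r) :
    3 ^ (n - 1) ≤ (r + 1) * 2 ^ (n - 1) := by
  classical
  have key := cor_add_bound_of_columnHit (fun S : Finset (Fin n) => cutMat S) {(⟨0, hn⟩ : Fin n)}
    (fun S S' hne => by
      by_contra h
      push Not at h
      apply hne
      apply cutMat_eq_of_column (⟨0, hn⟩ : Fin n)
      intro x
      have := h x ⟨0, hn⟩ (Finset.mem_singleton_self _)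
      rw [Matrix.sub_apply] at this
      linarith) r hEF
  rwa [Finset.card_singleton] at key

end ColumnHit

/-! ### §12h ★★★ FUNCTION-GRAPH PASSENGERS `[M u = v]` (`PM(K_n)`, Birkhoff, any family of maps) -/

section FuncGraph

variable {n k : ℕ}

/-- the graph matrix `[M u = v]` of a map. -/
def graphMat (M : Fin n → Fin n) : Matrix (Fin n) (Fin n) ℝ := fun u v => if M u = v then 1 else 0

theorem exists_faceZero_reads_graphMat (β : Fin n → Fin k) (h2 : ∀ i, 2 ≤ bsize β i) {M M' : Fin n → Fin n}
    (hne : graphMat M ≠ graphMat M') : ∃ U, faceZero β U ∧ flat U ⬝ᵥ flat (graphMat M - graphMat M') ≠ 0 := by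
  classical
  obtain ⟨x, hx⟩ : ∃ x, M x ≠ M' x := by
    by_contra h
    push Not at h
    exact hne (by unfold graphMat; ext u v; rw [h u])
  obtain ⟨y', hy'A, hy'ne⟩ : ∃ y' ∈ Finset.univ.filter (fun z => β z = β (M x)), y' ≠ M x := by
    by_contra h
    push Not at h
    have hsub : Finset.univ.filter (fun z => β z = β (M x)) ⊆ {M x} := fun z hz => Finset.mem_singleton.mpr (h z hz)
    have := (Finset.card_le_card hsub).trans_eq (Finset.card_singleton _)
    exact absurd (h2 (β (M x))) (by unfold bsize; omega)
  have hβ : β y' = β (M x) := (Finset.mem_filter.mp hy'A).2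
  refine ⟨Ed x (M x) y', Ed_faceZero β hβ.symm, ?_⟩
  rw [flat_Ed_dotProduct_flat, Matrix.sub_apply, Matrix.sub_apply]
  unfold graphMat
  rw [if_pos rfl, if_neg (Ne.symm hx), if_neg (Ne.symm hy'ne)]
  split_ifs <;> norm_num

/-- ★★★ **FUNCTION-GRAPH PASSENGERS ARE DECIDED** (any index family; `PM(K_n)`, Birkhoff / assignment vertices, TSP successor maps …). -/
theorem cor_add_funcGraph_bound {β : Fin n → Fin k} {σ : Fin k → Fin n} (hβσ : ∀ i, β (σ i) = i) (h2 : ∀ i, 2 ≤ bsize β i)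
    {ι : Type*} [Fintype ι] [Nonempty ι] (M : ι → (Fin n → Fin n)) (r : ℕ)
    (hEF : HasEFOfSize (corPolytope n + convexHull ℝ (Set.range (fun j => flat (graphMat (M j))))) r) :
    3 ^ k ≤ (r + 1) * 2 ^ k :=
  cor_add_bound_of_pairsRead hβσ (fun j => graphMat (M j)) (fun _ _ hne => exists_faceZero_reads_graphMat β h2 hne) r hEF

theorem cor_add_funcGraph_decided (c : ℕ) : ∃ n₀ : ℕ, ∀ n ≥ n₀, ∀ {ι : Type} [Fintype ι] [Nonempty ι]
    (M : ι → (Fin n → Fin n)) (r : ℕ),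
    HasEFOfSize (corPolytope n + convexHull ℝ (Set.range (fun j => flat (graphMat (M j))))) r → T c n < r := by
  obtain ⟨n₀, hn₀⟩ := T_lt_of_block_div 2 (by norm_num) c
  refine ⟨max n₀ 2, fun n hn ι _ _ M r hEF => hn₀ n (le_of_max_le_left hn) r ?_⟩
  have hns : 2 ≤ n := le_of_max_le_right hn
  exact cor_add_funcGraph_bound (βstd_σstd (by norm_num) hns) (le_bsize_βstd (by norm_num) hns) M r hEF

/-- ★★★ **`exactTilted.Law` RESTRICTED TO FUNCTION-GRAPH PASSENGERS HOLDS** — C′ in its literal currency (the budget hypothesis is not used). -/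
theorem exactTilted_lawBody_funcGraph (c : ℕ) : ∃ n₀ : ℕ, ∀ n ≥ n₀, ∀ (K : ℕ) (M : Fin (K + 1) → (Fin n → Fin n)) (r : ℕ),
    HasEFOfSize (convexHull ℝ (Set.range (fun j => flat (graphMat (M j))))) r →
    ∀ mm : exactTilted.A n → ℝ, (∀ a j, exactTilted.ρ n a ⬝ᵥ flat (graphMat (M j)) ≤ mm a) →
      (∀ a, ∃ j, exactTilted.ρ n a ⬝ᵥ flat (graphMat (M j)) = mm a) →
    ∀ (U : exactTilted.A n → Option (Fin r) → ℝ) (V : Finset (Fin n) × Fin (K + 1) → Option (Fin r) → ℝ),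
      (∀ a i, 0 ≤ U a i) → (∀ p i, 0 ≤ V p i) →
      (∀ a b j, (exactTilted.β n a + mm a) - exactTilted.ρ n a ⬝ᵥ (udPt b + flat (graphMat (M j))) = ∑ i, U a i * V (b, j) i) →
      T c n < r := by
  obtain ⟨n₀, hn₀⟩ := T_lt_of_block_div 2 (by norm_num) c
  refine ⟨max n₀ 2, fun n hn K M r _ mm hle hat U V hU hV hfac => hn₀ n (le_of_max_le_left hn) r ?_⟩
  have hns : 2 ≤ n := le_of_max_le_right hn
  obtain ⟨W, jstar, ht, hmax⟩ := exists_commonMax_of_pairsRead (βstd (by norm_num) hns) (fun j => graphMat (M j))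
    (fun _ _ hne => exists_faceZero_reads_graphMat _ (le_bsize_βstd (by norm_num) hns) hne)
  have := lawBody_bound_of_commonMaxD (βstd_σstd (by norm_num) hns) ∅ (fun j => flat (graphMat (M j))) W
    (fun S _ => ht S) jstar hmax r mm hle hat U V hU hV hfac
  simpa using this

end FuncGraph

end Summit.ValiantsHypothesis.ValiantsHypothesis.Cruxes.NNDivisionHard.ExactPencil

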